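import Summits.AtomisticToContinuum.HydrodynamicLimit.Theses.MourreKoopmanCharges
import Summits.AtomisticToContinuum.HydrodynamicLimit.Theorems.MourreKoopmanChargesStressStrongMixingTorusStressRawEqCov
import Summits.AtomisticToContinuum.HydrodynamicLimit.Theorems.MourreKoopmanChargesStressStrongMixingStressFramework
import Summits.AtomisticToContinuum.HydrodynamicLimit.Theorems.MourreKoopmanChargesStressStrongMixingTorusStressCovIdentification
import Summits.AtomisticToContinuum.HydrodynamicLimit.Theorems.MourreKoopmanChargesStressStrongMixingObservableSpan
import Summits.AtomisticToContinuum.HydrodynamicLimit.Theorems.MourreKoopmanChargesStressStrongMixingFoelnerPositivity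
import Summits.AtomisticToContinuum.HydrodynamicLimit.Theorems.MourreKoopmanChargesStressStrongMixingGibbsMoments
import Summits.AtomisticToContinuum.HydrodynamicLimit.Theorems.MourreKoopmanChargesStressStrongMixingEquilibriumFlowShiftCovariant
import Summits.AtomisticToContinuum.HydrodynamicLimit.Theorems.MourreKoopmanChargesStressStrongMixingDiluteGibbsDensityOne
import Summits.AtomisticToContinuum.HydrodynamicLimit.Theorems.MourreKoopmanChargesStressStrongMixingTorusStatics
import Summits.AtomisticToContinuum.HydrodynamicLimit.Theorems.MourreKoopmanChargesStressStrongMixingStressAutocorrelationZero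
import Summits.AtomisticToContinuum.HydrodynamicLimit.Theorems.MourreKoopmanChargesStressStrongMixingLowDensityGibbsUniqueness3
import Summits.AtomisticToContinuum.HydrodynamicLimit.Theorems.MourreKoopmanChargesStressStrongMixingTwoTimeClustering
import Summits.AtomisticToContinuum.HydrodynamicLimit.Theorems.MourreKoopmanChargesStressStrongMixingStaticClustering
import Summits.AtomisticToContinuum.HydrodynamicLimit.Theorems.MourreKoopmanChargesStressStrongMixingTwoTimeClusteringOfLocality
import Summits.AtomisticToContinuum.HydrodynamicLimit.Theorems.MourreKoopmanChargesStressStrongMixingTorusStressIdentificationPosOfTrig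
import Summits.AtomisticToContinuum.HydrodynamicLimit.Theorems.MourreKoopmanChargesStressStrongMixingTorusStressTrigReduction
import Summits.AtomisticToContinuum.HydrodynamicLimit.Theorems.MourreKoopmanChargesStressStrongMixingFlowLocalityOfInLaw
import Summits.AtomisticToContinuum.HydrodynamicLimit.Theorems.MourreKoopmanChargesStressStrongMixingWindowFourthMoments
import Literature.MathematicalPhysics.KineticTheory.Georgii1995HardSphereCanonicalLocalLimit
import Literature.MathematicalPhysics.StatisticalMechanics.DiluteHardSphereGasProofs

/-!
# Birth skeleton for crux `StressStrongMixing` (stmt-AtomisticToContinuum-9584)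

Route `route-AtomisticToContinuum-MourreKoopmanCharges` (sub-problem `HydrodynamicLimit`), crux rank 5,
FIXED and imported BY NAME:
`Summit.AtomisticToContinuum.HydrodynamicLimit.Theses.MourreKoopmanCharges.StressStrongMixing` —
STRONG (non-Cesàro) EULER-SCALE MIXING OF THE KINETIC SHEAR STRESS with existence of the infinite-volume
autocorrelation: `∃ σ₀ ∀ σ ∈ (0,σ₀) ∀ θ > 0 ∃ c : ℝ → ℝ, c → 0 at ∞ ∧ ∀ Φ χ₁ χ₂ ∀ s ≥ 0,
(N+1)·E_eq[Π(χ₁)(Φ_{s(N+1)^{-1/3}} z)·Π(χ₂)(z)] → c(s)·∫χ₁χ₂`, `Π(χ)(z) = (N+1)⁻¹ Σᵢ χ(xᵢ) vᵢ⁰vᵢ¹`.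

## The line (the route's own two-layer plan for this crux, typed over the LANDED carriers)

Route file, TWO-LAYER PLAN: "StressStrongMixing ⇐ … → [LAP near 0 off the slow algebra] → GlobalMourre →
StressStrongMixing, glue 'LAP ⇒ a.c. spectral measure of Π ⇒ Riemann–Lebesgue'", together with the support
`FluctuationFramework` (stmt-9702, informal): "(1) Spohn's fluctuation space ℋ of the infinite-volume hard-sphere
Gibbs state … Alexander's flow as a unitary Koopman group on it; (2) TorusToFluctuationSpace: the torus two-time
covariances × (N+1) converge to `∫χ₁χ₂ · ⟪U_s[A], [B]⟫_ℋ`".  Since 2026-08-15 the carriers are Lean objects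
(`Literature.MathematicalPhysics.KineticTheory.HardSphereFluctuationData`, `.koopman`, `.fluct`, `cellObs`,
`IdentifiesTorusCovariances`; `Literature.Analysis.FluidPDE.IsHardSphereGibbs`, `InfiniteHardSphereFlow`,
`IsEquilibriumFlow`), so the plan types as THREE stubs and a proved composition:

* `stub_stressFramework` (L; FluctuationFramework (1) at density one) — for small reduced diameter `σ` and every
  temperature `θ` there are an activity `z > 0` and hard-sphere fluctuation data `F` (Spohn's `ℋ`) whose state is a
  DLR Gibbs state of the hard-sphere gas at `(σ, z, β = θ⁻¹)` of DENSITY ONE (`∫ cellCharge 0 dμ = 1`: the blow-up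
  `x ↦ (N+1)^{1/3}x` of the torus system has density `1` and diameter `σ`), whose flow is a.e. an equilibrium
  Alexander flow, and for which the kinetic shear stress cell observable `Σ_{q∈[0,1)³} v⁰v¹` is a local observable
  (space–time summable truncated correlations).  Content: low-activity Gibbs state (Ruelle 1969; density is
  continuous increasing in `z`, `ρ(z) = z + O(z²σ³)`, so density one is reached inside the uniqueness regime
  `z < z₀(σ) ≍ σ⁻³` once `σ` is small), Alexander 1975/76 (`InfiniteHardSphereFlow.nonempty`), and SPACE–TIME
  clustering of the equilibrium hard-sphere dynamics at fixed small packing (open; Spohn 1991 Part I §7.1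
  Condition 2.1 is the static half).
* `stub_torusStressIdentification` (L; FluctuationFramework (2) for the stress = TorusToFluctuationSpace) — on any
  such `F`, the crux's torus two-time RAW moments of the stress fields (canonical law `localGibbsLaw σ 1 0 θ`,
  `N+1` spheres of diameter `σ(N+1)^{-1/3}`, microscopic time `s`) converge, for every flow family, continuous
  `χ₁, χ₂` and `s ≥ 0`, to `c_F(s)·∫χ₁χ₂` with `c_F(s) := ⟪U_s ξ_Π, ξ_Π⟫_ℋ` (raw = truncated moments here: `v⁰v¹` is
  centred under the canonical law, velocities being independent centred Maxwellians given the positions).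
  Content: locality IN LAW of Alexander's dynamics at fixed kinetic time + equivalence of ensembles at low
  density (Spohn 1991 Part I (7.14)–(7.15); the dilute analogue is BGSS CPAM 2023).  This is exactly the shape
  `IdentifiesTorusCovariances σ θ F` of `FluctuationSpace.lean`, specialised to `h₁ = h₂ = v⁰v¹`.
* `stub_stressRajchman` (XL; THE SPECTRAL CONTENT — hardest) — on any such `F`, `c_F(s) = ⟪U_s ξ_Π, ξ_Π⟫_ℋ → 0`
  as `s → ∞`: the spectral measure of the stress class under the Koopman group is Rajchman (no atom — in
  particular no component along a conserved vector, cf. OneBodyCompleteness — and no recurrent singular part).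
  Intended proofs: the route's engine (flow-adapted conjugate operator, LAP off thresholds ⇒ a.c. spectral measure
  ⇒ Riemann–Lebesgue; Mourre 1981, Amrein–Boutet de Monvel–Georgescu 1996) or directly the commutator criteria
  for strong mixing of unitary/Koopman groups (Tiedra de Aldecoa, doi:10.1017/etds.2015.47), which conclude
  Rajchman decay without absolute continuity.  MD/kinetic theory: `c(s) ≍ s^{-3/2}` (Ernst–Hauge–van Leeuwen
  1971, Alder–Wainwright 1970).

Composition `StressStrongMixing_of` (PROVED, pure logic): `σ₀ := min` of the three thresholds; for `σ < σ₀`,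
`θ > 0` take `z, F` from the framework stub, put `c := c_F`, decay from `stub_stressRajchman`, convergence from
`stub_torusStressIdentification` (whose limit is written in the crux's order `c_F(s)·∫χ₁χ₂`).

Hardest stub: `stub_stressRajchman` (it carries the whole positive-commutator engine; its failure mode is the
crux's recorded one — an eigenvalue or singular-continuous component of `iL` seen by the stress, or
threshold degeneracy at zero wavenumber spoiling pointwise decay).

Disproof used: none on file for this crux (`ledger crux ls stmt-AtomisticToContinuum-9584`: no workfiles,
no `Disproof.lean`, no landed `Negative/` lemma) — nothing to honour or avoid yet.  Negatives index consulted.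

Barriers: `BoltzmannHypothesisBarrier` — the ideal gas (free flight) satisfies the framework and the
identification stubs but NOT `stub_stressRajchman` (`c(s) ≡ θ²`, cf. the proved `IdealGasNoDecay`): the decay stub
is where collisions must bite, as the route intends; `HighMomentumCutoffBarrier` — not met (equilibrium Gaussian
moments, `v⁰v¹ ∈ L²(M_θ)`).

BC3 (this registrar): `lean check` rc 0, sorries = the three `stub_*` only; per-stub probes
`stub → StressStrongMixing` and `stub → _root_.HydrodynamicLimit` by `first | exact? | simpa | aesop` all FAIL
(see the registrar's NOTES.md for the raw outputs).

## Reshape 1 (lead c1, 2026-08-17): B split into B1 ∧ B2 (four stubs, composition re-proved)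

`stub_torusStressIdentification` (B) is no longer a stub: it is PROVED here (`torusStressIdentification_of`)
from two registered stubs,
* `stub_torusStressRawEqCov` (B1, M, provable now — finite-`N` statics on the torus): for `0 < σ ≤ 1/2`, `θ > 0`,
  every flow family, continuous `χ₁, χ₂`, real `s` and every `N`, the crux's RAW moment `torusStressMoment` equals
  `torusStressCov := (N+1)·Cov_{G_N}(Π(χ₁)∘Φ_{s(N+1)^{-1/3}}, Π(χ₂))` (the stress field is centred under the
  canonical law: independent centred Gaussian velocities given the positions; `L²` statics + invariance of `G_N`);
* `stub_torusStressCovIdentification` (B2, L — the genuine finite→infinite-volume content): the covariance form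
  converges to `c_F(s)·∫χ₁χ₂` on density-one frameworks, i.e. the `h₁ = h₂ = v⁰v¹`, `s ≥ 0` instance of the typed
  shape `IdentifiesTorusCovariances` (support FluctuationFramework 9702 (2)) — for the CENTRED stress profile the
  canonical number-charge correction that kills the general shape (Theorems/MourreKoopmanChargesFluctuationFramework)
  vanishes.
`stub_stressFramework` (A) and `stub_stressRajchman` (C) are unchanged (names and signatures); `StressStrongMixing_of`
now takes `(hA hB1 hB2 hC)`; `lean check`: rc 0, sorries = the four `stub_*` only.

## Status (lead c2, 2026-08-17, wave 1)

* B1 `stub_torusStressRawEqCov` — CLOSED, landed p145407 (`Theorems/MourreKoopmanChargesStressStrongMixingTorusStressRawEqCov.lean`,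
  decl `…Theorems.MourreKoopmanChargesStressStrongMixing.stub_torusStressRawEqCov`); the `sorry` below is replaced by it.
* A `stub_stressFramework` — OPEN, reduced: `…Theorems.MourreKoopmanChargesStressStrongMixing.stressFramework_of` (p147060,
  `Theorems/MourreKoopmanChargesStressStrongMixingStressFramework.lean`) assembles `F` from four infinite-volume inputs:
  F1 a translation-invariant DLR state at diameter `σ`, density one (⇐ the UNPROVED named fact
  `Literature.MathematicalPhysics.StatisticalMechanics.RuelleDiluteHardSphereGas` + a missing scaling lemma for DLR states + IVT),
  F2 `InfiniteHardSphereFlow.nonempty` (Alexander, UNPROVED named fact), Fcov a.e. translation covariance of the equilibrium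
  flow (missing), F3 `IsLocalObservableSpace Φ μ (hardSphereObs Φ)` at fixed small packing — spatial summability of truncated
  correlations of TIME-EVOLVED local observables (OPEN, no print source).
* B2 `stub_torusStressCovIdentification` — OPEN (locality in law + equivalence of ensembles at fixed packing; no tree fact).
* C `stub_stressRajchman` — OPEN (the crux's spectral content; lead's).
`lean check`: rc 0, sorries = 3 (A, B2, C).

## Reshape 2 (lead c2, 2026-08-17, after wave 1): A ⇐ F1 ∧ F2 ∧ Fcov ∧ F3 (landed reduction), C ⇐ C1 (Riemann–Lebesgue)

* A `stub_stressFramework` is no longer a stub: it is PROVED here (`stressFramework_of_inputs`) from four registered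
  stubs through the landed reduction `…Theorems.MourreKoopmanChargesStressStrongMixing.stressFramework_of` (p147060):
  F1 `stub_diluteGibbsDensityOne` (L of a known kind: a translation-invariant DLR state of the hard-sphere gas at
  diameter `σ`, zero drift, inverse temperature `θ⁻¹`, of DENSITY ONE, for all small `σ` — Ruelle 1969 /
  Dobrushin–Sinai–Sukhov at unit diameter = the tree's UNPROVED named fact `RuelleDiluteHardSphereGas`, plus the
  scaling `x ↦ σx` of DLR states and the intermediate value theorem on the density), F2 `stub_alexanderExistence`
  (= the named fact `InfiniteHardSphereFlow.nonempty (d := Fin 3)`, Alexander 1976 Thm 5.2, UNPROVED in the tree),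
  Fcov `stub_equilibriumFlowShiftCovariant` (M/L: every equilibrium flow commutes with the spatial translations a.e.
  in every Gibbs state — conjugate the flow by a translation, use translation covariance of `gibbsSpec` and the
  named fact `InfiniteHardSphereFlow.unique`), F3 `stub_spaceClusteringDensityOne` (OPEN: the observable space
  `hardSphereObs Φ` — flow–shift span of the local polynomial observables — is admissible for the density-one dilute
  Gibbs state: `L²`, spatially integrable truncated correlations of TIME-EVOLVED local observables, non-negative
  structure factor; Spohn 1991 Part I §7.1 assumes it; no print source at fixed packing).
* C `stub_stressRajchman` is no longer a stub: it is PROVED here (`stressRajchman_of_spectralDensity`) from the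
  registered stub C1 `stub_stressSpectralDensity` — the a.c. branch of the route's plan ("LAP ⇒ a.c. spectral
  measure of Π ⇒ Riemann–Lebesgue"): on every density-one framework the stress autocorrelation is the cosine
  transform of an INTEGRABLE spectral density, `⟪U_s ξ_Π, ξ_Π⟫ = ∫ cos(sλ) ρ(λ) dλ` (XL, OPEN: the output of a
  limiting absorption principle for the Liouvillian at every frequency; MD/kinetic theory: `ρ` continuous with
  `ρ(λ) - ρ(0) ≍ -|λ|^{1/2}` from the `s^{-3/2}` tail) — and the glue IS the Riemann–Lebesgue lemma
  (`tendsto_integral_cos_mul_of_integrable`, from Mathlib's `Real.tendsto_integral_exp_smul_cocompact`).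
Stubs now: F1, F2, Fcov, F3, B2, C1 open (6) + B1 closed = 7 = stubs_max; `StressStrongMixing_of` takes
`(hF1 hF2 hFcov hF3 hB2 hC1)` (B1 discharged inside by the landed theorem); `lean check`: rc 0, sorries = 6.

## Reshape 3 (lead c2, 2026-08-17, after wave 2): named facts isolated, the three open cores made minimal

* Fcov is PROVED from Fu (`equilibriumFlowShiftCovariant_of_unique`, p152524; translation covariance of the DLR
  specification p152177); F2 and Fu are ONE stub `stub_alexanderFlow := nonempty ∧ unique` (Alexander 1976 Thm 5.2 +
  Cor. 5.4, named, unproved).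
* F3 is replaced by the MINIMAL observable space `flowShiftSpan Φ {five cell charges, cell shear stress}` and split along
  the landed span reductions (`memLp_of_mem_flowShiftSpan`, `integrable_cov_of_mem_flowShiftSpan`, p151969) into
  F3static `stub_momentsAndPositivity` (L of a known kind: `L²` moments of the six generators + Følner positivity) and
  F3b `stub_twoTimeClustering` (OPEN core: `x ↦ Cov_μ(a, (b ∘ Φ_t) ∘ τ_x) ∈ L¹(ℝ³)` for the six generators and every `t`);
  A is assembled by `stressFramework_of_min` (landed `exists_framework_of_ae`).
* B2 is split along the landed reduction `torusStressCovIdentification_of` (p150204) into Fu (inside `stub_alexanderFlow`),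
  M4 `stub_densityOneGibbsUnique` (L of a known kind: ⇐ named `HardSphereGibbsLowDensityUniqueness` + the landed dilation
  covariance of DLR states `isHardSphereGibbs_map_dilate`, wave 2) and B2core `stub_torusStressIdentificationCore` (OPEN).
* F1 `stub_diluteGibbsDensityOne` stays registered (wave-2 worker: ⇐ named `RuelleDiluteHardSphereGas` + dilation + IVT,
  helper `diluteGibbsDensityOne_of_ruelle` registered).
Stubs now (7 = stubs_max): F1 `stub_diluteGibbsDensityOne`, `stub_alexanderFlow`, F3static `stub_momentsAndPositivity`,
F3b `stub_twoTimeClustering`, M4 `stub_densityOneGibbsUnique`, B2core `stub_torusStressIdentificationCore`,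
C1 `stub_stressSpectralDensity`; OPEN cores: F3b, B2core, C1; the rest are named published facts or L-sized plumbing.
`StressStrongMixing_of (hF1 hAlex hF3s hF3b hM4 hcore hC1)`; `lean check`: rc 0, sorries = 7.

## Reshape 4 (lead c2, 2026-08-17, wave 3 running): positivity of the structure factor PROVED (Følner lemma)

* The landed Følner / Gaussian-window lemma `integral_cov_spatialShift_nonneg` (p153941,
  `Theorems/MourreKoopmanChargesStressStrongMixingFoelnerPositivity.lean`: `0 ≤ ∫ Cov_μ(f, f ∘ τ_x) dx` for measurable
  `f ∈ L²(μ)` with integrable truncated correlations under a translation-invariant probability measure) discharges the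
  positivity half of F3static: span elements are measurable (`measurable_of_mem_flowShiftSpan`), in `L²`, and have
  integrable truncated correlations (F3b via `integrable_cov_of_mem_flowShiftSpan`), so `isLocalObservableSpace_min_of` now
  derives `form_self_nonneg` itself.
* F3static `stub_momentsAndPositivity` is therefore replaced by the purely STATIC F3a `stub_generatorMoments`: the six
  generators are in `L²(μ)` under EVERY hard-sphere DLR state (no smallness, no dynamics; wave-3 worker target
  `memLp_generators_of_isHardSphereGibbs`), and F1 ⇐ Ruelle, M4 ⇐ LowDensU are glued as in reshape 3.
Stubs now (7): named facts `stub_ruelleDiluteGas`, `stub_alexanderFlow`, `stub_lowDensityGibbsUniqueness`; static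
known-kind `stub_generatorMoments`; OPEN cores `stub_twoTimeClustering` (F3b), `stub_torusStressIdentificationCore`
(B2core), `stub_stressSpectralDensity` (C1). `StressStrongMixing_of (hRuelle hAlex hLowDensU hF3a hF3b hcore hC1)`;
`lean check`: rc 0, sorries = 7.

## Reshape 5 (lead c2, 2026-08-17, after wave 3): F3a CLOSED — six stubs left, three of them named facts

The wave-3 worker landed `memLp_generators_of_isHardSphereGibbs` (`Theorems/…GibbsMoments.lean`: the six generators are
in `L²` under every hard-sphere DLR state — hard-core cell count + Maxwellian fourth moments through `gibbsSpec`), which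
is `stub_generatorMoments` verbatim; it is discharged inside the composition.  FINAL SHAPE OF THE LINE:
`StressStrongMixing_of (hRuelle hAlex hLowDensU hF3b hcore hC1)` with
* NAMED PUBLISHED FACTS (unproved `def … : Prop`s of the tree): `stub_ruelleDiluteGas` (Ruelle 1969 Thm 4.2.3),
  `stub_alexanderFlow` (Alexander 1976 Thm 5.2 ∧ Cor. 5.4), `stub_lowDensityGibbsUniqueness` (Ruelle 1969 + Georgii 1995);
* OPEN CORES: F3b `stub_twoTimeClustering` (space–time clustering of the six generators under the dilute equilibrium
  dynamics), B2core `stub_torusStressIdentificationCore` (two-time locality in law + ensemble equivalence on the blown-up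
  torus), C1 `stub_stressSpectralDensity` (integrable stress spectral density = LAP for the Liouvillian);
everything else (B1; A-assembly with the minimal observable space; F1; Fcov; M4; static moments; Følner positivity;
B2-transfer; Riemann–Lebesgue) PROVED, in 14 landed support files.  `lean check`: rc 0, sorries = 6.

## Reshape 6 (lead c3, 2026-08-17, cycle 3): Ruelle CLOSED by the tree; `c_F(0) = θ²` split off B2core; LowDensU narrowed

* `stub_ruelleDiluteGas` is no longer a stub: the named fact was DISCHARGED in the tree
  (`Literature.MathematicalPhysics.StatisticalMechanics.RuelleDiluteHardSphereGas_holds`, `DiluteHardSphereGasProofs.lean`,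
  2026-08-17: Michelen–Perkins uniqueness route + Janossy identification of the two specifications + GNZ first-order
  density bounds + velocity transport); it is imported and discharged inside the composition.
* B2core is SPLIT along the time parameter: the static instance `s = 0` is the identity `c_F(0) = ⟪ξ_Π, ξ_Π⟫_ℋ = θ²`
  for EVERY density-one framework — registered as the provable-now stub `stub_stressAutocorrelationZero` (L of a known
  kind: `U_0 = 1`, `‖[Π]‖² = ∫ Cov_μ(Π_C, Π_{C+x}) dx`, and under a hard-sphere DLR state the velocity marks are
  conditionally i.i.d. centred Maxwellians of variance `θ`, so `Cov_μ(Π_A, Π_B) = θ² E_μ N_{A∩B} = θ² vol(A ∩ B)` at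
  density one, and `∫ vol(C ∩ (C+x)) dx = 1`) — which together with the landed torus statics `torusStressMoment_zero`
  (`M_N(0) = θ²∫χ₁χ₂` for all `N`) and B1 closes the `s = 0` case of the identification; the dynamic remainder
  `stub_torusStressIdentificationPos` is B2core VERBATIM with `0 < s` in place of `0 ≤ s`
  (glue `torusStressIdentificationCore_of_pos_of_zero`, proved below).
* `stub_lowDensityGibbsUniqueness` (the named fact `HardSphereGibbsLowDensityUniqueness`, stated for ALL dimensions) is
  NARROWED to the instance the composition uses, `stub_lowDensityGibbsUniqueness3`: `d = 3`, unit diameter, zero drift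
  (two translation-invariant `IsHardSphereGibbs 1 z β 0` / `IsHardSphereGibbs 1 z' β 0` states with the same density
  `< ρ₀` coincide).  Its published ingredients are now PROVED in the tree in `d = 3`: uniqueness at small activity
  `IsHardSphereGibbs.unique_of_small_activity` (`16 z < 1`), translation invariance, and the GNZ sandwich
  `HardSphereDLR.activity_le_two_mul_density` (density `ρ < 1/32` forces activity `z ≤ 2ρ`); what is left is the
  injectivity of `z ↦ ρ(z)` on `(0, 1/16)` (Ruelle: `ρ(z) = z - (4π/3)·z² + O(z³)` strictly increasing; GNZ form
  `ρ(z) = z · G_z(no centre in B(0,1))` with a Lipschitz dependence of the void probability on `z`).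
Stubs now (6): named fact `stub_alexanderFlow`; known-kind `stub_lowDensityGibbsUniqueness3`, `stub_stressAutocorrelationZero`;
OPEN cores `stub_twoTimeClustering` (F3b), `stub_torusStressIdentificationPos` (B2pos), `stub_stressSpectralDensity` (C1).
`StressStrongMixing_of (hAlex hLowDensU3 hF3b hpos hzero hC1)`; `lean check`: rc 0, sorries = 6.

## Status after cycle-3 wave 1 (lead c3, 2026-08-17): LowDensU3 and B2zero CLOSED — four stubs left, three of them open cores

* `stub_stressAutocorrelationZero` LANDED (p158174, `Theorems/…StressAutocorrelationZero.lean`): `c_F(0) = θ²` on every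
  density-one framework; with `torusStressMoment_zero` the `s = 0` identification holds for EVERY framework.
* `stub_lowDensityGibbsUniqueness3` LANDED (p159640 with helpers p157794 `…Cloud`, p158437 `…Estimates`, p159290 `…Lipschitz`):
  `ρ₀ = 1/2000`; GNZ identity `ρ = z·q(z)` with the vacancy probability `q` Lipschitz in `z` uniformly in the volume (pinning),
  so `z ↦ ρ(z)` is injective on `(0, 1/1000)`; equal activities by `IsHardSphereGibbs.unique_of_small_activity`.  This is the
  `d = 3` content of the named fact `HardSphereGibbsLowDensityUniqueness`.
* `stub_twoTimeClustering`: worker landed the reduction `twoTimeClustering_of_decay` (p158195, `Theorems/…TwoTimeClustering.lean`: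
  F3b follows verbatim from an integrable decay majorant of `x ↦ Cov_μ(a, (b∘Φ_t)∘τ_x)` off a ball; measurability of the
  shift action in `(x, ω)` settled) and reported `stub-blocked: (no tree fact) space–time clustering of Alexander dynamics at
  low density` — missing (i) STATIC exponential clustering of polynomial-mark linear statistics under the dilute DLR state
  (event-level pinning pieces exist: `IsHsLocalGibbs.abs_measureReal_sub_hsLocalSpec_empty_le`, free-measure covariance bound
  `abs_measureReal_inter_sub_mul_le`), (ii) DYNAMIC locality in law of equilibrium flows (finite collision clusters on `[0,t]`
  with exponential diameter tail; tree has only the vocabulary `collisionCluster` / `HasFiniteClustersOn`).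
* `stub_torusStressIdentificationPos`: `stub-blocked: Georgii1995_hardSphereCanonicalLocalLimit` (nearest named fact; it is the
  static, one-time, setwise, subsequential case).  Missing inputs typed by the worker: M1 two-time local limit IN LAW of the
  blown-up canonical torus process with its flow towards `(μ, Alexander flow)` ("dynamic Georgii"); M2 uniform-in-`N` clustering
  of the truncated two-time stress pair-correlation measure at covariance scale (tightness of `c_N(s)` in total variation +
  uniformly small tails); M3 the endgame `M1 ∧ M2 ∧ L^{2+δ}` Maxwellian bounds ⇒ B2pos (folklore, provable).  No structural
  obstruction: the canonical rank-one (number-charge) correction vanishes for the stress at every `s` (centring by `v⁰ ↦ -v⁰`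
  and invariance of the canonical law under the flow).
* `stub_alexanderFlow`: `stub-blocked: InfiniteHardSphereFlow.nonempty` — audit found no defect in the typed facts (no degenerate
  witness: Gibbs states exist, `good = ∅` fails; `unique` compares `flow t ω` only); a Lean proof of Alexander 1976 Thm 5.2 /
  Cor 5.4 is estimated at 7–10k lines over the landed `ConfinedHardSphereFlow*` finite-`N` flows.
Shape after wave 1: `StressStrongMixing_of (hAlex hF3b hpos hC1)`, minimal cut `StressStrongMixing_of_min (hpos hC1)`;
`lean check`: rc 0, sorries = 4 (Alexander — named fact; F3b, B2pos, C1 — open cores).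

## Reshape 7 (lead c3, after wave 1): F3b = F3static ∧ F3dyn

F3b `stub_twoTimeClustering` is no longer a stub: it is PROVED here from two registered stubs, the provable-now static half
`stub_staticClustering` (F3static: `x ↦ Cov_μ(a, b ∘ τ_x) ∈ L¹(ℝ³)` for the six generators under the density-one dilute DLR
state — uniform boundary-condition pinning `abs_hsLocalSpec_toReal_sub_le` ⇒ exponential `φ`-mixing ⇒ covariance decay,
with Maxwellian truncation) and the open dynamic upgrade `stub_dynamicClusteringUpgrade` (F3dyn: F3static ⇒ F3b; locality in
law of equilibrium flows).  Stubs now (5): `stub_alexanderFlow` (named fact), `stub_staticClustering` (known kind, wave 2),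
OPEN cores `stub_dynamicClusteringUpgrade` (F3dyn), `stub_torusStressIdentificationPos` (B2pos), `stub_stressSpectralDensity` (C1).
`StressStrongMixing_of (hAlex hF3s hF3d hpos hC1)`; `lean check`: rc 0, sorries = 5.

## Status after cycle-3 wave 2 (lead c3): F3static CLOSED — four stubs left = one named fact + three open cores

`stub_staticClustering` LANDED (p162821; helpers p161371 Pinning, p162147 Mixing — exponential φ-mixing of the dilute DLR
state, reusable for F3dyn —, p161957 Moments, p162596 Locality).  FINAL SHAPE OF CYCLE 3:
`StressStrongMixing_of (hAlex hF3d hpos hC1)`, minimal cut `StressStrongMixing_of_min (hpos hC1)`; `lean check`: rc 0,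
sorries = 4: `stub_alexanderFlow` (named fact, Alexander 1976), `stub_dynamicClusteringUpgrade` (F3dyn: locality in law of
equilibrium flows), `stub_torusStressIdentificationPos` (B2pos: dynamic Georgii + covariance-scale clustering),
`stub_stressSpectralDensity` (C1: integrable stress spectral density — the crux's open content).

## Reshape 8 (lead c4, 2026-08-17, cycle 4): F3dyn ⇐ FlowLocality + glue; B2pos ⇐ Fourier-monomial identification + glue

* F-side.  The open stub F3dyn (`static ⇒ two-time clustering`) hid two things of different status: a piece of ANALYSIS that is
  provable now from the landed `φ`-mixing / clamp / decay-reduction lemmas, and the genuinely dynamical input.  The latter is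
  now typed MINIMALLY as `FlowLocality` (registered `stub_flowLocality`, OPEN, no print source at fixed packing): under the
  dilute density-one Gibbs state, the time-`t` image `b ∘ Φ_t` of each of the six cell generators is approximable in `L²(μ)` by
  cylinder functions of the balls `B(0, L)` with an error `≤ K e^{-κL}` (finite speed of dependence of the equilibrium hard-sphere
  dynamics in law: collision chains spanning distance `L` in time `t` cost `(C z σ³)^{L/σ}` or a Maxwellian tail).  The glue
  `stub_twoTimeClusteringOfLocality : FlowLocality → TwoTimeClustering` is registered as a PROVABLE stub (wave 1): at a shift
  `x` take `L = ‖x‖/2`, split `b ∘ Φ_t = g_L + (b ∘ Φ_t - g_L)`, bound the second piece by Cauchy–Schwarz (`≤ ‖a‖₂ √K e^{-κ‖x‖/4}`)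
  and the first by the landed clamp + `φ`-mixing argument of `stub_staticClustering` (`g_L ∘ τ_x` is a cylinder function of
  `B(0, ‖x‖/2)ᶜ`), then conclude with `integrable_cov_flow_spatialShift_of_decay`.  F3dyn is PROVED from the two.
* B-side.  B2pos (torus → `ℋ` identification for ALL continuous test functions, `s > 0`, for ONE framework) is now derived from
  A (framework existence) and the `∀ F` identification `TorusStressIdentificationPosAll`, which in turn is reduced to the
  identification on REAL FOURIER MONOMIALS `x ↦ Re/Im e^{2πi n·x}` (`stub_torusStressIdentificationTrig`, OPEN: the two-time
  kinetic stress structure factor of the density-one torus gas at fixed macroscopic wavenumber `n` converges to the `k = 0`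
  infinite-volume autocorrelation `c_F(s)·∫χ₁χ₂` — dynamic Georgii + covariance-scale clustering, the `n = m = 0` instance being
  the MD statement `(N+1)⁻¹ Cov(S(s), S(0)) → c_F(s)` for the total kinetic shear stress `S`) by the PROVABLE density glue
  `stub_torusStressIdentificationPosOfTrig` (wave 1): the crux's moment `M_N(s; χ₁, χ₂)` is bilinear in `(χ₁, χ₂)` and bounded by
  `θ² ‖χ₁‖_{L²} ‖χ₂‖_{L²} ≤ θ² ‖χ₁‖_∞ ‖χ₂‖_∞` UNIFORMLY IN `N` (landed `abs_torusStressMoment_le`), real trigonometric polynomials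
  are dense in `C(𝕋³, ℝ)` (Mathlib `UnitAddTorus.span_mFourier_closure_eq_top`, real parts), and the limit `c_F(s)∫χ₁χ₂` is
  continuous in the sup norms — a `3ε` argument.  The Core / `∀ F`-upgrade detour through the two uniqueness facts is no longer
  on the load-bearing path (kept below for the record).
Stubs now (6 ≤ 7): named fact `stub_alexanderFlow`; OPEN cores `stub_flowLocality` (Loc), `stub_torusStressIdentificationTrig`
(B2trig), `stub_stressSpectralDensity` (C1, the crux's spectral content); PROVABLE glue `stub_twoTimeClusteringOfLocality`,
`stub_torusStressIdentificationPosOfTrig` (wave 1 of cycle 4).  `StressStrongMixing_of (hAlex hLoc hLocGlue hTrig hTrigGlue hC1)`.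

## Status after cycle-4 wave 1 (lead c4): both glues LANDED; B2trig reduced to its diagonal core; Loc reduced to locality in law

* `stub_twoTimeClusteringOfLocality` LANDED (p166515, `Theorems/…TwoTimeClusteringOfLocality.lean`: cylinder lemma
  `comp_spatialShift_superposeIn_ball_of_isCylinder`, clamp + `φ`-mixing for `L²` cylinder observables, `σ₃ := min σ₄ (1/4)`).
* `stub_torusStressIdentificationPosOfTrig` LANDED (p167024, `Theorems/…TorusStressIdentificationPosOfTrig.lean`: real trigonometric
  polynomials dense in `C(𝕋³, ℝ)` from `span_mFourier_closure_eq_top`, equicontinuity of uniformly bounded bilinear forms).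
* Torus symmetries LANDED by the B2trig worker (p166664 `…TorusStressTranslationInvariance`: `M_N(s; χ₁(·+a), χ₂(·+a)) = M_N(s; χ₁, χ₂)`,
  `M_N(s; χ₁, χ₂) = M_N(s; χ₂, χ₁)`; p168030 `…TorusStressTrigHaar`; p168678 `…TorusStressTrigBilinear`: off-resonant `n ≠ ±m` and all
  mixed `Re/Im` moments vanish EXACTLY at every `N`, `(Im e_n, Im e_n) = (Re e_n, Re e_n)`; p169373 `…TorusStressTrigReduction`:
  `torusStressIdentificationTrig_of_diagonal`, and `torusStressMoment_wavenumber_zero` = the MD form at `n = 0`).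

## Reshape 9 (lead c4, after wave 1): B2trig ⇐ B2diag (landed reduction); Loc ⇐ Loc0 (locality in law) + assembly glue

* B2trig is PROVED from the new minimal open stub `stub_torusStressDiagonalLimit` (B2diag: for every density-one framework, flow
  family, wavenumber `n ∈ ℤ³` and `s > 0`, `M_N(s; Re e_n, Re e_n) → c_F(s)·∫(Re e_n)²` — the two-time kinetic shear-stress STRUCTURE
  FACTOR of the density-one torus gas at fixed macroscopic wavenumber; `n = 0`: `(N+1)⁻¹ Cov_{G_N}(S(s(N+1)^{-1/3}), S(0)) → c_F(s)`) by
  `torusStressIdentificationTrig_of_diagonal` (p169373).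
* Loc is PROVED from the new minimal open stub `stub_flowLocalityInLaw` (Loc0: EVENT-LEVEL locality — for each `L` a measurable
  `B(0,L)`-cylinder `g` with fourth moments `≤ C(1+L)^m` agreeing with `b ∘ Φ_t` off an event of measure `≤ K₀e^{-κ₀L}`; content =
  exponential reach tail of the collision clusters of the unit cell + truncated cylinder dynamics + cluster determination + window
  fourth moments, items I1–I4 of the wave-1 census `flowLocality-census.md`, ≈ 6–9 kLoC, no print source) and the PROVABLE assembly
  glue `stub_flowLocalityOfInLaw` (I5 of that census, Cauchy–Schwarz/AM–GM; registered, landed next).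
Stubs now (5): named fact `stub_alexanderFlow`; OPEN cores `stub_flowLocalityInLaw` (Loc0), `stub_torusStressDiagonalLimit` (B2diag),
`stub_stressSpectralDensity` (C1); PROVABLE glue `stub_flowLocalityOfInLaw`.  `StressStrongMixing_of (hAlex hLoc0 hLocGlue0 hDiag hC1)`.

## Reshape 10 (lead c4, same integration step): Loc0 ⇐ LocDom (event-level, energy-dominated) ∧ I4 WindowFourthMoments (provable) — glue proved here

The fourth-moment clause of Loc0 is separated from its dynamical content: `stub_flowLocalityDominated` (LocDom, OPEN: cylinder approximants
`g_L` of `B(0,L)` agreeing with `b ∘ Φ_t` off an event of measure `≤ K₀e^{-κ₀L}` and dominated POINTWISE by `A · Σ_{q ∈ B(0,L)} (1 + ‖v‖²)`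
— the natural bound for `b` evaluated on the energy-conserving truncated evolution of the particles initially in `B(0, L)`) and
`stub_windowFourthMoments` (I4, PROVABLE NOW, wave 2: `E_μ[(Σ_{q ∈ B(0,L)} (1 + ‖v‖²))⁴] ≤ C (1 + L)^{12}` under a translation-invariant
hard-sphere Gibbs state — hard core + conditional Maxwellian marks); `flowLocalityInLaw_of_dominated` (proved below) gives Loc0.
Stubs now (6): named fact `stub_alexanderFlow`; OPEN cores `stub_flowLocalityDominated` (LocDom), `stub_torusStressDiagonalLimit` (B2diag),
`stub_stressSpectralDensity` (C1); PROVABLE `stub_windowFourthMoments` (I4, wave 2), `stub_flowLocalityOfInLaw` (LocGlue0, lead, landing).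
`StressStrongMixing_of (hAlex hLocDom hI4 hLocGlue0 hDiag hC1)`.

## Status after cycle-4 wave 2 (lead c4): I4 and LocGlue0 CLOSED — FINAL SHAPE OF CYCLE 4

`stub_windowFourthMoments` LANDED (p170434) and `stub_flowLocalityOfInLaw` LANDED (p169819); both are discharged inside the composition.
`StressStrongMixing_of (hAlex hLocDom hDiag hC1)`; `lean check`: rc 0, sorries = 4: `stub_alexanderFlow` (named fact, Alexander 1976),
`stub_flowLocalityDominated` (LocDom: finite speed of dependence in probability of the dilute equilibrium dynamics — census I1–I3),
`stub_torusStressDiagonalLimit` (B2diag: two-time kinetic stress structure factor of the torus gas at fixed macroscopic wavenumber — census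
M1–M4), `stub_stressSpectralDensity` (C1: integrable stress spectral density — the crux's open content).  Cycle-4 landings: p166515, p167024,
p166664, p168030, p168678, p169373, p169819, p170434 (8 files).

## Reshape 11 (lead c5, 2026-08-17, cycle 5): the registered C-stub is made MINIMAL — C (Rajchman decay) instead of C1 (a.c. density)

Since reshape 2 the registered spectral stub was C1 `stub_stressSpectralDensity` (`c_F(s) = ∫ cos(sλ) ρ(λ) dλ`, `ρ ∈ L¹`: absolute continuity of
the stress spectral measure on ALL of `ℝ` plus strong continuity of `U` on the cyclic subspace of `ξ_Π`), chosen to mirror the route's plan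
"LAP ⇒ a.c. ⇒ Riemann–Lebesgue".  That is STRICTLY MORE than the composition consumes: `StressStrongMixing_of_ABC` uses only C `StressRajchman`
(`c_F(s) → 0`, the Rajchman property), and a.c. spectrum has no engine at fixed packing that Rajchman decay lacks (strategist census S1:
both need a conjugate operator for the Liouvillian; the commutator criteria for strong mixing, doi:10.1017/etds.2015.47, conclude Rajchman
decay WITHOUT absolute continuity).  The registered stub is therefore now C itself, `stub_stressRajchman` — VERBATIM (modulo the `open`
namespaces of this file) the child `StressRajchmanDecay` of the strategist's parked three-way split (`Lines/split3.lean`, glue landed p171764) —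
and C1 survives only as the named `Prop` `StressSpectralDensity` with its proved implication `stressRajchman_of_spectralDensity` (Riemann–Lebesgue)
and the record composition `StressStrongMixing_of_C1`.  Nothing landed is orphaned; every composition now takes `hC : StressRajchman`.
`StressStrongMixing_of (hAlex hLocDom hDiag hC)`; `lean check`: rc 0, sorries = 4: `stub_alexanderFlow` (named fact in print, Alexander 1976
Thm 5.2 ∧ Cor 5.4; 7–10 kLoC over the landed finite-`N` flows), `stub_flowLocalityDominated` (LocDom; 6–8 kLoC, folklore, no print source at
fixed packing), `stub_torusStressDiagonalLimit` (B2diag; 8–12 kLoC, dynamic Georgii + covariance-scale clustering, no print source),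
`stub_stressRajchman` (C: THE OPEN PROBLEM — Spohn 1991 Part I §7.2 p. 94; Dobrushin–Sinai–Sukhov EMS 2 Ch. 10 §4.4; rigorous progress only in the
Boltzmann–Grad limit, BGSS CPAM 2023 Thm 1.1).  Hardest stub: `stub_stressRajchman`.  Each of the four is item-sized.

## Reshape 12 (lead c6, 2026-08-17, cycle 6): the LONG-WAVELENGTH REDUCTION of B2diag — two provable stubs split off

B2diag (the structure-factor limit at EVERY fixed macroscopic wavenumber `n`) hid a piece of finite-`N` Fourier bookkeeping and an
easy long-wavelength step next to its dynamical content.  It is now PROVED here from four registered stubs through the two-time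
stress PAIR FUNCTIONAL `P_N(s; f) = (N+1)⁻¹ Σ_{i,j} E_{G_N}[f(x_i(s_N) − x_j(0)) Π_i(s_N) Π_j(0)]` (`torusStressPairFunctional`, `f` a
function of the MACROSCOPIC displacement):
* B3form `stub_torusStressPairForm` (PROVABLE NOW, wave 1): `M_N(s; Re e_n, Re e_n) + M_N(s; Im e_n, Im e_n) = P_N(s; Re e_n)` —
  `Re e_n(x)Re e_n(y) + Im e_n(x)Im e_n(y) = Re e_n(x − y)` on the finite empirical sums, plus the landed `G_N`-integrability;
* B3loc `stub_torusStressPairLocality` (OPEN core, minimal): MACROSCOPIC LOCALITY of the pair functional, `P_N(s; f) − f(0)·P_N(s; 1) → 0`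
  for continuous `f` — uniform total-variation bound + no mass at macroscopic displacement at a fixed microscopic time (cluster-size /
  reach tails uniform in `N`; the torus twin of F3b; no print source at fixed packing);
* B2diag₀ `stub_torusStressDiagonalLimitZero` (OPEN core): B2diag AT `n = 0` VERBATIM — the molecular-dynamics statement
  `(N+1)⁻¹ E_{G_N}[S(s_N)S(0)] → c_F(s)` (dynamic Georgii + micro-scale clustering + two-time Campbell; Spohn 1991 I (7.14)–(7.15));
* B3lw `stub_torusStressLongWavelength` (PROVABLE NOW, wave 1): B3form → B3loc → B2diag₀ → B2diag (`n ≠ 0`: `2M_N(Re e_n, Re e_n) =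
  P_N(Re e_n) = P_N(1) + o(1) → c_F(s)`, `∫(Re e_n)² = 1/2`; isotropy `torusStressMoment_im_im_eq_re_re`).
`StressStrongMixing_of (hAlex hLocDom hForm hPairLoc hDiag0 hLW hC)` (7 = stubs_max; shape 11 kept as the record `cruxStatement_of_shape11`);
`lean check`: rc 0, sorries = 7.  Open cores after wave 1 lands: Alexander (named fact), LocDom, B3loc, B2diag₀, C.
-/

noncomputable section

open MeasureTheory ProbabilityTheory Filter Topology
open scoped InnerProductSpace ENNReal

namespace Summit.AtomisticToContinuum.HydrodynamicLimit.Cruxes.StressStrongMixing.Birth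

open Literature.MathematicalPhysics.KineticTheory Literature.Analysis.FluidPDE

/-! ### Vocabulary (abbreviations of the crux's own expressions and of the landed carriers; no new mathematics) -/

/-- The kinetic shear-stress one-body function `Π(v) = v⁰ v¹` (the crux's `y.2 0 * y.2 1`). -/
def shearStress (v : V3) : ℝ := v 0 * v 1

/-- The crux's torus quantity, VERBATIM: `(N+1) · E_eq[Π(χ₁)(Φ_{s(N+1)^{-1/3}} z) · Π(χ₂)(z)]` under the canonical
equilibrium law `localGibbsLaw σ 1 0 θ N (Φ N)`, `Π(χ)(z) = (N+1)⁻¹ Σᵢ χ(xᵢ) vᵢ⁰ vᵢ¹` (raw second moment; it equals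
the covariance since `Π` is centred under the canonical law). -/
def torusStressMoment (σ θ : ℝ)
    (Φ : (N : ℕ) → HardSphereFlow (Torus.geometry (Fin 3)) (hsDiameter σ N) (N + 1))
    (χ₁ χ₂ : T3 → ℝ) (s : ℝ) (N : ℕ) : ℝ :=
  ((N : ℝ) + 1) * ∫ z, (∫ y, χ₁ y.1 * (y.2 0 * y.2 1)
      ∂(empiricalMeasure ((Φ N).flow (s * ((N : ℝ) + 1) ^ (-(1 / 3 : ℝ))) z))) *
    (∫ y, χ₂ y.1 * (y.2 0 * y.2 1) ∂(empiricalMeasure z))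
    ∂(localGibbsLaw σ (fun _ => 1) (fun _ => 0) (fun _ => θ) N (Φ N))

/-- **The carrier hypotheses** pinning the infinite-volume object: `F` is hard-sphere fluctuation data at reduced
diameter `σ` whose state is a DLR Gibbs state of the hard-sphere gas at activity `z`, inverse temperature `θ⁻¹`,
zero drift (`IsHardSphereGibbs`), of DENSITY ONE (expected number of particles in the unit cell,
`cellCharge 0 = Σ_{q ∈ [0,1)³} 1`), whose flow is a.e. an equilibrium Alexander flow (`IsEquilibriumFlow`), and for
which the kinetic shear stress of the unit cell is a local observable. (Same shape as the hypotheses of the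
route's typed rung `ChargesCompleteHS`, plus density one and the stress.) -/
def IsStressFramework (σ θ z : ℝ) (F : HardSphereFluctuationData σ) : Prop :=
  IsHardSphereGibbs σ z θ⁻¹ (0 : V3) F.μ ∧
  (∫ ω, cellCharge 0 ω ∂F.μ = 1) ∧
  (∃ Φ : InfiniteHardSphereFlow (Fin 3) σ, Φ.IsEquilibriumFlow ∧ ∀ t : ℝ, F.flow t =ᵐ[F.μ] Φ.flow t) ∧
  cellObs shearStress ∈ F.localObs

/-- **The infinite-volume stress autocorrelation** `c_F(s) := ⟪U_s ξ_Π, ξ_Π⟫_ℋ`, `ξ_Π = [cellObs Π] ∈ ℋ_F`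
(`= ∫ dx Cov_μ(Π ∘ φ_s, Π ∘ τ_x)` by `inner_fluct_koopman_fluct`; the Green–Kubo integrand of the kinetic–kinetic
shear viscosity; even in `s` since `U_s` is orthogonal on the real space `ℋ`). -/
def stressAutocorrelation {σ : ℝ} (F : HardSphereFluctuationData σ) (s : ℝ) : ℝ :=
  ⟪F.koopman s (F.fluct (cellObs shearStress)), F.fluct (cellObs shearStress)⟫_ℝ

/-! ### The statements of the line (named `Prop`s) -/

/-- **A · StressFramework** (L; FluctuationFramework (1) of the route at density one). For small reduced diameter
and every temperature, the density-one hard-sphere Gibbs state carries Spohn's fluctuation data with Alexander's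
flow and the kinetic shear stress as a local observable. Why plausible: low-activity uniqueness/clustering of the
hard-sphere Gibbs state (Ruelle 1969) with density `ρ(z) = z + O(z²σ³)` continuous and increasing, so density one
lies inside the uniqueness regime for small `σ`; Alexander's theorem (`InfiniteHardSphereFlow.nonempty`); the open
part is SPACE–TIME summability of truncated correlations of time-evolved local observables at fixed packing
(Spohn 1991 Part I §7.1). Leans on: `HardSphereFluctuationData`, `IsHardSphereGibbs`, `IsEquilibriumFlow`,
`cellObs`, `cellCharge`. -/
def StressFramework : Prop :=
  ∃ σ₀ : ℝ, 0 < σ₀ ∧ ∀ σ : ℝ, 0 < σ → σ < σ₀ → ∀ θ : ℝ, 0 < θ →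
    ∃ z : ℝ, 0 < z ∧ ∃ F : HardSphereFluctuationData σ, IsStressFramework σ θ z F

/-- The torus two-time stress COVARIANCE times `N + 1` (the `h₁ = h₂ = v⁰v¹` integrand of the typed shape
`IdentifiesTorusCovariances σ θ F` of `FluctuationSpace.lean`):
`(N+1) · Cov_{G_N}(Π(χ₁) ∘ Φ_{s(N+1)^{-1/3}}, Π(χ₂))`, `G_N = localGibbsLaw σ 1 0 θ N (Φ N)`. -/
def torusStressCov (σ θ : ℝ)
    (Φ : (N : ℕ) → HardSphereFlow (Torus.geometry (Fin 3)) (hsDiameter σ N) (N + 1))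
    (χ₁ χ₂ : T3 → ℝ) (s : ℝ) (N : ℕ) : ℝ :=
  ((N : ℝ) + 1) *
    cov[fun z => ∫ y, χ₁ y.1 * (y.2 0 * y.2 1)
          ∂(empiricalMeasure ((Φ N).flow (s * ((N : ℝ) + 1) ^ (-(1 / 3 : ℝ))) z)),
        fun z => ∫ y, χ₂ y.1 * (y.2 0 * y.2 1) ∂(empiricalMeasure z);
      localGibbsLaw σ (fun _ => 1) (fun _ => 0) (fun _ => θ) N (Φ N)]

/-- **B · TorusStressIdentification** (L; FluctuationFramework (2) = TorusToFluctuationSpace for the stress;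
the `h₁ = h₂ = v⁰v¹` instance of the shape `IdentifiesTorusCovariances σ θ F`, written with the crux's raw
moments). On any density-one framework `F` at `(σ, θ)`, for every flow family, continuous `χ₁, χ₂` and `s ≥ 0`:
`(N+1)·E_eq[Π(χ₁)(Φ_{s(N+1)^{-1/3}}z)·Π(χ₂)(z)] → c_F(s)·∫χ₁χ₂`. Why plausible: Spohn 1991 Part I (7.14)–(7.15);
locality in law of Alexander's dynamics at a fixed kinetic time (finitely many collisions per particle, Gaussian
velocity tails) + equivalence of canonical and grand-canonical ensembles at low density; the Boltzmann–Grad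
analogue is BGSS (CPAM 2023). Might fail only through the `N → ∞`/fixed-`s` locality at positive packing.
Leans on: `localGibbsLaw`, `empiricalMeasure`, `HardSphereFluctuationData.koopman/fluct`.
RESHAPED 2026-08-17 (lead c1): proved below from the two registered stubs B1 `TorusStressRawEqCov` (raw moment
= `(N+1)`·covariance, finite-`N` statics) and B2 `TorusStressCovIdentification` (the covariance identification). -/
def TorusStressIdentification : Prop :=
  ∃ σ₀ : ℝ, 0 < σ₀ ∧ ∀ σ : ℝ, 0 < σ → σ < σ₀ → ∀ θ : ℝ, 0 < θ → ∀ z : ℝ, 0 < z →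
    ∀ F : HardSphereFluctuationData σ, IsStressFramework σ θ z F →
    ∀ Φ : (N : ℕ) → HardSphereFlow (Torus.geometry (Fin 3)) (hsDiameter σ N) (N + 1),
    ∀ χ₁ χ₂ : T3 → ℝ, Continuous χ₁ → Continuous χ₂ → ∀ s : ℝ, 0 ≤ s →
      Tendsto (fun N : ℕ => torusStressMoment σ θ Φ χ₁ χ₂ s N) atTop
        (𝓝 (stressAutocorrelation F s * ∫ x, χ₁ x * χ₂ x))

/-- **B1 · TorusStressRawEqCov** (M; finite-`N` statics, provable now). For `0 < σ ≤ 1/2` (the homogeneous local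
Gibbs law `G_N` is then a probability measure, `isProbabilityMeasure_localGibbsLaw_const`) and `θ > 0`, for every
flow family, continuous `χ₁, χ₂`, every real `s` and every `N`, the crux's RAW two-time moment equals `N + 1` times
the two-time COVARIANCE: `Π(χ₂)(z) = (N+1)⁻¹ Σᵢ χ₂(xᵢ) vᵢ⁰vᵢ¹` is centred under `G_N` (given the positions the
velocities are independent centred Gaussians `N(0, θ)`: `map_velOf_localGibbsLaw_const` / `lintegral_localGibbsMeasure`,
and `E[v⁰v¹] = 0`), both factors are in `L²(G_N)` (`memLp_weighted_sum`-type statics; the time-`s` factor by the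
invariance `measurePreserving_flow_localGibbsLaw` of `G_N` under `Φ_t`), so `Cov(X, Y) = E[XY] − E[X]·E[Y] = E[XY]`.
This is exactly why the raw-moment typing of the crux is harmless for the stress (unlike for the number charge,
`Theorems/MourreKoopmanChargesFluctuationFramework.lean`). Leans on: `localGibbsLaw_eq`, `lintegral_localGibbsMeasure`,
`map_velOf_localGibbsLaw_const`, `measurePreserving_flow_localGibbsLaw`, Mathlib `ProbabilityTheory.covariance`. -/
def TorusStressRawEqCov : Prop :=
  ∀ σ : ℝ, 0 < σ → σ ≤ 1 / 2 → ∀ θ : ℝ, 0 < θ →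
    ∀ Φ : (N : ℕ) → HardSphereFlow (Torus.geometry (Fin 3)) (hsDiameter σ N) (N + 1),
    ∀ χ₁ χ₂ : T3 → ℝ, Continuous χ₁ → Continuous χ₂ → ∀ (s : ℝ) (N : ℕ),
      torusStressMoment σ θ Φ χ₁ χ₂ s N = torusStressCov σ θ Φ χ₁ χ₂ s N

/-- **B2 · TorusStressCovIdentification** (L; FluctuationFramework (2) for the stress = the `h₁ = h₂ = v⁰v¹`,
`s ≥ 0` instance of `IdentifiesTorusCovariances σ θ F` restricted to density-one frameworks; the stress profile is
`M_θ`-centred, so the canonical rank-one (number-charge) correction of the general repair vanishes). On any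
density-one framework `F` at `(σ, θ)`, for every flow family, continuous `χ₁, χ₂` and `s ≥ 0`:
`(N+1)·Cov_{G_N}(Π(χ₁)∘Φ_{s(N+1)^{-1/3}}, Π(χ₂)) → c_F(s)·∫χ₁χ₂`. Content: locality in law of Alexander's dynamics
at a fixed kinetic time + equivalence of ensembles at low density (Spohn 1991 Part I (7.14)–(7.15); dilute analogue
BGSS CPAM 2023) + uniqueness of the low-activity Gibbs state and of the equilibrium flow (Ruelle 1969; Alexander
1976 Cor. 5.4, `InfiniteHardSphereFlow.unique`). Leans on: `localGibbsLaw`, `empiricalMeasure`,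
`HardSphereFluctuationData.koopman/fluct`, `inner_fluct_koopman_fluct`. -/
def TorusStressCovIdentification : Prop :=
  ∃ σ₀ : ℝ, 0 < σ₀ ∧ ∀ σ : ℝ, 0 < σ → σ < σ₀ → ∀ θ : ℝ, 0 < θ → ∀ z : ℝ, 0 < z →
    ∀ F : HardSphereFluctuationData σ, IsStressFramework σ θ z F →
    ∀ Φ : (N : ℕ) → HardSphereFlow (Torus.geometry (Fin 3)) (hsDiameter σ N) (N + 1),
    ∀ χ₁ χ₂ : T3 → ℝ, Continuous χ₁ → Continuous χ₂ → ∀ s : ℝ, 0 ≤ s →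
      Tendsto (fun N : ℕ => torusStressCov σ θ Φ χ₁ χ₂ s N) atTop
        (𝓝 (stressAutocorrelation F s * ∫ x, χ₁ x * χ₂ x))

/-- **C · StressRajchman** (XL; HARDEST — the spectral content of the crux). On any density-one framework `F` at
small reduced diameter, the stress autocorrelation in `ℋ` decays: `⟪U_s ξ_Π, ξ_Π⟫_ℋ → 0` as `s → ∞` (the spectral
measure of `ξ_Π` under the Koopman group is Rajchman: no conserved component — `ξ_Π ⊥ 𝒞` statically, and no hidden
charge overlaps it — and no recurrent singular part). Intended proof: the route's positive-commutator engine
(flow-adapted conjugate operator; LAP off thresholds ⇒ a.c. spectral measure ⇒ Riemann–Lebesgue: Mourre 1981,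
ABG 1996) or the commutator criteria for strong mixing (doi:10.1017/etds.2015.47). Why it might fail: an eigenvalue
or singular-continuous component of `iL` seen by the stress, or zero-wavenumber threshold degeneracy. Fails for
the ideal gas (`c ≡ θ²`, BoltzmannHypothesisBarrier / IdealGasNoDecay): collisions must bite here. -/
def StressRajchman : Prop :=
  ∃ σ₀ : ℝ, 0 < σ₀ ∧ ∀ σ : ℝ, 0 < σ → σ < σ₀ → ∀ θ : ℝ, 0 < θ → ∀ z : ℝ, 0 < z →
    ∀ F : HardSphereFluctuationData σ, IsStressFramework σ θ z F →
      Tendsto (stressAutocorrelation F) atTop (𝓝 0)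

/-- **F1 · DiluteGibbsDensityOne** (L of a known kind). For all small reduced diameters `σ` and every temperature
`θ` there is an activity `z > 0` and a translation-invariant DLR Gibbs state of the hard-sphere gas at
`(σ, z, β = θ⁻¹)`, zero drift, of DENSITY ONE (`PointProcess.density μ = 1`: mean number of centres in the unit
cube). Why plausible: Ruelle 1969 Thm 4.2.3 / Dobrushin–Sinai–Sukhov Chap. 10 §2.4 give the unit-diameter dilute gas
with density `ρ(z) ∈ [z - Cz², z]` continuous (tree: named fact `RuelleDiluteHardSphereGas`, unproved); the dilation
`x ↦ σx` maps it to diameter `σ`, activity `z/σ³`, density `ρ(z)/σ³`, and the intermediate value theorem puts the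
density at `1` for `σ³ < z₁/2`. Leans on: `IsHardSphereGibbs`, `IsTranslationInvariant`, `PointProcess.density`. -/
def DiluteGibbsDensityOne : Prop :=
  ∃ σ₁ : ℝ, 0 < σ₁ ∧ ∀ σ : ℝ, 0 < σ → σ < σ₁ → ∀ θ : ℝ, 0 < θ →
    ∃ z : ℝ, 0 < z ∧ ∃ μ : Measure MarkedConfig,
      IsHardSphereGibbs σ z θ⁻¹ (0 : V3) μ ∧ IsTranslationInvariant μ ∧ PointProcess.density μ = 1

/-- **Ruelle · RuelleDiluteGas** (= the named fact `Literature.MathematicalPhysics.StatisticalMechanics.RuelleDiluteHardSphereGas`,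
Ruelle 1969 Thm 4.2.3 / Dobrushin–Sinai–Sukhov, unproved in the tree): the unit-diameter dilute hard-sphere gas has
translation-invariant DLR states of density `ρ(z) ∈ [z - Cz², z]`, `ρ` continuous. F1 follows (landed
`diluteGibbsDensityOne_of_ruelle`, p152665: dilation of DLR states + intermediate value theorem). -/
def RuelleDiluteGas : Prop := Literature.MathematicalPhysics.StatisticalMechanics.RuelleDiluteHardSphereGas

/-- **LowDensU · LowDensityGibbsUniqueness** (= the named fact
`Literature.MathematicalPhysics.KineticTheory.HardSphereGibbsLowDensityUniqueness`, Ruelle 1969 Thm 4.2.3 with Georgii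
1995 Thm 3.4 / Rem. 3.7, unproved in the tree): two translation-invariant hard-sphere DLR states with the same marks and
the same small density coincide. M4 follows by the dilation `x ↦ σ⁻¹x` (landed `IsHardSphereGibbs.map_dilate`,
`isTranslationInvariant_map_dilate`, `density_map_dilate`, p152252/p152665). -/
def LowDensityGibbsUniqueness : Prop := Literature.MathematicalPhysics.KineticTheory.HardSphereGibbsLowDensityUniqueness

/-- **F2 · AlexanderExistence** (= the named fact `InfiniteHardSphereFlow.nonempty` in dimension 3, Alexander 1976
Thm 5.2, unproved in the tree): for every diameter there is an infinite hard-sphere flow that is a.e. defined and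
stationary in every Gibbs state. -/
def AlexanderExistence : Prop := InfiniteHardSphereFlow.nonempty (d := Fin 3)

/-- **F2 ∧ Fu · AlexanderFlow** (= the two named facts `InfiniteHardSphereFlow.nonempty ∧ InfiniteHardSphereFlow.unique`
in dimension 3, Alexander 1976 Thm 5.2 and Cor. 5.4, both unproved in the tree): existence and uniqueness of the
equilibrium hard-sphere flow. One registered stub for the pair (the two facts come from the same source and are
used together: existence for A, uniqueness for Fcov and for the `F`-independence of `c_F` in B2). -/
def AlexanderFlow : Prop :=
  InfiniteHardSphereFlow.nonempty (d := Fin 3) ∧ InfiniteHardSphereFlow.unique (d := Fin 3)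

/-- **Fcov · EquilibriumFlowShiftCovariant** (M/L). Every equilibrium flow commutes with the spatial translations
almost surely in every Gibbs state: `Φ_t ∘ τ_x = τ_x ∘ Φ_t` `μ`-a.e. Why plausible: conjugating an equilibrium flow by
`τ_x` gives an equilibrium flow (the set of Gibbs states is translation invariant: covariance of `gibbsSpec`), and two
equilibrium flows agree a.e. in every Gibbs state (named fact `InfiniteHardSphereFlow.unique`, Alexander 1976
Cor. 5.4). Leans on: `InfiniteHardSphereFlow.IsEquilibriumFlow`, `spatialShift`, `IsHardSphereGibbs`. -/
def EquilibriumFlowShiftCovariant : Prop :=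
  ∀ σ : ℝ, 0 < σ → ∀ Φ : InfiniteHardSphereFlow (Fin 3) σ, Φ.IsEquilibriumFlow →
    ∀ z β : ℝ, 0 < z → 0 < β → ∀ μ : Measure MarkedConfig, IsHardSphereGibbs σ z β (0 : V3) μ →
      ∀ (t : ℝ) (x : V3), Φ.flow t ∘ spatialShift x =ᵐ[μ] spatialShift x ∘ Φ.flow t

/-- **F3 · SpaceClusteringDensityOne** (OPEN — the static-dynamic clustering input of Spohn's `ℋ`). For all small
`σ`, every equilibrium flow `Φ` and every translation-invariant density-one Gibbs state `μ` at `(σ, z, θ⁻¹)`, the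
flow–shift span `hardSphereObs Φ` of the local polynomial observables is an admissible observable space
(`IsLocalObservableSpace`: square integrability, spatially INTEGRABLE truncated correlations `x ↦ Cov_μ(a, b ∘ τ_x)` for
time-evolved local `a, b`, non-negative zero-wavenumber structure factor, the five charges). Static part: Ruelle's
cluster expansion; dynamic part (time-evolved observables at fixed packing): no print source. -/
def SpaceClusteringDensityOne : Prop :=
  ∃ σ₃ : ℝ, 0 < σ₃ ∧ ∀ σ : ℝ, 0 < σ → σ < σ₃ → ∀ Φ : InfiniteHardSphereFlow (Fin 3) σ,
    Φ.IsEquilibriumFlow → ∀ θ z : ℝ, 0 < θ → 0 < z →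
    ∀ μ : Measure MarkedConfig, IsHardSphereGibbs σ z θ⁻¹ (0 : V3) μ → IsTranslationInvariant μ →
      PointProcess.density μ = 1 → IsLocalObservableSpace Φ μ (hardSphereObs Φ)

/-- **Fu · AlexanderUnique** (= the named fact `InfiniteHardSphereFlow.unique` in dimension 3, Alexander 1976 Cor. 5.4,
unproved in the tree): two equilibrium flows agree, at all times, almost surely in every Gibbs state. -/
def AlexanderUnique : Prop := InfiniteHardSphereFlow.unique (d := Fin 3)

/-- **M4 · DensityOneGibbsUnique** (L of a known kind). For all small `σ` and every inverse temperature, two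
translation-invariant DLR states of the hard-sphere gas at diameter `σ`, zero drift and DENSITY ONE coincide, whatever
their activities. Why plausible: the named fact `HardSphereGibbsLowDensityUniqueness` (Ruelle 1969 Thm 4.2.3 + Georgii
1995 Thm 3.4 / Rem. 3.7: small equal densities ⇒ equal states, threshold `ρ₀(ε)`) at unit diameter, transported to
diameter `σ` by the dilation `x ↦ σx` of DLR states (density one at diameter `σ` ↔ density `σ³ < ρ₀(1)` at diameter 1). -/
def DensityOneGibbsUnique : Prop :=
  ∃ σ₁ : ℝ, 0 < σ₁ ∧ ∀ σ : ℝ, 0 < σ → σ < σ₁ → ∀ β : ℝ, 0 < β →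
    ∀ (z z' : ℝ) (μ μ' : Measure MarkedConfig), 0 < z → 0 < z' →
      IsHardSphereGibbs σ z β (0 : V3) μ → IsHardSphereGibbs σ z' β (0 : V3) μ' →
      IsTranslationInvariant μ → IsTranslationInvariant μ' →
      PointProcess.density μ = 1 → PointProcess.density μ' = 1 → μ = μ'

/-- **B2core · TorusStressIdentificationCore** (L/XL, OPEN — the finite→infinite-volume content proper). For all small
`σ` and every `θ` there are an activity `z` and ONE density-one framework `F` (as in A) for which the torus two-time
stress covariances converge to `c_F(s)·∫χ₁χ₂` for every flow family, continuous `χ₁, χ₂` and `s ≥ 0`: two-time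
LOCALITY IN LAW of Alexander's dynamics at fixed kinetic time on the blown-up torus + canonical→grand-canonical
equivalence for two-time one-body observables (Spohn 1991 Part I (7.14)–(7.15); the static one-time marginal version is
the named fact `Georgii1995_hardSphereCanonicalLocalLimit`; dilute analogue BGSS CPAM 2023). With Fu and M4 it gives B2
for EVERY framework (landed reduction `torusStressCovIdentification_of`, p150204). -/
def TorusStressIdentificationCore : Prop :=
  ∃ σ₂ : ℝ, 0 < σ₂ ∧ ∀ σ : ℝ, 0 < σ → σ < σ₂ → ∀ θ : ℝ, 0 < θ →
    ∃ z : ℝ, 0 < z ∧ ∃ F : HardSphereFluctuationData σ, IsStressFramework σ θ z F ∧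
      ∀ Φ : (N : ℕ) → HardSphereFlow (Torus.geometry (Fin 3)) (hsDiameter σ N) (N + 1),
      ∀ χ₁ χ₂ : T3 → ℝ, Continuous χ₁ → Continuous χ₂ → ∀ s : ℝ, 0 ≤ s →
        Tendsto (fun N : ℕ => torusStressCov σ θ Φ χ₁ χ₂ s N) atTop
          (𝓝 (stressAutocorrelation F s * ∫ x, χ₁ x * χ₂ x))

/-- **B2zero · StressAutocorrelationZero** (L of a known kind — the STATIC instance of the identification, split off
B2core by lead c3). On every density-one framework `F` at `(σ, θ, z)` the stress autocorrelation at time zero is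
`c_F(0) = ⟪U_0 ξ_Π, ξ_Π⟫_ℋ = ‖ξ_Π‖²_ℋ = θ²`. Why true: `U_0 = 1`; `‖[Π]‖² = ∫_{ℝ³} Cov_μ(Π_C, Π_C ∘ τ_x) dx`
(`norm_fluct_sq`, `form_def`), `Π_C ∘ τ_x = Π_{C-x}`; under a hard-sphere DLR state the velocity marks are, given the
positions, i.i.d. centred Maxwellians of covariance `θ·1` (`gibbsSpec` with `maxwellPhaseMeasure θ⁻¹ 0 Λ =
Leb|_Λ ⊗ M_{θ⁻¹}`), and `E_M[v⁰v¹] = 0`, `E_M[(v⁰v¹)²] = θ²`, so `E_μ Π_A = 0` and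
`Cov_μ(Π_A, Π_B) = θ² · E_μ N_{A ∩ B} = θ² · ρ · vol(A ∩ B)` for bounded Borel `A, B` (translation invariance:
the intensity measure is `ρ · Leb`, `ρ = E_μ N_C = 1`); finally `∫ vol(C ∩ (C - x)) dx = vol(C)² = 1`. With the landed
torus statics `torusStressMoment_zero` (`M_N(0) = θ²∫χ₁χ₂` for every `N`) and B1 this IS the `s = 0` case of B2 for
every framework. Leans on: `HardSphereDLR.lintegral_eq_lintegral_gibbsSpecMeasure`, `gibbsSpecMeasure`,
`maxwellPhaseMeasure_eq_prod`, `FluctuationStructure.norm_fluct_sq`, `koopman_zero_apply`,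
`integral_cellCharge_zero_eq_toReal_density`. -/
def StressAutocorrelationZero : Prop :=
  ∀ (σ θ z : ℝ), 0 < σ → 0 < θ → 0 < z → ∀ F : HardSphereFluctuationData σ, IsStressFramework σ θ z F →
    stressAutocorrelation F 0 = θ ^ 2

/-- **B2pos · TorusStressIdentificationPos** (L/XL, OPEN — the DYNAMIC content of B2core: B2core verbatim with `0 < s`).
For all small `σ` and every `θ` there are an activity `z` and ONE density-one framework `F` for which the torus
two-time stress covariances converge to `c_F(s)·∫χ₁χ₂` for every flow family, continuous `χ₁, χ₂` and `s > 0`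
(two-time locality in law of Alexander's dynamics at fixed kinetic time on the blown-up torus + canonical →
grand-canonical equivalence for two-time one-body observables; Spohn 1991 Part I (7.14)–(7.15)). -/
def TorusStressIdentificationPos : Prop :=
  ∃ σ₂ : ℝ, 0 < σ₂ ∧ ∀ σ : ℝ, 0 < σ → σ < σ₂ → ∀ θ : ℝ, 0 < θ →
    ∃ z : ℝ, 0 < z ∧ ∃ F : HardSphereFluctuationData σ, IsStressFramework σ θ z F ∧
      ∀ Φ : (N : ℕ) → HardSphereFlow (Torus.geometry (Fin 3)) (hsDiameter σ N) (N + 1),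
      ∀ χ₁ χ₂ : T3 → ℝ, Continuous χ₁ → Continuous χ₂ → ∀ s : ℝ, 0 < s →
        Tendsto (fun N : ℕ => torusStressCov σ θ Φ χ₁ χ₂ s N) atTop
          (𝓝 (stressAutocorrelation F s * ∫ x, χ₁ x * χ₂ x))

/-- The two REAL FOURIER MONOMIALS of wavenumber `n ∈ ℤ³` on the macroscopic torus: `x ↦ Re e^{2πi n·x}` and `x ↦ Im e^{2πi n·x}`
(real and imaginary parts of Mathlib's `UnitAddTorus.mFourier n`; their real span — the real trigonometric polynomials — is dense
in `C(𝕋³, ℝ)` by `UnitAddTorus.span_mFourier_closure_eq_top`). -/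
def trigMonomials (n : Fin 3 → ℤ) : Set (T3 → ℝ) :=
  {fun x : T3 => (UnitAddTorus.mFourier n x).re, fun x : T3 => (UnitAddTorus.mFourier n x).im}

/-- **B2trig · TorusStressIdentificationTrig** (OPEN — the finite→infinite-volume content of B2pos at FIXED MACROSCOPIC WAVENUMBER,
typed by lead c4).  On every density-one framework `F` at small `σ`, for every flow family, every pair of real Fourier monomials
`χ₁ ∈ {Re, Im} e^{2πi n·x}`, `χ₂ ∈ {Re, Im} e^{2πi m·x}` and every `s > 0`, the crux's torus two-time stress moment converges:
`M_N(s; χ₁, χ₂) → c_F(s)·∫χ₁χ₂`.  Content: the two-time kinetic shear-stress structure factor of the density-one torus gas at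
microscopic wavenumber `2πn(N+1)^{-1/3} → 0` converges to the `k = 0` infinite-volume autocorrelation (two-time locality in law
of the torus dynamics uniformly in `N` + canonical → grand-canonical equivalence; Spohn 1991 Part I (7.14)–(7.15)); the
`n = m = 0` instance is the molecular-dynamics statement `(N+1)⁻¹ Cov_{G_N}(S(s(N+1)^{-1/3}), S(0)) → c_F(s)` for the total
kinetic shear stress `S = Σᵢ vᵢ⁰vᵢ¹`; for `n ≠ ±m` the limit is `0` (translation invariance of `G_N` and a.e. covariance of the
torus flow).  With the density glue `TorusStressIdentificationPosOfTrig` (provable now) it gives the identification for all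
continuous test functions. -/
def TorusStressIdentificationTrig : Prop :=
  ∃ σ₂ : ℝ, 0 < σ₂ ∧ ∀ σ : ℝ, 0 < σ → σ < σ₂ → ∀ θ : ℝ, 0 < θ → ∀ z : ℝ, 0 < z →
    ∀ F : HardSphereFluctuationData σ, IsStressFramework σ θ z F →
    ∀ Φ : (N : ℕ) → HardSphereFlow (Torus.geometry (Fin 3)) (hsDiameter σ N) (N + 1),
    ∀ n m : Fin 3 → ℤ, ∀ χ₁ ∈ trigMonomials n, ∀ χ₂ ∈ trigMonomials m, ∀ s : ℝ, 0 < s →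
      Tendsto (fun N : ℕ => torusStressMoment σ θ Φ χ₁ χ₂ s N) atTop
        (𝓝 (stressAutocorrelation F s * ∫ x, χ₁ x * χ₂ x))

/-- **B2all · TorusStressIdentificationPosAll** (the `∀ F`, raw-moment, `s > 0` form of the identification for ALL continuous
test functions; derived from B2trig by the density glue). -/
def TorusStressIdentificationPosAll : Prop :=
  ∃ σ₂ : ℝ, 0 < σ₂ ∧ ∀ σ : ℝ, 0 < σ → σ < σ₂ → ∀ θ : ℝ, 0 < θ → ∀ z : ℝ, 0 < z →
    ∀ F : HardSphereFluctuationData σ, IsStressFramework σ θ z F →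
    ∀ Φ : (N : ℕ) → HardSphereFlow (Torus.geometry (Fin 3)) (hsDiameter σ N) (N + 1),
    ∀ χ₁ χ₂ : T3 → ℝ, Continuous χ₁ → Continuous χ₂ → ∀ s : ℝ, 0 < s →
      Tendsto (fun N : ℕ => torusStressMoment σ θ Φ χ₁ χ₂ s N) atTop
        (𝓝 (stressAutocorrelation F s * ∫ x, χ₁ x * χ₂ x))

/-- **B2glue · TorusStressIdentificationPosOfTrig** (PROVABLE NOW — registered for wave 1 of cycle 4):
`TorusStressIdentificationTrig → TorusStressIdentificationPosAll`.  Proof plan (`σ₂ := min σ₂ (1/2)`): `M_N(s; χ₁, χ₂)` is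
bilinear in `(χ₁, χ₂)` (linearity of `χ ↦ Π(χ)` against the empirical measure and of the `G_N`-integral on `L²` fields) and
`|M_N(s; χ₁, χ₂)| ≤ θ² (∫χ₁²)^{1/2} (∫χ₂²)^{1/2} ≤ θ² ‖χ₁‖_∞ ‖χ₂‖_∞` uniformly in `N` (landed `abs_torusStressMoment_le`);
real trigonometric polynomials (real spans of `trigMonomials`) are dense in `C(𝕋³, ℝ)` for the sup norm (real parts of
`UnitAddTorus.span_mFourier_closure_eq_top`); so approximate `χᵢ` by `Pᵢ` within `ε`, pass to the limit on `M_N(s; P₁, P₂)`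
termwise, and use `|∫χ₁χ₂ - ∫P₁P₂| ≤ ε(‖χ₁‖_∞ + ‖P₂‖_∞)` — a `3ε` argument. -/
def TorusStressIdentificationPosOfTrig : Prop := TorusStressIdentificationTrig → TorusStressIdentificationPosAll

/-- **B2diag · TorusStressDiagonalLimit** (OPEN — the DIAGONAL CORE of B2trig, typed by lead c4 after the wave-1 census: the two-time
kinetic shear-stress structure factor of the density-one torus gas at fixed macroscopic wavenumber).  On every density-one framework
`F` at small `σ`, for every flow family, wavenumber `n ∈ ℤ³` and `s > 0`: `M_N(s; Re e_n, Re e_n) → c_F(s)·∫(Re e_n)²`.  At `n = 0`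
this is the molecular-dynamics statement `(N+1)⁻¹ Cov_{G_N}(S(s(N+1)^{-1/3}), S(0)) → c_F(s)`, `S = Σᵢ vᵢ⁰vᵢ¹` (landed
`torusStressMoment_wavenumber_zero`, `integral_re_mFourier_zero_sq`); for `n ≠ 0` the microscopic wavenumber is
`2πn(N+1)^{-1/3} → 0`.  Content (census M1–M4): two-time local limit IN LAW of the blown-up canonical torus process towards
`(μ, Alexander flow)` for bounded cylinder observables (dynamic Georgii — its static half `Georgii1995_hardSphereCanonicalLocalLimit` is
itself unproved), uniform-in-`N` covariance-scale clustering of the two-time truncated stress pair correlation, a provable endgame and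
the two-time Campbell identification of the limit constant with `⟪U_s ξ_Π, ξ_Π⟫_ℋ`.  All other instances of B2trig (off-resonant and
mixed pairs) are PROVED outright at every `N` (p168678). -/
def TorusStressDiagonalLimit : Prop :=
  ∃ σ₂ : ℝ, 0 < σ₂ ∧ ∀ σ : ℝ, 0 < σ → σ < σ₂ → ∀ θ : ℝ, 0 < θ → ∀ z : ℝ, 0 < z →
    ∀ F : HardSphereFluctuationData σ, IsStressFramework σ θ z F →
    ∀ Φ : (N : ℕ) → HardSphereFlow (Torus.geometry (Fin 3)) (hsDiameter σ N) (N + 1),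
    ∀ n : Fin 3 → ℤ, ∀ s : ℝ, 0 < s →
      Tendsto (fun N : ℕ => torusStressMoment σ θ Φ (fun x : T3 => (UnitAddTorus.mFourier n x).re)
          (fun x : T3 => (UnitAddTorus.mFourier n x).re) s N) atTop
        (𝓝 (stressAutocorrelation F s * ∫ x : T3, (UnitAddTorus.mFourier n x).re * (UnitAddTorus.mFourier n x).re))

/-! ### Reshape 12 (lead c6): the long-wavelength reduction of B2diag -/

/-- The two-time kinetic shear-stress PAIR FUNCTIONAL of the density-one torus gas tested against a function `f` of the
MACROSCOPIC displacement (lead c6, reshape 12):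
`P_N(s; f) := (N+1) · E_{G_N}[∫∫ f(y.1 - y'.1) Π(y.2) Π(y'.2) d(emp z)(y') d(emp Φ_{s_N} z)(y)]`
`= (N+1)⁻¹ Σ_{i,j} E_{G_N}[f(x_i(s_N) - x_j(0)) Π_i(s_N) Π_j(0)]`, `s_N = s(N+1)^{-1/3}` — the stress-weighted two-time pair
"measure" of the torus gas (self pairs `i = j` included) integrated against `f`.  `P_N(s; Re e_n)` is the two-time kinetic
shear-stress structure factor at macroscopic wavenumber `n` (`= M_N(s; Re e_n, Re e_n) + M_N(s; Im e_n, Im e_n)`, B3form), and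
`P_N(s; 1) = M_N(s; 1, 1) = (N+1)⁻¹ E_{G_N}[S(s_N) S(0)]`, `S = Σᵢ vᵢ⁰vᵢ¹`, is the molecular-dynamics stress autocorrelation of the
finite system (`torusStressMoment_wavenumber_zero`). -/
def torusStressPairFunctional (σ θ : ℝ)
    (Φ : (N : ℕ) → HardSphereFlow (Torus.geometry (Fin 3)) (hsDiameter σ N) (N + 1))
    (f : T3 → ℝ) (s : ℝ) (N : ℕ) : ℝ :=
  ((N : ℝ) + 1) * ∫ z, (∫ y, (∫ y', f (y.1 - y'.1) * (y.2 0 * y.2 1) * (y'.2 0 * y'.2 1)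
      ∂(empiricalMeasure z)) ∂(empiricalMeasure ((Φ N).flow (s * ((N : ℝ) + 1) ^ (-(1 / 3 : ℝ))) z)))
    ∂(localGibbsLaw σ (fun _ => 1) (fun _ => 0) (fun _ => θ) N (Φ N))

/-- **B3form · TorusStressPairForm** (PROVABLE NOW — finite-`N` Fourier bookkeeping; registered by lead c6 for wave 1 of cycle 6).
For `0 < σ ≤ 1/2`, `θ > 0`, every flow family, wavenumber `n`, time `s` and `N`:
`M_N(s; Re e_n, Re e_n) + M_N(s; Im e_n, Im e_n) = P_N(s; Re e_n)`.  Proof: pointwise in `z` both empirical integrals are finite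
sums (`integral_empiricalMeasure`) and `Re e_n(x) Re e_n(y) + Im e_n(x) Im e_n(y) = Re(e_n(x) conj e_n(y)) = Re e_n(x - y)`
(`mFourier_apply_add_T3`, `mFourier_neg`); then `∫ (A + B) dG_N = ∫ A + ∫ B` by the landed
`integrable_stressField_flow_mul_of_continuous` (`σ ≤ 1/2`, `θ > 0`). -/
def TorusStressPairForm : Prop :=
  ∀ σ : ℝ, 0 < σ → σ ≤ 1 / 2 → ∀ θ : ℝ, 0 < θ →
    ∀ Φ : (N : ℕ) → HardSphereFlow (Torus.geometry (Fin 3)) (hsDiameter σ N) (N + 1),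
    ∀ (n : Fin 3 → ℤ) (s : ℝ) (N : ℕ),
      torusStressMoment σ θ Φ (fun x : T3 => (UnitAddTorus.mFourier n x).re)
          (fun x : T3 => (UnitAddTorus.mFourier n x).re) s N +
        torusStressMoment σ θ Φ (fun x : T3 => (UnitAddTorus.mFourier n x).im)
          (fun x : T3 => (UnitAddTorus.mFourier n x).im) s N =
      torusStressPairFunctional σ θ Φ (fun x : T3 => (UnitAddTorus.mFourier n x).re) s N

/-- **B3loc · TorusStressPairLocality** (OPEN core — MACROSCOPIC LOCALITY of the two-time stress pair functional, typed minimally by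
lead c6: exactly what the long-wavelength step consumes; the torus twin of the infinite-volume space–time clustering F3b).  For all
small `σ`, every `θ > 0`, every flow family, every `s > 0` and every continuous `f : 𝕋³ → ℝ`:
`P_N(s; f) - f(0) · P_N(s; 1) → 0` as `N → ∞` — at a fixed MICROSCOPIC time the stress-weighted two-time pair correlation of the
torus gas carries, as `N → ∞`, no mass at MACROSCOPIC displacements, and has bounded variation near zero displacement, so that a
continuous test function of the macroscopic displacement may be replaced by its value at `0`.  Content: (i) a uniform-in-`N` bound
`|P_N(s; f)| ≤ C ‖f‖_∞` (total variation of the two-time stress pair measure: resampling `v_j`, a pair `(i, j)` contributes only if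
`j` lies in the backward collision cluster of `i` over `[0, s_N]` for the original or the resampled velocity, so the bound is a
velocity-weighted cluster-size moment, uniform in `N` at small packing; self pairs by Cauchy–Schwarz and stationarity);
(ii) vanishing of the mass at macroscopic distance `≥ δ`, i.e. microscopic distance `≥ δ(N+1)^{1/3} → ∞` (reach tail of the
clusters; Maxwellian tail `‖v‖ ≥ δ(N+1)^{1/3}/s` for the self pairs).  No print source at fixed packing (folklore; the
Boltzmann–Grad analogue is controlled in BGSS, CPAM 2023); implied by, and much weaker than, the covariance-scale (microscopic)
tightness "M2" of the c4 census.  Why it might fail: only through heavy tails of the collision-cluster size/reach at fixed small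
packing, uniformly in the volume. -/
def TorusStressPairLocality : Prop :=
  ∃ σ₂ : ℝ, 0 < σ₂ ∧ ∀ σ : ℝ, 0 < σ → σ < σ₂ → ∀ θ : ℝ, 0 < θ →
    ∀ Φ : (N : ℕ) → HardSphereFlow (Torus.geometry (Fin 3)) (hsDiameter σ N) (N + 1),
    ∀ s : ℝ, 0 < s → ∀ f : T3 → ℝ, Continuous f →
      Tendsto (fun N : ℕ => torusStressPairFunctional σ θ Φ f s N -
          f 0 * torusStressPairFunctional σ θ Φ (fun _ => 1) s N) atTop (𝓝 0)

/-- **B2diag₀ · TorusStressDiagonalLimitZero** (OPEN core — the WAVENUMBER-ZERO instance of B2diag, verbatim; the molecular-dynamics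
statement).  On every density-one framework `F` at small `σ`, for every flow family and `s > 0`:
`M_N(s; Re e_0, Re e_0) → c_F(s) · ∫(Re e_0)²`, i.e. (`torusStressMoment_wavenumber_zero`, `∫(Re e_0)² = 1`)
`(N+1)⁻¹ E_{G_N}[S(s_N) S(0)] → c_F(s) = ⟪U_s ξ_Π, ξ_Π⟫_ℋ`, `S = Σᵢ vᵢ⁰vᵢ¹`: the finite-volume Green–Kubo integrand of the
kinetic–kinetic shear viscosity converges, at each fixed microscopic time, to the infinite-volume one.  Content (c4 census
M1 + M2 + M4): two-time local limit IN LAW of the blown-up canonical torus process seen from a tagged particle towards the Palm version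
of `(μ, Alexander flow)` ("dynamic Georgii"; static half = the named fact `Georgii1995_hardSphereCanonicalLocalLimit`, itself unproved),
uniform integrability from microscopic clustering uniform in `N`, and the two-time Campbell identification of the limit with
`⟪U_s ξ_Π, ξ_Π⟫_ℋ = ∫ Cov_μ(Π_C ∘ φ_s, Π_{C+x}) dx` (`inner_fluct_koopman_fluct`).  Spohn 1991 Part I (7.14)–(7.15) states it without
proof; no print source at fixed packing. -/
def TorusStressDiagonalLimitZero : Prop :=
  ∃ σ₂ : ℝ, 0 < σ₂ ∧ ∀ σ : ℝ, 0 < σ → σ < σ₂ → ∀ θ : ℝ, 0 < θ → ∀ z : ℝ, 0 < z →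
    ∀ F : HardSphereFluctuationData σ, IsStressFramework σ θ z F →
    ∀ Φ : (N : ℕ) → HardSphereFlow (Torus.geometry (Fin 3)) (hsDiameter σ N) (N + 1),
    ∀ s : ℝ, 0 < s →
      Tendsto (fun N : ℕ => torusStressMoment σ θ Φ (fun x : T3 => (UnitAddTorus.mFourier (0 : Fin 3 → ℤ) x).re)
          (fun x : T3 => (UnitAddTorus.mFourier (0 : Fin 3 → ℤ) x).re) s N) atTop
        (𝓝 (stressAutocorrelation F s *
          ∫ x : T3, (UnitAddTorus.mFourier (0 : Fin 3 → ℤ) x).re * (UnitAddTorus.mFourier (0 : Fin 3 → ℤ) x).re))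

/-- **B3lw · TorusStressLongWavelength** (PROVABLE NOW — the long-wavelength glue; registered by lead c6 for wave 1 of cycle 6):
`TorusStressPairForm → TorusStressPairLocality → TorusStressDiagonalLimitZero → TorusStressDiagonalLimit`.  Proof plan
(`σ₂ := min σ₂(B3loc) (min σ₂(B2diag₀) (1/2))`; fix `F`, `Φ`, `n`, `s > 0`): for `n = 0` the conclusion IS B2diag₀.  For `n ≠ 0`:
B3form at wavenumber `0` with `Re e_0 = 1`, `Im e_0 = 0` (`re_mFourier_zero`; the `Im` moment is `(N+1)·∫0 = 0`) turns B2diag₀ into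
`P_N(s; 1) → c_F(s)` (`integral_re_mFourier_zero_sq`); B3loc with `f := Re e_n` (`Re e_n(0) = 1`, `mFourier n 0 = 1`) then gives
`P_N(s; Re e_n) → c_F(s)`; B3form at `n` with the landed isotropy `torusStressMoment_im_im_eq_re_re` (`n ≠ 0`, `σ ≤ 1/2`) gives
`2 M_N(s; Re e_n, Re e_n) = P_N(s; Re e_n)`, and `∫(Re e_n)² = 1/2` (`integral_re_mul_re_mFourier`, `n + n ≠ 0`). -/
def TorusStressLongWavelength : Prop :=
  TorusStressPairForm → TorusStressPairLocality → TorusStressDiagonalLimitZero → TorusStressDiagonalLimit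

/-- **F3a · GeneratorMoments** (M/L of a known kind — the STATIC input of F3; no smallness, no dynamics). Under every
DLR Gibbs state of the hard-sphere gas (diameter `σ`, activity `z`, inverse temperature `θ⁻¹`, zero drift) the six
generators — the five cell charges and the cell shear stress `Σ_{q ∈ [0,1)³} v⁰v¹` — are in `L²(μ)`: the hard core bounds
the number of centres in the unit cell, and the Maxwellian velocity marks of the specification have fourth moments
(conditional-Maxwellian structure of `gibbsSpec`). The positivity of the structure factor on the flow–shift span is
NOT assumed any more: it follows from F3a, F3b and the landed Følner lemma `integral_cov_spatialShift_nonneg`. -/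
def GeneratorMoments : Prop :=
  ∀ (σ θ z : ℝ), 0 < σ → 0 < θ → 0 < z → ∀ μ : Measure MarkedConfig, IsHardSphereGibbs σ z θ⁻¹ (0 : V3) μ →
    ∀ a ∈ Set.range cellCharge ∪ {cellObs fun v : V3 => v 0 * v 1}, MemLp a 2 μ

/-- **F3b · TwoTimeClustering** (OPEN — the dynamic core of F3 and of Spohn's `ℋ`, MINIMAL generators). For all small
`σ`, every equilibrium flow `Φ` and every translation-invariant density-one Gibbs state `μ` at `(σ, z, θ⁻¹)`: for any two
of the six generators `a, b` (five cell charges, cell shear stress) and every time `t`, the truncated two-time two-point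
function is spatially integrable, `x ↦ Cov_μ(a, (b ∘ Φ_t) ∘ τ_x) ∈ L¹(ℝ³)` — Spohn 1991 Part I (7.6)/(7.14) "since the
truncated correlations decay" for the five conserved fields and the stress at fixed small packing (`t = 0`: Ruelle's
cluster expansion; `t ≠ 0`: no print source). With Fcov and F3static it yields the admissible observable space
`flowShiftSpan Φ {charges, stress}` (landed span reductions `memLp_of_mem_flowShiftSpan`,
`integrable_cov_of_mem_flowShiftSpan`). -/
def TwoTimeClustering : Prop :=
  ∃ σ₃ : ℝ, 0 < σ₃ ∧ ∀ σ : ℝ, 0 < σ → σ < σ₃ → ∀ Φ : InfiniteHardSphereFlow (Fin 3) σ,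
    Φ.IsEquilibriumFlow → ∀ θ z : ℝ, 0 < θ → 0 < z →
    ∀ μ : Measure MarkedConfig, IsHardSphereGibbs σ z θ⁻¹ (0 : V3) μ → IsTranslationInvariant μ →
      PointProcess.density μ = 1 →
      ∀ a ∈ Set.range cellCharge ∪ {cellObs fun v : V3 => v 0 * v 1},
      ∀ b ∈ Set.range cellCharge ∪ {cellObs fun v : V3 => v 0 * v 1}, ∀ t : ℝ,
        Integrable (fun x : V3 => cov[a, (b ∘ Φ.flow t) ∘ spatialShift x; μ]) volume

/-- **F3static · StaticClustering** (L of a known kind — the `t = 0` half of F3b, split off by lead c3 after wave 1).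
For all small `σ` and every translation-invariant density-one hard-sphere DLR state `μ` at `(σ, z, θ⁻¹)`: for any two of
the six generators the STATIC truncated two-point function is spatially integrable, `x ↦ Cov_μ(a, b ∘ τ_x) ∈ L¹(ℝ³)`
(Ruelle 1969 §4.4: exponential clustering of the low-activity gas; Spohn 1991 Part I Condition 2.1). Why provable now:
density one forces `z σ³ ≲ σ³` small (GNZ sandwich), the tree's uniform boundary-condition pinning
`abs_hsLocalSpec_toReal_sub_le` (RiemannLocalGibbsBoundary.lean: specifications on `B(0,R)` with two hard-core boundary
conditions differ on `B(0,k)`-local events by `≤ 2ν(B_k)e^{ν(B_k)}(2κ)^d`, `R ≥ k + (d+2)σ`, `κ = z·vol B(·,σ)`) and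
the DLR equation give exponential `φ`-MIXING of `μ` between the `σ`-algebra of a ball and that of the complement of a
larger ball, hence `|Cov_μ(f, g)| ≤ 2φ ‖f‖_∞ ‖g‖₁` for inside-bounded `f` / outside-`L¹` `g`; truncate the Maxwellian
marks of `a` (all moments finite, `memLp_two_linStat_of_isHardSphereGibbs`) and conclude with the landed reduction
`integrable_cov_comp_spatialShift_of_decay` (p158195). -/
def StaticClustering : Prop :=
  ∃ σ₃ : ℝ, 0 < σ₃ ∧ ∀ σ : ℝ, 0 < σ → σ < σ₃ → ∀ θ z : ℝ, 0 < θ → 0 < z →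
    ∀ μ : Measure MarkedConfig, IsHardSphereGibbs σ z θ⁻¹ (0 : V3) μ → IsTranslationInvariant μ →
      PointProcess.density μ = 1 →
      ∀ a ∈ Set.range cellCharge ∪ {cellObs fun v : V3 => v 0 * v 1},
      ∀ b ∈ Set.range cellCharge ∪ {cellObs fun v : V3 => v 0 * v 1},
        Integrable (fun x : V3 => cov[a, b ∘ spatialShift x; μ]) volume

/-- **F3dyn · DynamicClusteringUpgrade** (OPEN — the DYNAMIC content of F3b: static ⇒ space–time clustering). Given static
clustering of the generators, the two-time truncated correlations of the generators under ANY equilibrium flow are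
spatially integrable as well. Content: LOCALITY IN LAW of the equilibrium (Alexander) dynamics at low density — the
time-`t` image of the unit-cell configuration is, off an event of probability `≤ K_t e^{-κL}`, a function of the initial
configuration in `B(0, L)` (finite collision clusters on `[0, t]` with an exponential diameter tail; Alexander 1976 §4–5
proves finiteness, no print source gives the tail at fixed packing) — combined with `φ`-mixing for GENERAL ball-local `L²`
observables and `L⁴` Maxwellian moments (truncation).  The landed `twoTimeClustering_of_decay` (p158195) is the endgame. -/
def DynamicClusteringUpgrade : Prop := StaticClustering → TwoTimeClustering

/-- **Loc · FlowLocality** (OPEN — the DYNAMICAL input of F3b, typed minimally by lead c4; no print source at fixed packing).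
For all small `σ`, every equilibrium flow `Φ`, every translation-invariant density-one hard-sphere Gibbs state `μ` at
`(σ, z, θ⁻¹)`, each of the six generators `b` and every time `t`: the time-evolved observable `b ∘ Φ_t` is approximable in
`L²(μ)` by CYLINDER FUNCTIONS OF BALLS with an exponential rate — there are `K ≥ 0`, `κ > 0` such that for every `L > 0` some
measurable `g ∈ L²(μ)` depending only on the configuration in `B(0, L) × ℝ³` (`IsCylinder (B(0,L)) g`) has
`∫ (b ∘ Φ_t - g)² dμ ≤ K e^{-κL}`.  Why plausible: finite speed of dependence of the dilute equilibrium hard-sphere dynamics in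
law — `b ∘ Φ_t` differs from the evolution of the particles initially in `B(0, L)` only if a collision chain or a fast particle
connects `B(0, L)ᶜ` to the unit cell within time `t`; at low activity a chain spanning distance `L` costs `(C z σ³)^{L/σ}` and a
fast particle a Maxwellian tail, iterated over `t/δ` stationary steps (Alexander 1976 §4–5 proves the finiteness of the clusters,
not the tail).  Why it might fail: only through a heavy tail of the interaction-cluster diameter at fixed packing (any rate
integrable against `L² dL` would still give F3b).  Leans on: `InfiniteHardSphereFlow.IsEquilibriumFlow`, `IsHardSphereGibbs`,
`IsCylinder`, `cellCharge`, `cellObs`. -/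
def FlowLocality : Prop :=
  ∃ σ₄ : ℝ, 0 < σ₄ ∧ ∀ σ : ℝ, 0 < σ → σ < σ₄ → ∀ Φ : InfiniteHardSphereFlow (Fin 3) σ,
    Φ.IsEquilibriumFlow → ∀ θ z : ℝ, 0 < θ → 0 < z →
    ∀ μ : Measure MarkedConfig, IsHardSphereGibbs σ z θ⁻¹ (0 : V3) μ → IsTranslationInvariant μ →
      PointProcess.density μ = 1 →
      ∀ b ∈ Set.range cellCharge ∪ {cellObs fun v : V3 => v 0 * v 1}, ∀ t : ℝ,
        ∃ K κ : ℝ, 0 ≤ K ∧ 0 < κ ∧ ∀ L : ℝ, 0 < L →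
          ∃ g : MarkedConfig → ℝ, Measurable g ∧ MemLp g 2 μ ∧ IsCylinder (Metric.ball (0 : V3) L) g ∧
            ∫ ω, (b (Φ.flow t ω) - g ω) ^ 2 ∂μ ≤ K * Real.exp (-(κ * L))

/-- **F3glue · TwoTimeClusteringOfLocality** (PROVABLE NOW — the analysis half of F3b, registered for wave 1 of cycle 4):
`FlowLocality → TwoTimeClustering`.  Proof plan: at a shift `x` with `‖x‖ ≥ 16 + 4σ` put `L = ‖x‖/2` and take `g` from Loc;
`Cov(a, (b∘Φ_t)∘τ_x) = Cov(a, g∘τ_x) + Cov(a, (b∘Φ_t - g)∘τ_x)`; the second piece is `≤ (Var a · K)^{1/2} e^{-κ‖x‖/4}`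
(`abs_cov_comp_spatialShift_le`, shift invariance); for the first, clamp `a` at height `q^{-d/2}` (`abs_cov_sub_clamp_le`,
fourth moments `integrable_pow_four_of_mem_generators`) and apply the `φ`-mixing bound `abs_cov_le_of_isHardSphereGibbs` with
inner radius `4`, outer radius `‖x‖/2` (`g ∘ τ_x` is a cylinder function of `B(0, ‖x‖/2)ᶜ` since `g` only sees `B(0, L)`),
exactly as in the landed `stub_staticClustering`; both pieces are `≤ A e^{-c‖x‖}`, and `integrable_cov_flow_spatialShift_of_decay`
concludes. -/
def TwoTimeClusteringOfLocality : Prop := FlowLocality → TwoTimeClustering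

/-- **Loc0 · FlowLocalityInLaw** (OPEN — EVENT-LEVEL locality of the dilute equilibrium dynamics, typed by lead c4 after the wave-1
census; no print source at fixed packing).  For all small `σ`, every equilibrium flow `Φ`, every translation-invariant density-one
hard-sphere Gibbs state `μ` at `(σ, z, θ⁻¹)`, each generator `b` and every time `t`: there are `K₀ ≥ 0`, `κ₀ > 0`, `C` and `m` such
that for every `L > 0` some measurable cylinder function `g` of `B(0, L)` with fourth moment `∫ g⁴ dμ ≤ C (1 + L)^m` agrees with
`b ∘ Φ_t` off an event of `μ`-measure `≤ K₀ e^{-κ₀ L}`.  Intended `g`: `b` evaluated on the truncated free-space evolution of the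
particles initially in `B(0, L)`; intended event: the collision cluster of the unit cell over `[0, t]` is infinite or reaches outside
`B(0, L/2)` (for `Φ` or for the truncated evolution).  Content (census I1–I4): exponential reach tail of the collision clusters under
the dilute Gibbs state for an ARBITRARY equilibrium flow (a.s. logarithmic velocity growth, static insulation percolation at
`16 z σ³ < 1`, deterministic bootstrap, stationary iteration over `t/δ` steps), a measurable truncated cylinder dynamics, cluster
determination, window fourth moments.  Alexander 1976 §4–5 / Sinai 1974 (DSS Ch. 10 §4.1) prove FINITENESS of the clusters only. -/
def FlowLocalityInLaw : Prop :=
  ∃ σ₄ : ℝ, 0 < σ₄ ∧ ∀ σ : ℝ, 0 < σ → σ < σ₄ → ∀ Φ : InfiniteHardSphereFlow (Fin 3) σ,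
    Φ.IsEquilibriumFlow → ∀ θ z : ℝ, 0 < θ → 0 < z →
    ∀ μ : Measure MarkedConfig, IsHardSphereGibbs σ z θ⁻¹ (0 : V3) μ → IsTranslationInvariant μ →
      PointProcess.density μ = 1 →
      ∀ b ∈ Set.range cellCharge ∪ {cellObs fun v : V3 => v 0 * v 1}, ∀ t : ℝ,
        ∃ (K₀ κ₀ C : ℝ) (m : ℕ), 0 ≤ K₀ ∧ 0 < κ₀ ∧ ∀ L : ℝ, 0 < L →
          ∃ g : MarkedConfig → ℝ, Measurable g ∧ IsCylinder (Metric.ball (0 : V3) L) g ∧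
            Integrable (fun ω => g ω ^ 4) μ ∧ (∫ ω, g ω ^ 4 ∂μ ≤ C * (1 + L) ^ m) ∧
            μ {ω | b (Φ.flow t ω) ≠ g ω} ≤ ENNReal.ofReal (K₀ * Real.exp (-(κ₀ * L)))

/-- **LocGlue0 · FlowLocalityOfInLaw** (PROVABLE NOW — census I5, pure measure theory): `FlowLocalityInLaw → FlowLocality`
(`b ∘ Φ_t` has a finite fourth moment by stationarity and `integrable_pow_four_of_mem_generators`; on `{b ∘ Φ_t ≠ g}` bound
`(F - g)² ≤ λ/2 + (F - g)⁴/(2λ)` with `λ = e^{-κ₀L/2}` and integrate: `≤ λ/2·μ{≠}·… + 8(∫F⁴ + ∫g⁴)/(2λ)`-type AM–GM bookkeeping giving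
`K e^{-κL}` with `κ = κ₀/4`). -/
def FlowLocalityOfInLaw : Prop := FlowLocalityInLaw → FlowLocality

/-- The window energy statistic `Σ_{q ∈ ω, q ∈ B(0,L)} (1 + ‖v_q‖²)` (number plus twice the kinetic energy of the particles in the ball
`B(0, L)`; a linear statistic, `linStat`). -/
def windowEnergyStat (L : ℝ) (ω : MarkedConfig) : ℝ :=
  linStat (fun p => (Metric.ball (0 : V3) L).indicator (fun _ => 1 + ‖p.2‖ ^ 2) p.1) ω

/-- **I4 · WindowFourthMoments** (PROVABLE NOW — census I4 of the wave-1 worker on Loc; registered for wave 2).  Under every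
translation-invariant hard-sphere Gibbs state at `(σ, z, θ⁻¹)` the window energy statistic of `B(0, L)` has a fourth moment
`≤ C (1 + L)^{12}` for all `L > 0` (hard core: at most `C_σ (1 + L)³` centres in the ball; conditionally on the positions the velocity
marks are i.i.d. centred Maxwellians with all moments — `lintegral_pow_four_linStat_gibbsSpecMeasure_le`-type bounds on a cover of the
ball by unit cells, translation invariance). -/
def WindowFourthMoments : Prop :=
  ∀ σ z θ : ℝ, 0 < σ → 0 < z → 0 < θ → ∀ μ : Measure MarkedConfig, IsHardSphereGibbs σ z θ⁻¹ (0 : V3) μ →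
    IsTranslationInvariant μ → ∃ C : ℝ, ∀ L : ℝ, 0 < L →
      Integrable (fun ω => (linStat (fun p => (Metric.ball (0 : V3) L).indicator (fun _ => 1 + ‖p.2‖ ^ 2) p.1) ω) ^ 4) μ ∧
      ∫ ω, (linStat (fun p => (Metric.ball (0 : V3) L).indicator (fun _ => 1 + ‖p.2‖ ^ 2) p.1) ω) ^ 4 ∂μ ≤ C * (1 + L) ^ 12

/-- **LocDom · FlowLocalityDominated** (OPEN — the DYNAMICAL content of Loc0 alone: finite speed of dependence IN PROBABILITY with
energy-dominated cylinder approximants; typed by lead c4).  For all small `σ`, every equilibrium flow `Φ`, every translation-invariant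
density-one hard-sphere Gibbs state `μ` at `(σ, z, θ⁻¹)`, each generator `b` and time `t`: there are `K₀ ≥ 0`, `κ₀ > 0`, `A` such that for
every `L > 0` some measurable cylinder function `g` of `B(0, L)`, dominated pointwise by `A · Σ_{q ∈ B(0,L)} (1 + ‖v_q‖²)`, agrees with
`b ∘ Φ_t` off an event of `μ`-measure `≤ K₀ e^{-κ₀ L}`.  Intended `g`: `b` evaluated at time `t` on the free-space hard-sphere evolution of
the particles initially in `B(0, L)` (exterior deleted), times the indicator of a certified-insulation cylinder event; the domination is
number/energy conservation of that finite evolution (`|v⁰v¹| ≤ ‖v‖²`, `|chargeFn i v| ≤ (1 + ‖v‖)² ≤ 2(1 + ‖v‖²)`); the exceptional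
event: the collision cluster of the unit cell over `[0, t]` reaches outside `B(0, L/2)` (for `Φ` or for the truncated evolution) or `ω`
is not good.  Content = census I1 (exponential reach tail of the clusters for an ARBITRARY equilibrium flow under the dilute Gibbs
state: a.s. logarithmic velocity growth, static insulation percolation at `16 z σ³ < 1`, deterministic bootstrap, stationary iteration),
I2 (measurable truncated cylinder dynamics), I3 (cluster determination); ≈ 6–8 kLoC; Alexander 1976 §4–5 / Sinai 1974 give finiteness
only, no tail in print. -/
def FlowLocalityDominated : Prop :=
  ∃ σ₄ : ℝ, 0 < σ₄ ∧ ∀ σ : ℝ, 0 < σ → σ < σ₄ → ∀ Φ : InfiniteHardSphereFlow (Fin 3) σ,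
    Φ.IsEquilibriumFlow → ∀ θ z : ℝ, 0 < θ → 0 < z →
    ∀ μ : Measure MarkedConfig, IsHardSphereGibbs σ z θ⁻¹ (0 : V3) μ → IsTranslationInvariant μ →
      PointProcess.density μ = 1 →
      ∀ b ∈ Set.range cellCharge ∪ {cellObs fun v : V3 => v 0 * v 1}, ∀ t : ℝ,
        ∃ K₀ κ₀ A : ℝ, 0 ≤ K₀ ∧ 0 < κ₀ ∧ ∀ L : ℝ, 0 < L →
          ∃ g : MarkedConfig → ℝ, Measurable g ∧ IsCylinder (Metric.ball (0 : V3) L) g ∧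
            (∀ ω, |g ω| ≤ A * linStat (fun p => (Metric.ball (0 : V3) L).indicator (fun _ => 1 + ‖p.2‖ ^ 2) p.1) ω) ∧
            μ {ω | b (Φ.flow t ω) ≠ g ω} ≤ ENNReal.ofReal (K₀ * Real.exp (-(κ₀ * L)))

/-- **LocDom and I4 imply Loc0** (pure bookkeeping: `∫ g⁴ ≤ A⁴ ∫ (Σ_{B_L}(1+‖v‖²))⁴ ≤ A⁴ C (1 + L)^{12}`). -/
theorem flowLocalityInLaw_of_dominated (hdom : FlowLocalityDominated) (hI4 : WindowFourthMoments) : FlowLocalityInLaw := by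
  obtain ⟨σ₄, hσ₄, H⟩ := hdom
  refine ⟨σ₄, hσ₄, fun σ hσ hσ' Φ hΦ θ z hθ hz μ hG hti hρ b hb t => ?_⟩
  obtain ⟨K₀, κ₀, A, hK₀, hκ₀, h⟩ := H σ hσ hσ' Φ hΦ θ z hθ hz μ hG hti hρ b hb t
  obtain ⟨C, hC⟩ := hI4 σ z θ hσ hz hθ μ hG hti
  refine ⟨K₀, κ₀, A ^ 4 * C, 12, hK₀, hκ₀, fun L hL => ?_⟩
  obtain ⟨g, hg, hcyl, hdomg, hbad⟩ := h L hL
  obtain ⟨hS4, hS4le⟩ := hC L hL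
  set S : MarkedConfig → ℝ := fun ω => linStat (fun p => (Metric.ball (0 : V3) L).indicator (fun _ => 1 + ‖p.2‖ ^ 2) p.1) ω
    with hSdef
  have hpt : ∀ ω, g ω ^ 4 ≤ A ^ 4 * S ω ^ 4 := fun ω => by
    have h1 : |g ω| ^ 4 ≤ (A * S ω) ^ 4 := pow_le_pow_left₀ (abs_nonneg _) (hdomg ω) 4
    have h2 : |g ω| ^ 4 = g ω ^ 4 := by rw [← abs_pow, abs_of_nonneg (by positivity)]
    rw [h2, mul_pow] at h1
    exact h1
  have hg4 : Integrable (fun ω => g ω ^ 4) μ := by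
    refine (hS4.const_mul (A ^ 4)).mono' ((hg.pow_const 4).aestronglyMeasurable) (Filter.Eventually.of_forall fun ω => ?_)
    rw [Real.norm_eq_abs, abs_of_nonneg (by positivity)]
    exact hpt ω
  refine ⟨g, hg, hcyl, hg4, ?_, hbad⟩
  calc ∫ ω, g ω ^ 4 ∂μ ≤ ∫ ω, A ^ 4 * S ω ^ 4 ∂μ := integral_mono hg4 (hS4.const_mul (A ^ 4)) hpt
    _ = A ^ 4 * ∫ ω, S ω ^ 4 ∂μ := integral_const_mul _ _
    _ ≤ A ^ 4 * (C * (1 + L) ^ 12) := mul_le_mul_of_nonneg_left hS4le (by positivity)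
    _ = A ^ 4 * C * (1 + L) ^ 12 := by ring

/-- **C1 · StressSpectralDensity** (XL; HARDEST — the spectral content of the crux, a.c. branch of the route's plan
"LAP ⇒ a.c. spectral measure of Π ⇒ Riemann–Lebesgue"). On every density-one framework `F` at small reduced
diameter, the spectral measure of the stress class `ξ_Π` under the Koopman group is absolutely continuous with an
integrable density: `∃ ρ ∈ L¹(ℝ), ∀ s, ⟪U_s ξ_Π, ξ_Π⟫_ℋ = ∫ cos(sλ) ρ(λ) dλ` (the real, even form: `ℋ` is real and
`c_F` is even). Intended proof: Mourre estimate / limiting absorption principle for the Liouvillian off a discrete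
threshold set seen by `ξ_Π` with an integrable boundary value (Mourre 1981, ABG 1996; the route's engine
`CollisionCommutatorRegularityR` + repaired `TwoScaleMourreAtZero` + `GlobalMourre`). Why it might fail: an eigenvalue
or singular-continuous component of `iL` seen by the stress; failure of strong continuity of `U`. MD/kinetic theory:
`ρ` continuous, `ρ(λ) - ρ(0) ≍ -|λ|^{1/2}` (the `s^{-3/2}` tail). -/
def StressSpectralDensity : Prop :=
  ∃ σ₀ : ℝ, 0 < σ₀ ∧ ∀ σ : ℝ, 0 < σ → σ < σ₀ → ∀ θ : ℝ, 0 < θ → ∀ z : ℝ, 0 < z →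
    ∀ F : HardSphereFluctuationData σ, IsStressFramework σ θ z F →
      ∃ ρ : ℝ → ℝ, Integrable ρ ∧ ∀ s : ℝ, stressAutocorrelation F s = ∫ l, Real.cos (s * l) * ρ l

/-! ### Registered stubs (the open obligations of the line; `sorry` only here) -/

/-! The stub SIGNATURES are written FULLY EXPANDED over tree constants only (no skeleton-local `def`), so that a
`Theorems/` file — which cannot import this workfile — can state and prove each of them verbatim, by name, with the
same `open Literature.MathematicalPhysics.KineticTheory Literature.Analysis.FluidPDE` in force; each expanded type is
definitionally the named `Prop` above (`StressFramework`, `TorusStressRawEqCov`, `TorusStressCovIdentification`,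
`StressRajchman`: unfold `IsStressFramework`, `shearStress`, `torusStressMoment`, `torusStressCov`,
`stressAutocorrelation`), which is what the wiring `example` at the end of the file re-checks. -/

/-- Ruelle (formerly STUB Ruelle, the named fact `RuelleDiluteHardSphereGas`, Ruelle 1969 Thm 4.2.3): CLOSED —
DISCHARGED IN THE TREE (`RuelleDiluteHardSphereGas_holds`, `DiluteHardSphereGasProofs.lean`, 2026-08-17). -/
theorem stub_ruelleDiluteGas : Literature.MathematicalPhysics.StatisticalMechanics.RuelleDiluteHardSphereGas :=
  Literature.MathematicalPhysics.StatisticalMechanics.RuelleDiluteHardSphereGas_holds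

/-- F1 (formerly STUB F1, now PROVED from the Ruelle stub by the landed `diluteGibbsDensityOne_of_ruelle`, p152665): a
translation-invariant density-one DLR state at diameter `σ` exists for small `σ` (`= DiluteGibbsDensityOne`). -/
theorem stub_diluteGibbsDensityOne :
    ∃ σ₁ : ℝ, 0 < σ₁ ∧ ∀ σ : ℝ, 0 < σ → σ < σ₁ → ∀ θ : ℝ, 0 < θ →
      ∃ z : ℝ, 0 < z ∧ ∃ μ : Measure MarkedConfig,
        IsHardSphereGibbs σ z θ⁻¹ (0 : V3) μ ∧ IsTranslationInvariant μ ∧ PointProcess.density μ = 1 :=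
  Summit.AtomisticToContinuum.HydrodynamicLimit.Theorems.MourreKoopmanChargesStressStrongMixing.diluteGibbsDensityOne_of_ruelle
    stub_ruelleDiluteGas

/-- STUB F2∧Fu (named facts, Alexander 1976 Thm 5.2 + Cor. 5.4): existence and uniqueness of the equilibrium
hard-sphere flow in `ℝ³` (`= AlexanderFlow`). -/
theorem stub_alexanderFlow :
    InfiniteHardSphereFlow.nonempty (d := Fin 3) ∧ InfiniteHardSphereFlow.unique (d := Fin 3) := by
  sorry

/-- F2 (projection of STUB `stub_alexanderFlow`): existence of the equilibrium flow (`= AlexanderExistence`). -/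
theorem stub_alexanderExistence : InfiniteHardSphereFlow.nonempty (d := Fin 3) := stub_alexanderFlow.1

/-- Fu (projection of STUB `stub_alexanderFlow`): uniqueness of the equilibrium flow (`= AlexanderUnique`). -/
theorem stub_alexanderUnique : InfiniteHardSphereFlow.unique (d := Fin 3) := stub_alexanderFlow.2

/-- Fcov (formerly STUB Fcov, now PROVED from Fu by the landed `equilibriumFlowShiftCovariant_of_unique`, p152524):
equilibrium flows commute with the spatial translations a.e. in every Gibbs state (`= EquilibriumFlowShiftCovariant`). -/
theorem stub_equilibriumFlowShiftCovariant :
    ∀ σ : ℝ, 0 < σ → ∀ Φ : InfiniteHardSphereFlow (Fin 3) σ, Φ.IsEquilibriumFlow →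
      ∀ z β : ℝ, 0 < z → 0 < β → ∀ μ : Measure MarkedConfig, IsHardSphereGibbs σ z β (0 : V3) μ →
        ∀ (t : ℝ) (x : V3), Φ.flow t ∘ spatialShift x =ᵐ[μ] spatialShift x ∘ Φ.flow t :=
  -- CLOSED modulo Fu (wave 2, p152524): conjugation by `τ_x` + translation covariance of `gibbsSpec` (p152177)
  Summit.AtomisticToContinuum.HydrodynamicLimit.Theorems.MourreKoopmanChargesStressStrongMixing.equilibriumFlowShiftCovariant_of_unique
    stub_alexanderUnique

/-- F3a (formerly STUB F3a, CLOSED in wave 3 by the landed `memLp_generators_of_isHardSphereGibbs`): `L²` moments of the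
six generators under any hard-sphere DLR state (`= GeneratorMoments`). -/
theorem stub_generatorMoments :
    ∀ (σ θ z : ℝ), 0 < σ → 0 < θ → 0 < z → ∀ μ : Measure MarkedConfig, IsHardSphereGibbs σ z θ⁻¹ (0 : V3) μ →
      ∀ a ∈ Set.range cellCharge ∪ {cellObs fun v : V3 => v 0 * v 1}, MemLp a 2 μ :=
  -- CLOSED (wave 3, `Theorems/MourreKoopmanChargesStressStrongMixingGibbsMoments.lean`): DLR conditional-Maxwellian moments
  Summit.AtomisticToContinuum.HydrodynamicLimit.Theorems.MourreKoopmanChargesStressStrongMixing.memLp_generators_of_isHardSphereGibbs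

/-- F3static (formerly STUB F3static, CLOSED in cycle 3, wave 2: landed p162821 with helpers p161371 `…StaticClusteringPinning`
(abstract φ-mixing from pinning: layer cake + DLR for functions), p162147 `…StaticClusteringMixing`
(`abs_cov_le_of_isHardSphereGibbs`: `|Cov_μ(f, g)| ≤ 2Cφ‖g‖₁` for `f` bounded `B(0,k)`-local, `g` a `B(0,R)ᶜ`-cylinder,
`16 z σ³ < 1`), p161957 `…StaticClusteringMoments` (fourth moments of the generators), p162596 `…StaticClusteringLocality`
(clamp/truncation estimate); `σ₃ = 1/4`): static spatial clustering of the six generators for the density-one dilute Gibbs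
state (`= StaticClustering`, expanded). -/
theorem stub_staticClustering :
    ∃ σ₃ : ℝ, 0 < σ₃ ∧ ∀ σ : ℝ, 0 < σ → σ < σ₃ → ∀ θ z : ℝ, 0 < θ → 0 < z →
      ∀ μ : Measure MarkedConfig, IsHardSphereGibbs σ z θ⁻¹ (0 : V3) μ → IsTranslationInvariant μ →
        PointProcess.density μ = 1 →
        ∀ a ∈ Set.range cellCharge ∪ {cellObs fun v : V3 => v 0 * v 1},
        ∀ b ∈ Set.range cellCharge ∪ {cellObs fun v : V3 => v 0 * v 1},
          Integrable (fun x : V3 => cov[a, b ∘ spatialShift x; μ]) volume :=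
  Summit.AtomisticToContinuum.HydrodynamicLimit.Theorems.MourreKoopmanChargesStressStrongMixing.stub_staticClustering

/-- STUB LocDom (OPEN, typed by lead c4): event-level locality of the time-evolved generators under the dilute equilibrium dynamics
with energy-dominated cylinder approximants (`= FlowLocalityDominated`, expanded). -/
theorem stub_flowLocalityDominated :
    ∃ σ₄ : ℝ, 0 < σ₄ ∧ ∀ σ : ℝ, 0 < σ → σ < σ₄ → ∀ Φ : InfiniteHardSphereFlow (Fin 3) σ,
      Φ.IsEquilibriumFlow → ∀ θ z : ℝ, 0 < θ → 0 < z →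
      ∀ μ : Measure MarkedConfig, IsHardSphereGibbs σ z θ⁻¹ (0 : V3) μ → IsTranslationInvariant μ →
        PointProcess.density μ = 1 →
        ∀ b ∈ Set.range cellCharge ∪ {cellObs fun v : V3 => v 0 * v 1}, ∀ t : ℝ,
          ∃ K₀ κ₀ A : ℝ, 0 ≤ K₀ ∧ 0 < κ₀ ∧ ∀ L : ℝ, 0 < L →
            ∃ g : MarkedConfig → ℝ, Measurable g ∧ IsCylinder (Metric.ball (0 : V3) L) g ∧
              (∀ ω, |g ω| ≤ A * linStat (fun p => (Metric.ball (0 : V3) L).indicator (fun _ => 1 + ‖p.2‖ ^ 2) p.1) ω) ∧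
              μ {ω | b (Φ.flow t ω) ≠ g ω} ≤ ENNReal.ofReal (K₀ * Real.exp (-(κ₀ * L))) := by
  sorry

/-- I4 (formerly STUB I4, CLOSED in cycle 4, wave 2: landed p170434, `Theorems/…WindowFourthMoments.lean` — cover of the ball by
`27·⌈…⌉`-many unit cells, power mean, translation invariance, `C = 27⁴ E[X_{[0,1)³}⁴]`): fourth moments of the window energy statistic under a translation-invariant hard-sphere
Gibbs state (`= WindowFourthMoments`, expanded). -/
theorem stub_windowFourthMoments :
    ∀ σ z θ : ℝ, 0 < σ → 0 < z → 0 < θ → ∀ μ : Measure MarkedConfig, IsHardSphereGibbs σ z θ⁻¹ (0 : V3) μ →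
      IsTranslationInvariant μ → ∃ C : ℝ, ∀ L : ℝ, 0 < L →
        Integrable (fun ω => (linStat (fun p => (Metric.ball (0 : V3) L).indicator (fun _ => 1 + ‖p.2‖ ^ 2) p.1) ω) ^ 4) μ ∧
        ∫ ω, (linStat (fun p => (Metric.ball (0 : V3) L).indicator (fun _ => 1 + ‖p.2‖ ^ 2) p.1) ω) ^ 4 ∂μ ≤ C * (1 + L) ^ 12 :=
  Summit.AtomisticToContinuum.HydrodynamicLimit.Theorems.MourreKoopmanChargesStressStrongMixing.stub_windowFourthMoments

/-- Loc0 (typed by lead c4 after the wave-1 census, RESHAPED at once into LocDom ∧ I4 — proved from them by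
`flowLocalityInLaw_of_dominated`): event-level locality with polynomial fourth moments (`= FlowLocalityInLaw`, expanded). -/
theorem stub_flowLocalityInLaw :
    ∃ σ₄ : ℝ, 0 < σ₄ ∧ ∀ σ : ℝ, 0 < σ → σ < σ₄ → ∀ Φ : InfiniteHardSphereFlow (Fin 3) σ,
      Φ.IsEquilibriumFlow → ∀ θ z : ℝ, 0 < θ → 0 < z →
      ∀ μ : Measure MarkedConfig, IsHardSphereGibbs σ z θ⁻¹ (0 : V3) μ → IsTranslationInvariant μ →
        PointProcess.density μ = 1 →
        ∀ b ∈ Set.range cellCharge ∪ {cellObs fun v : V3 => v 0 * v 1}, ∀ t : ℝ,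
          ∃ (K₀ κ₀ C : ℝ) (m : ℕ), 0 ≤ K₀ ∧ 0 < κ₀ ∧ ∀ L : ℝ, 0 < L →
            ∃ g : MarkedConfig → ℝ, Measurable g ∧ IsCylinder (Metric.ball (0 : V3) L) g ∧
              Integrable (fun ω => g ω ^ 4) μ ∧ (∫ ω, g ω ^ 4 ∂μ ≤ C * (1 + L) ^ m) ∧
              μ {ω | b (Φ.flow t ω) ≠ g ω} ≤ ENNReal.ofReal (K₀ * Real.exp (-(κ₀ * L))) :=
  flowLocalityInLaw_of_dominated stub_flowLocalityDominated stub_windowFourthMoments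

/-- LocGlue0 (formerly STUB LocGlue0, CLOSED in cycle 4 by the lead: landed p169819, `Theorems/…FlowLocalityOfInLaw.lean`, abstract
`flowLocality_assembly`): locality in law with fourth moments gives locality in `L²`
(`= FlowLocalityOfInLaw`, expanded: the Loc0 signature implies the Loc signature). -/
theorem stub_flowLocalityOfInLaw :
    (∃ σ₄ : ℝ, 0 < σ₄ ∧ ∀ σ : ℝ, 0 < σ → σ < σ₄ → ∀ Φ : InfiniteHardSphereFlow (Fin 3) σ,
      Φ.IsEquilibriumFlow → ∀ θ z : ℝ, 0 < θ → 0 < z →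
      ∀ μ : Measure MarkedConfig, IsHardSphereGibbs σ z θ⁻¹ (0 : V3) μ → IsTranslationInvariant μ →
        PointProcess.density μ = 1 →
        ∀ b ∈ Set.range cellCharge ∪ {cellObs fun v : V3 => v 0 * v 1}, ∀ t : ℝ,
          ∃ (K₀ κ₀ C : ℝ) (m : ℕ), 0 ≤ K₀ ∧ 0 < κ₀ ∧ ∀ L : ℝ, 0 < L →
            ∃ g : MarkedConfig → ℝ, Measurable g ∧ IsCylinder (Metric.ball (0 : V3) L) g ∧
              Integrable (fun ω => g ω ^ 4) μ ∧ (∫ ω, g ω ^ 4 ∂μ ≤ C * (1 + L) ^ m) ∧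
              μ {ω | b (Φ.flow t ω) ≠ g ω} ≤ ENNReal.ofReal (K₀ * Real.exp (-(κ₀ * L)))) →
    ∃ σ₄ : ℝ, 0 < σ₄ ∧ ∀ σ : ℝ, 0 < σ → σ < σ₄ → ∀ Φ : InfiniteHardSphereFlow (Fin 3) σ,
      Φ.IsEquilibriumFlow → ∀ θ z : ℝ, 0 < θ → 0 < z →
      ∀ μ : Measure MarkedConfig, IsHardSphereGibbs σ z θ⁻¹ (0 : V3) μ → IsTranslationInvariant μ →
        PointProcess.density μ = 1 →
        ∀ b ∈ Set.range cellCharge ∪ {cellObs fun v : V3 => v 0 * v 1}, ∀ t : ℝ,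
          ∃ K κ : ℝ, 0 ≤ K ∧ 0 < κ ∧ ∀ L : ℝ, 0 < L →
            ∃ g : MarkedConfig → ℝ, Measurable g ∧ MemLp g 2 μ ∧ IsCylinder (Metric.ball (0 : V3) L) g ∧
              ∫ ω, (b (Φ.flow t ω) - g ω) ^ 2 ∂μ ≤ K * Real.exp (-(κ * L)) :=
  Summit.AtomisticToContinuum.HydrodynamicLimit.Theorems.MourreKoopmanChargesStressStrongMixing.stub_flowLocalityOfInLaw

/-- Loc (formerly STUB Loc, RESHAPED by lead c4 after wave 1 into Loc0 ∧ LocGlue0): `L²(μ)`-locality of the time-evolved generators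
under the dilute equilibrium dynamics, with an exponential rate (`= FlowLocality`, expanded). -/
theorem stub_flowLocality :
    ∃ σ₄ : ℝ, 0 < σ₄ ∧ ∀ σ : ℝ, 0 < σ → σ < σ₄ → ∀ Φ : InfiniteHardSphereFlow (Fin 3) σ,
      Φ.IsEquilibriumFlow → ∀ θ z : ℝ, 0 < θ → 0 < z →
      ∀ μ : Measure MarkedConfig, IsHardSphereGibbs σ z θ⁻¹ (0 : V3) μ → IsTranslationInvariant μ →
        PointProcess.density μ = 1 →
        ∀ b ∈ Set.range cellCharge ∪ {cellObs fun v : V3 => v 0 * v 1}, ∀ t : ℝ,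
          ∃ K κ : ℝ, 0 ≤ K ∧ 0 < κ ∧ ∀ L : ℝ, 0 < L →
            ∃ g : MarkedConfig → ℝ, Measurable g ∧ MemLp g 2 μ ∧ IsCylinder (Metric.ball (0 : V3) L) g ∧
              ∫ ω, (b (Φ.flow t ω) - g ω) ^ 2 ∂μ ≤ K * Real.exp (-(κ * L)) :=
  stub_flowLocalityOfInLaw stub_flowLocalityInLaw

/-- F3glue (formerly STUB F3glue, CLOSED in cycle 4, wave 1: landed p166515, `Theorems/…TwoTimeClusteringOfLocality.lean`): locality in `L²` upgrades the landed static `φ`-mixing to two-time spatial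
clustering of the six generators (`= TwoTimeClusteringOfLocality`, expanded: the Loc signature implies the F3b signature). -/
theorem stub_twoTimeClusteringOfLocality :
    (∃ σ₄ : ℝ, 0 < σ₄ ∧ ∀ σ : ℝ, 0 < σ → σ < σ₄ → ∀ Φ : InfiniteHardSphereFlow (Fin 3) σ,
      Φ.IsEquilibriumFlow → ∀ θ z : ℝ, 0 < θ → 0 < z →
      ∀ μ : Measure MarkedConfig, IsHardSphereGibbs σ z θ⁻¹ (0 : V3) μ → IsTranslationInvariant μ →
        PointProcess.density μ = 1 →
        ∀ b ∈ Set.range cellCharge ∪ {cellObs fun v : V3 => v 0 * v 1}, ∀ t : ℝ,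
          ∃ K κ : ℝ, 0 ≤ K ∧ 0 < κ ∧ ∀ L : ℝ, 0 < L →
            ∃ g : MarkedConfig → ℝ, Measurable g ∧ MemLp g 2 μ ∧ IsCylinder (Metric.ball (0 : V3) L) g ∧
              ∫ ω, (b (Φ.flow t ω) - g ω) ^ 2 ∂μ ≤ K * Real.exp (-(κ * L))) →
    ∃ σ₃ : ℝ, 0 < σ₃ ∧ ∀ σ : ℝ, 0 < σ → σ < σ₃ → ∀ Φ : InfiniteHardSphereFlow (Fin 3) σ,
      Φ.IsEquilibriumFlow → ∀ θ z : ℝ, 0 < θ → 0 < z →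
      ∀ μ : Measure MarkedConfig, IsHardSphereGibbs σ z θ⁻¹ (0 : V3) μ → IsTranslationInvariant μ →
        PointProcess.density μ = 1 →
        ∀ a ∈ Set.range cellCharge ∪ {cellObs fun v : V3 => v 0 * v 1},
        ∀ b ∈ Set.range cellCharge ∪ {cellObs fun v : V3 => v 0 * v 1}, ∀ t : ℝ,
          Integrable (fun x : V3 => cov[a, (b ∘ Φ.flow t) ∘ spatialShift x; μ]) volume :=
  Summit.AtomisticToContinuum.HydrodynamicLimit.Theorems.MourreKoopmanChargesStressStrongMixing.stub_twoTimeClusteringOfLocality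

/-- F3dyn (formerly STUB F3dyn, RESHAPED by lead c4 into Loc ∧ F3glue): the dynamic upgrade static ⇒ two-time clustering
(`= DynamicClusteringUpgrade`, expanded) — the static hypothesis is not even needed once Loc is available. -/
theorem stub_dynamicClusteringUpgrade :
    (∃ σ₃ : ℝ, 0 < σ₃ ∧ ∀ σ : ℝ, 0 < σ → σ < σ₃ → ∀ θ z : ℝ, 0 < θ → 0 < z →
      ∀ μ : Measure MarkedConfig, IsHardSphereGibbs σ z θ⁻¹ (0 : V3) μ → IsTranslationInvariant μ →
        PointProcess.density μ = 1 →
        ∀ a ∈ Set.range cellCharge ∪ {cellObs fun v : V3 => v 0 * v 1},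
        ∀ b ∈ Set.range cellCharge ∪ {cellObs fun v : V3 => v 0 * v 1},
          Integrable (fun x : V3 => cov[a, b ∘ spatialShift x; μ]) volume) →
    ∃ σ₃ : ℝ, 0 < σ₃ ∧ ∀ σ : ℝ, 0 < σ → σ < σ₃ → ∀ Φ : InfiniteHardSphereFlow (Fin 3) σ,
      Φ.IsEquilibriumFlow → ∀ θ z : ℝ, 0 < θ → 0 < z →
      ∀ μ : Measure MarkedConfig, IsHardSphereGibbs σ z θ⁻¹ (0 : V3) μ → IsTranslationInvariant μ →
        PointProcess.density μ = 1 →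
        ∀ a ∈ Set.range cellCharge ∪ {cellObs fun v : V3 => v 0 * v 1},
        ∀ b ∈ Set.range cellCharge ∪ {cellObs fun v : V3 => v 0 * v 1}, ∀ t : ℝ,
          Integrable (fun x : V3 => cov[a, (b ∘ Φ.flow t) ∘ spatialShift x; μ]) volume :=
  fun _ => stub_twoTimeClusteringOfLocality stub_flowLocality

/-- F3b (formerly STUB F3b, RESHAPED by lead c3 after wave 1 into F3static ∧ F3dyn): two-time spatial clustering of the
six generators (charges and stress) for the density-one dilute Gibbs state (`= TwoTimeClustering`). -/
theorem stub_twoTimeClustering :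
    ∃ σ₃ : ℝ, 0 < σ₃ ∧ ∀ σ : ℝ, 0 < σ → σ < σ₃ → ∀ Φ : InfiniteHardSphereFlow (Fin 3) σ,
      Φ.IsEquilibriumFlow → ∀ θ z : ℝ, 0 < θ → 0 < z →
      ∀ μ : Measure MarkedConfig, IsHardSphereGibbs σ z θ⁻¹ (0 : V3) μ → IsTranslationInvariant μ →
        PointProcess.density μ = 1 →
        ∀ a ∈ Set.range cellCharge ∪ {cellObs fun v : V3 => v 0 * v 1},
        ∀ b ∈ Set.range cellCharge ∪ {cellObs fun v : V3 => v 0 * v 1}, ∀ t : ℝ,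
          Integrable (fun x : V3 => cov[a, (b ∘ Φ.flow t) ∘ spatialShift x; μ]) volume :=
  stub_dynamicClusteringUpgrade stub_staticClustering

/-- Every element of the flow–shift span of measurable generators is measurable (minimality against the submodule of
measurable functions; flow maps and translations are measurable). -/
theorem measurable_of_mem_flowShiftSpan {σ : ℝ} (Φ : InfiniteHardSphereFlow (Fin 3) σ) {S : Set (MarkedConfig → ℝ)}
    (hS : ∀ a ∈ S, Measurable a) {f : MarkedConfig → ℝ} (hf : f ∈ flowShiftSpan Φ S) : Measurable f := by
  let W : Submodule ℝ (MarkedConfig → ℝ) :=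
    { carrier := {g | Measurable g}
      zero_mem' := measurable_const
      add_mem' := fun hg hg' => Measurable.add hg hg'
      smul_mem' := fun c g hg => Measurable.const_smul (hg : Measurable g) c }
  have hle : flowShiftSpan Φ S ≤ W :=
    flowShiftSpan_le (fun a ha => hS a ha) (fun t g hg => (hg : Measurable g).comp (Φ.measurable_flow t))
      (fun x g hg => (hg : Measurable g).comp (Literature.Analysis.FunctionSpaces.PointConfig.measurable_translate _))
  exact hle hf

/-- The six generators are measurable. -/
theorem measurable_generators :
    ∀ a ∈ Set.range cellCharge ∪ {cellObs fun v : V3 => v 0 * v 1}, Measurable a := by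
  rintro a (⟨i, rfl⟩ | ha)
  · exact measurable_cellCharge i
  · rw [Set.mem_singleton_iff] at ha
    rw [ha]
    exact measurable_cellObs (by fun_prop : Continuous fun v : V3 => v 0 * v 1).measurable

/-- **The minimal observable space is admissible** under Fcov-type covariance, F3a and F3b at one `(σ, Φ, μ)`:
`IsLocalObservableSpace Φ μ (flowShiftSpan Φ {charges, stress})` — `L²` and clustering by the landed span reductions,
positivity of the structure factor by the landed Følner lemma `integral_cov_spatialShift_nonneg` (span elements are
measurable, in `L²`, with integrable truncated correlations); the dynamical inputs are read off `IsEquilibriumFlow` in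
the Gibbs state (`Φ_0 = id` a.e., stationarity, a.e. group law) and translation invariance of `μ`. -/
theorem isLocalObservableSpace_min_of {σ θ z : ℝ} (hσ : 0 < σ) (hθ : 0 < θ) (hz : 0 < z)
    {Φ : InfiniteHardSphereFlow (Fin 3) σ} (hΦ : Φ.IsEquilibriumFlow) {μ : Measure MarkedConfig}
    (hG : IsHardSphereGibbs σ z θ⁻¹ (0 : V3) μ) (hti : IsTranslationInvariant μ)
    (hcomm : ∀ (t : ℝ) (x : V3), Φ.flow t ∘ spatialShift x =ᵐ[μ] spatialShift x ∘ Φ.flow t)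
    (hmom : GeneratorMoments)
    (hcl : ∀ a ∈ Set.range cellCharge ∪ {cellObs fun v : V3 => v 0 * v 1},
      ∀ b ∈ Set.range cellCharge ∪ {cellObs fun v : V3 => v 0 * v 1}, ∀ t : ℝ,
        Integrable (fun x : V3 => cov[a, (b ∘ Φ.flow t) ∘ spatialShift x; μ]) volume) :
    IsLocalObservableSpace Φ μ (flowShiftSpan Φ (Set.range cellCharge ∪ {cellObs fun v : V3 => v 0 * v 1})) := by
  obtain ⟨hD, hS⟩ := hΦ z θ⁻¹ hz (inv_pos.2 hθ) μ hG
  haveI : IsProbabilityMeasure μ := hG.1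
  have hflow : ∀ t : ℝ, MeasurePreserving (Φ.flow t) μ μ := fun t => hS.measurePreserving t
  have hshift : ∀ x : V3, MeasurePreserving (spatialShift x) μ μ := fun x =>
    ⟨Literature.Analysis.FunctionSpaces.PointConfig.measurable_translate _, hti x⟩
  have hzero : Φ.flow 0 =ᵐ[μ] id := by
    filter_upwards [hD] with ω hω
    exact Φ.flow_zero ω hω
  have hadd : ∀ s t : ℝ, Φ.flow (s + t) =ᵐ[μ] Φ.flow s ∘ Φ.flow t := fun s t => Φ.flow_add_ae hD hS s t
  have hch : ∀ i : Fin 5, cellCharge i ∈ flowShiftSpan Φ (Set.range cellCharge ∪ {cellObs fun v : V3 => v 0 * v 1}) :=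
    fun i => subset_flowShiftSpan (Or.inl ⟨i, rfl⟩)
  have hmomμ : ∀ a ∈ Set.range cellCharge ∪ {cellObs fun v : V3 => v 0 * v 1}, MemLp a 2 μ :=
    hmom σ θ z hσ hθ hz μ hG
  have hL2 : ∀ f ∈ flowShiftSpan Φ (Set.range cellCharge ∪ {cellObs fun v : V3 => v 0 * v 1}), MemLp f 2 μ :=
    fun f hf => Summit.AtomisticToContinuum.HydrodynamicLimit.Theorems.MourreKoopmanChargesStressStrongMixing.memLp_of_mem_flowShiftSpan
      Φ μ hflow hshift hmomμ hf
  have hcov : ∀ f ∈ flowShiftSpan Φ (Set.range cellCharge ∪ {cellObs fun v : V3 => v 0 * v 1}),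
      ∀ g ∈ flowShiftSpan Φ (Set.range cellCharge ∪ {cellObs fun v : V3 => v 0 * v 1}),
        Integrable (fun x : V3 => cov[f, g ∘ spatialShift x; μ]) volume :=
    fun f hf g hg => Summit.AtomisticToContinuum.HydrodynamicLimit.Theorems.MourreKoopmanChargesStressStrongMixing.integrable_cov_of_mem_flowShiftSpan
      Φ μ hflow hshift hzero hadd hcomm hmomμ hcl hf hg
  refine (isLocalObservableSpace_flowShiftSpan_iff hch).2 ⟨hL2, hcov, ?_⟩
  intro f hf
  exact Summit.AtomisticToContinuum.HydrodynamicLimit.Theorems.MourreKoopmanChargesStressStrongMixing.integral_cov_spatialShift_nonneg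
    μ hG.1 hshift f (measurable_of_mem_flowShiftSpan Φ measurable_generators hf) (hL2 f hf) (hcov f hf f hf)

/-- **F1, F2, Fcov, F3a and F3b imply A** (`StressFramework`) with the MINIMAL observable space
`flowShiftSpan Φ {charges, stress}` (landed `exists_framework_of_ae`, p147060; `σ₀ := min σ₁ σ₃`). -/
theorem stressFramework_of_min (hF1 : DiluteGibbsDensityOne) (hF2 : AlexanderExistence)
    (hFcov : EquilibriumFlowShiftCovariant) (hmom : GeneratorMoments) (hclust : TwoTimeClustering) :
    StressFramework := by
  obtain ⟨σ₁, hσ₁, H₁⟩ := hF1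
  obtain ⟨σ₄, hσ₄, H₄⟩ := hclust
  refine ⟨min σ₁ σ₄, lt_min hσ₁ hσ₄, ?_⟩
  intro σ hσ hσlt θ hθ
  have h₁ : σ < σ₁ := lt_of_lt_of_le hσlt (min_le_left _ _)
  have h₄ : σ < σ₄ := lt_of_lt_of_le hσlt (min_le_right _ _)
  obtain ⟨z, hz, μ, hG, hti, hρ⟩ := H₁ σ hσ h₁ θ hθ
  obtain ⟨Φ, hΦ⟩ := hF2 hσ
  have hcl := H₄ σ hσ h₄ Φ hΦ θ z hθ hz μ hG hti hρ
  have hcomm : ∀ (t : ℝ) (x : V3), Φ.flow t ∘ spatialShift x =ᵐ[μ] spatialShift x ∘ Φ.flow t :=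
    fun t x => hFcov σ hσ Φ hΦ z θ⁻¹ hz (inv_pos.2 hθ) μ hG t x
  have h𝒱 := isLocalObservableSpace_min_of hσ hθ hz hΦ hG hti hcomm hmom hcl
  exact ⟨z, hz, Summit.AtomisticToContinuum.HydrodynamicLimit.Theorems.MourreKoopmanChargesStressStrongMixing.exists_framework_of_ae
    hσ hθ hz hG hti hρ hΦ hcomm h𝒱 (subset_flowShiftSpan (Or.inr rfl))⟩

/-- A (formerly STUB A, now PROVED from F1, F2, Fcov, F3a, F3b via `stressFramework_of_min`): the density-one
framework exists for small reduced diameter (`= StressFramework`, expanded). -/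
theorem stub_stressFramework :
    ∃ σ₀ : ℝ, 0 < σ₀ ∧ ∀ σ : ℝ, 0 < σ → σ < σ₀ → ∀ θ : ℝ, 0 < θ →
      ∃ z : ℝ, 0 < z ∧ ∃ F : HardSphereFluctuationData σ,
        IsHardSphereGibbs σ z θ⁻¹ (0 : V3) F.μ ∧
        (∫ ω, cellCharge 0 ω ∂F.μ = 1) ∧
        (∃ Φ : InfiniteHardSphereFlow (Fin 3) σ, Φ.IsEquilibriumFlow ∧ ∀ t : ℝ, F.flow t =ᵐ[F.μ] Φ.flow t) ∧
        cellObs (fun v : V3 => v 0 * v 1) ∈ F.localObs :=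
  stressFramework_of_min stub_diluteGibbsDensityOne stub_alexanderExistence stub_equilibriumFlowShiftCovariant
    stub_generatorMoments stub_twoTimeClustering

/-- STUB B1 (M) — CLOSED: raw two-time stress moment = `(N+1)` · two-time stress covariance
(`= TorusStressRawEqCov`, expanded); proved in `Theorems/MourreKoopmanChargesStressStrongMixingTorusStressRawEqCov.lean`
(p145407: both factors are centred under the canonical law at rest — reflection `v⁰ ↦ -v⁰` — and the
covariance of two centred functions is their raw moment by definition; no integrability needed). -/
theorem stub_torusStressRawEqCov :
    ∀ σ : ℝ, 0 < σ → σ ≤ 1 / 2 → ∀ θ : ℝ, 0 < θ →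
      ∀ Φ : (N : ℕ) → HardSphereFlow (Torus.geometry (Fin 3)) (hsDiameter σ N) (N + 1),
      ∀ χ₁ χ₂ : T3 → ℝ, Continuous χ₁ → Continuous χ₂ → ∀ (s : ℝ) (N : ℕ),
        ((N : ℝ) + 1) * ∫ z, (∫ y, χ₁ y.1 * (y.2 0 * y.2 1)
            ∂(empiricalMeasure ((Φ N).flow (s * ((N : ℝ) + 1) ^ (-(1 / 3 : ℝ))) z))) *
          (∫ y, χ₂ y.1 * (y.2 0 * y.2 1) ∂(empiricalMeasure z))
          ∂(localGibbsLaw σ (fun _ => 1) (fun _ => 0) (fun _ => θ) N (Φ N)) =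
        ((N : ℝ) + 1) *
          cov[fun z => ∫ y, χ₁ y.1 * (y.2 0 * y.2 1)
                ∂(empiricalMeasure ((Φ N).flow (s * ((N : ℝ) + 1) ^ (-(1 / 3 : ℝ))) z)),
              fun z => ∫ y, χ₂ y.1 * (y.2 0 * y.2 1) ∂(empiricalMeasure z);
            localGibbsLaw σ (fun _ => 1) (fun _ => 0) (fun _ => θ) N (Φ N)] :=
  -- CLOSED (lead c2, wave 1): landed p145407 as a `--supports` Theorems file
  Summit.AtomisticToContinuum.HydrodynamicLimit.Theorems.MourreKoopmanChargesStressStrongMixing.stub_torusStressRawEqCov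

/-- **LowDensU3 · LowDensityGibbsUniqueness3** (L of a known kind — the `d = 3`, unit-diameter, zero-drift INSTANCE of
the named fact `HardSphereGibbsLowDensityUniqueness` that the composition uses). Two translation-invariant DLR states of
the unit-diameter hard-sphere gas in `ℝ³` with centred Maxwellian marks of the same inverse temperature and the same
density `< ρ₀` coincide, whatever their activities. Ingredients PROVED in the tree (2026-08-17): uniqueness and
translation invariance at small activity (`IsHardSphereGibbs.unique_of_small_activity`, `16 z < 1`, Michelen–Perkins
route) and the GNZ sandwich (`HardSphereDLR.activity_le_two_mul_density`: density `< 1/32` forces `z ≤ 2ρ < 1/16`);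
missing: injectivity of the density in the activity on `(0, 1/16)` (Ruelle 1969 §4.3: `ρ₁(z) = z + O(z²)` analytic,
strictly increasing near `0`; Georgii 1995 Rem. 3.7). -/
def LowDensityGibbsUniqueness3 : Prop :=
  ∃ ρ₀ : ℝ, 0 < ρ₀ ∧ ∀ (β z z' : ℝ) (G G' : Measure MarkedConfig), 0 < β → 0 < z → 0 < z' →
    IsHardSphereGibbs 1 z β (0 : V3) G → IsHardSphereGibbs 1 z' β (0 : V3) G' →
    IsTranslationInvariant G → IsTranslationInvariant G' →
    PointProcess.density G = PointProcess.density G' → PointProcess.density G < ENNReal.ofReal ρ₀ → G = G'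

/-- The named fact (all dimensions, diameters, drifts) implies its `d = 3` unit-diameter zero-drift instance. -/
theorem lowDensityGibbsUniqueness3_of_lowDensityUniqueness
    (hU : Literature.MathematicalPhysics.KineticTheory.HardSphereGibbsLowDensityUniqueness) :
    LowDensityGibbsUniqueness3 := by
  obtain ⟨ρ₀, hρ₀, H⟩ := hU (Fin 3) 1 one_pos
  exact ⟨ρ₀, hρ₀, fun β z z' G G' hβ hz hz' hG hG' hti hti' hd hlt => H β 0 z z' G G' hβ hz hz' hG hG' hti hti' hd hlt⟩

/-- LowDensU3 (formerly STUB LowDensU3, CLOSED in cycle 3, wave 1: landed p159640 with helpers p157794 p158437 p159290 —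
GNZ identity `ρ = z·q`, vacancy probability Lipschitz in the activity uniformly in the volume via pinning, hence
`z ↦ ρ(z)` injective on `(0, 1/1000)`; equal activities by `IsHardSphereGibbs.unique_of_small_activity`; `ρ₀ = 1/2000`):
low-density uniqueness of the translation-invariant unit-diameter hard-sphere DLR state in `ℝ³`, zero drift
(`= LowDensityGibbsUniqueness3`, expanded). -/
theorem stub_lowDensityGibbsUniqueness3 :
    ∃ ρ₀ : ℝ, 0 < ρ₀ ∧ ∀ (β z z' : ℝ) (G G' : Measure MarkedConfig), 0 < β → 0 < z → 0 < z' →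
      IsHardSphereGibbs 1 z β (0 : V3) G → IsHardSphereGibbs 1 z' β (0 : V3) G' →
      IsTranslationInvariant G → IsTranslationInvariant G' →
      PointProcess.density G = PointProcess.density G' → PointProcess.density G < ENNReal.ofReal ρ₀ → G = G' :=
  Summit.AtomisticToContinuum.HydrodynamicLimit.Theorems.MourreKoopmanChargesStressStrongMixing.stub_lowDensityGibbsUniqueness3

/-- **LowDensU3 implies M4** (`DensityOneGibbsUnique`): dilate a density-one state at diameter `σ` by `σ⁻¹` to a
unit-diameter state of density `σ³ < ρ₀` (landed `IsHardSphereGibbs.map_dilate`, `isTranslationInvariant_map_dilate`,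
`density_map_dilate`), apply the `d = 3` uniqueness, and pull back through the measurable equivalence
`PointConfig.mapHomeomorphEquiv`. -/
theorem densityOneGibbsUnique_of_lowDensityUniqueness3 (hU : LowDensityGibbsUniqueness3) :
    ∃ σ₁ : ℝ, 0 < σ₁ ∧ ∀ σ : ℝ, 0 < σ → σ < σ₁ → ∀ β : ℝ, 0 < β →
      ∀ (z z' : ℝ) (μ μ' : Measure MarkedConfig), 0 < z → 0 < z' →
        IsHardSphereGibbs σ z β (0 : V3) μ → IsHardSphereGibbs σ z' β (0 : V3) μ' →
        IsTranslationInvariant μ → IsTranslationInvariant μ' →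
        PointProcess.density μ = 1 → PointProcess.density μ' = 1 → μ = μ' := by
  obtain ⟨ρ₀, hρ₀, H⟩ := hU
  -- `σ₁ := min 1 ρ₀ ^ (1/3)`-free choice: `σ < σ₁ := min 1 ρ₀` gives `σ³ ≤ σ < ρ₀` since `σ < 1`
  refine ⟨min 1 ρ₀, lt_min one_pos hρ₀, ?_⟩
  intro σ hσ hσlt β hβ z z' μ μ' hz hz' hG hG' hti hti' hρ hρ'
  have hσ1 : σ < 1 := lt_of_lt_of_le hσlt (min_le_left _ _)
  have hσρ : σ < ρ₀ := lt_of_lt_of_le hσlt (min_le_right _ _)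
  have hσ3 : σ ^ 3 < ρ₀ := by
    have : σ ^ 3 ≤ σ := by
      calc σ ^ 3 ≤ σ ^ 1 := pow_le_pow_of_le_one hσ.le hσ1.le (by norm_num)
        _ = σ := pow_one σ
    exact lt_of_le_of_lt this hσρ
  -- the dilation by `c := σ⁻¹`
  set c : ℝ := σ⁻¹ with hc
  have hcpos : 0 < c := inv_pos.2 hσ
  set D : V3 × V3 ≃ₜ V3 × V3 := (Homeomorph.smulOfNeZero c hcpos.ne').prodCongr (Homeomorph.refl V3) with hDdef
  have hD : ∀ p : V3 × V3, D p = (c • p.1, p.2) := fun _ => rfl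
  have hcσ : c * σ = 1 := inv_mul_cancel₀ hσ.ne'
  have hcard : Fintype.card (Fin 3) = 3 := Fintype.card_fin 3
  -- images at unit diameter
  have hG1 : IsHardSphereGibbs 1 (z / c ^ 3) β (0 : V3) (μ.map (Literature.Analysis.FunctionSpaces.PointConfig.mapHomeomorph D)) := by
    have h := hG.map_dilate hcpos hD
    rwa [hcσ, hcard] at h
  have hG1' : IsHardSphereGibbs 1 (z' / c ^ 3) β (0 : V3) (μ'.map (Literature.Analysis.FunctionSpaces.PointConfig.mapHomeomorph D)) := by
    have h := hG'.map_dilate hcpos hD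
    rwa [hcσ, hcard] at h
  have hti1 := Summit.AtomisticToContinuum.HydrodynamicLimit.Theorems.MourreKoopmanChargesStressStrongMixing.isTranslationInvariant_map_dilate
    hcpos.ne' hD hti
  have hti1' := Summit.AtomisticToContinuum.HydrodynamicLimit.Theorems.MourreKoopmanChargesStressStrongMixing.isTranslationInvariant_map_dilate
    hcpos.ne' hD hti'
  have hd1 : PointProcess.density (μ.map (Literature.Analysis.FunctionSpaces.PointConfig.mapHomeomorph D)) = ENNReal.ofReal (σ ^ 3) := by
    rw [Summit.AtomisticToContinuum.HydrodynamicLimit.Theorems.MourreKoopmanChargesStressStrongMixing.density_map_dilate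
      hti (by rw [hρ]; exact ENNReal.one_ne_top) hcpos hD, hρ, mul_one, hcard, hc, inv_pow, inv_inv]
  have hd1' : PointProcess.density (μ'.map (Literature.Analysis.FunctionSpaces.PointConfig.mapHomeomorph D)) = ENNReal.ofReal (σ ^ 3) := by
    rw [Summit.AtomisticToContinuum.HydrodynamicLimit.Theorems.MourreKoopmanChargesStressStrongMixing.density_map_dilate
      hti' (by rw [hρ']; exact ENNReal.one_ne_top) hcpos hD, hρ', mul_one, hcard, hc, inv_pow, inv_inv]
  have hc3 : 0 < c ^ 3 := pow_pos hcpos 3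
  have heq := H β (z / c ^ 3) (z' / c ^ 3) _ _ hβ (div_pos hz hc3) (div_pos hz' hc3) hG1 hG1' hti1 hti1'
    (by rw [hd1, hd1']) (by rw [hd1]; exact (ENNReal.ofReal_lt_ofReal_iff hρ₀).2 hσ3)
  -- pull back through the measurable equivalence
  have hinj := (Literature.Analysis.FunctionSpaces.PointConfig.mapHomeomorphEquiv D).map_measurableEquiv_injective
  rw [Literature.Analysis.FunctionSpaces.PointConfig.coe_mapHomeomorphEquiv] at hinj
  exact hinj heq

/-- **LowDensU (all dimensions) implies M4**, through the `d = 3` instance. -/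
theorem densityOneGibbsUnique_of_lowDensityUniqueness
    (hU : Literature.MathematicalPhysics.KineticTheory.HardSphereGibbsLowDensityUniqueness) :
    ∃ σ₁ : ℝ, 0 < σ₁ ∧ ∀ σ : ℝ, 0 < σ → σ < σ₁ → ∀ β : ℝ, 0 < β →
      ∀ (z z' : ℝ) (μ μ' : Measure MarkedConfig), 0 < z → 0 < z' →
        IsHardSphereGibbs σ z β (0 : V3) μ → IsHardSphereGibbs σ z' β (0 : V3) μ' →
        IsTranslationInvariant μ → IsTranslationInvariant μ' →
        PointProcess.density μ = 1 → PointProcess.density μ' = 1 → μ = μ' :=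
  densityOneGibbsUnique_of_lowDensityUniqueness3 (lowDensityGibbsUniqueness3_of_lowDensityUniqueness hU)

/-- M4 (formerly STUB M4, now PROVED from LowDensU3 by `densityOneGibbsUnique_of_lowDensityUniqueness3`): uniqueness of
the translation-invariant density-one DLR state at small `σ` (`= DensityOneGibbsUnique`). -/
theorem stub_densityOneGibbsUnique :
    ∃ σ₁ : ℝ, 0 < σ₁ ∧ ∀ σ : ℝ, 0 < σ → σ < σ₁ → ∀ β : ℝ, 0 < β →
      ∀ (z z' : ℝ) (μ μ' : Measure MarkedConfig), 0 < z → 0 < z' →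
        IsHardSphereGibbs σ z β (0 : V3) μ → IsHardSphereGibbs σ z' β (0 : V3) μ' →
        IsTranslationInvariant μ → IsTranslationInvariant μ' →
        PointProcess.density μ = 1 → PointProcess.density μ' = 1 → μ = μ' :=
  densityOneGibbsUnique_of_lowDensityUniqueness3 stub_lowDensityGibbsUniqueness3

/-- B2zero (formerly STUB B2zero, CLOSED in cycle 3, wave 1: landed p158174 — `U_0 = 1`, `‖[Π]‖² = ∫ Cov_μ(Π_C, Π_{C-x}) dx`,
second-order marked Campbell identity under the DLR state (`gibbsCampbellSecondMoment`), centred Maxwellian shear germ with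
`E[(v⁰v¹)²] = θ²`, intensity `= ρ·Leb` at density one, `∫ vol(C ∩ (C-x)) dx = 1`): `c_F(0) = θ²` on every density-one
framework (`= StressAutocorrelationZero`, expanded). -/
theorem stub_stressAutocorrelationZero :
    ∀ (σ θ z : ℝ), 0 < σ → 0 < θ → 0 < z → ∀ F : HardSphereFluctuationData σ,
      (IsHardSphereGibbs σ z θ⁻¹ (0 : V3) F.μ ∧
        (∫ ω, cellCharge 0 ω ∂F.μ = 1) ∧
        (∃ Φ : InfiniteHardSphereFlow (Fin 3) σ, Φ.IsEquilibriumFlow ∧ ∀ t : ℝ, F.flow t =ᵐ[F.μ] Φ.flow t) ∧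
        cellObs (fun v : V3 => v 0 * v 1) ∈ F.localObs) →
      ⟪F.koopman 0 (F.fluct (cellObs fun v : V3 => v 0 * v 1)),
        F.fluct (cellObs fun v : V3 => v 0 * v 1)⟫_ℝ = θ ^ 2 :=
  Summit.AtomisticToContinuum.HydrodynamicLimit.Theorems.MourreKoopmanChargesStressStrongMixing.stub_stressAutocorrelationZero

/-- STUB B3form (PROVABLE NOW, registered by lead c6 for wave 1 of cycle 6): the finite-`N` Fourier/pair identity
`M_N(s; Re e_n, Re e_n) + M_N(s; Im e_n, Im e_n) = P_N(s; Re e_n)` (`= TorusStressPairForm`, expanded). -/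
theorem stub_torusStressPairForm :
    ∀ σ : ℝ, 0 < σ → σ ≤ 1 / 2 → ∀ θ : ℝ, 0 < θ →
      ∀ Φ : (N : ℕ) → HardSphereFlow (Torus.geometry (Fin 3)) (hsDiameter σ N) (N + 1),
      ∀ (n : Fin 3 → ℤ) (s : ℝ) (N : ℕ),
        ((N : ℝ) + 1) * ∫ z, (∫ y, (UnitAddTorus.mFourier n y.1).re * (y.2 0 * y.2 1)
              ∂(empiricalMeasure ((Φ N).flow (s * ((N : ℝ) + 1) ^ (-(1 / 3 : ℝ))) z))) *
            (∫ y, (UnitAddTorus.mFourier n y.1).re * (y.2 0 * y.2 1) ∂(empiricalMeasure z))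
            ∂(localGibbsLaw σ (fun _ => 1) (fun _ => 0) (fun _ => θ) N (Φ N)) +
          ((N : ℝ) + 1) * ∫ z, (∫ y, (UnitAddTorus.mFourier n y.1).im * (y.2 0 * y.2 1)
              ∂(empiricalMeasure ((Φ N).flow (s * ((N : ℝ) + 1) ^ (-(1 / 3 : ℝ))) z))) *
            (∫ y, (UnitAddTorus.mFourier n y.1).im * (y.2 0 * y.2 1) ∂(empiricalMeasure z))
            ∂(localGibbsLaw σ (fun _ => 1) (fun _ => 0) (fun _ => θ) N (Φ N)) =
        ((N : ℝ) + 1) * ∫ z, (∫ y, (∫ y', (UnitAddTorus.mFourier n (y.1 - y'.1)).re * (y.2 0 * y.2 1) * (y'.2 0 * y'.2 1)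
              ∂(empiricalMeasure z)) ∂(empiricalMeasure ((Φ N).flow (s * ((N : ℝ) + 1) ^ (-(1 / 3 : ℝ))) z)))
            ∂(localGibbsLaw σ (fun _ => 1) (fun _ => 0) (fun _ => θ) N (Φ N)) := by
  sorry

/-- STUB B3loc (OPEN core, typed by lead c6): macroscopic locality of the two-time stress pair functional of the density-one torus
gas at a fixed microscopic time (`= TorusStressPairLocality`, expanded). -/
theorem stub_torusStressPairLocality :
    ∃ σ₂ : ℝ, 0 < σ₂ ∧ ∀ σ : ℝ, 0 < σ → σ < σ₂ → ∀ θ : ℝ, 0 < θ →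
      ∀ Φ : (N : ℕ) → HardSphereFlow (Torus.geometry (Fin 3)) (hsDiameter σ N) (N + 1),
      ∀ s : ℝ, 0 < s → ∀ f : T3 → ℝ, Continuous f →
        Tendsto (fun N : ℕ =>
          ((N : ℝ) + 1) * ∫ z, (∫ y, (∫ y', f (y.1 - y'.1) * (y.2 0 * y.2 1) * (y'.2 0 * y'.2 1)
              ∂(empiricalMeasure z)) ∂(empiricalMeasure ((Φ N).flow (s * ((N : ℝ) + 1) ^ (-(1 / 3 : ℝ))) z)))
            ∂(localGibbsLaw σ (fun _ => 1) (fun _ => 0) (fun _ => θ) N (Φ N)) -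
          f 0 * (((N : ℝ) + 1) * ∫ z, (∫ y, (∫ y', 1 * (y.2 0 * y.2 1) * (y'.2 0 * y'.2 1)
              ∂(empiricalMeasure z)) ∂(empiricalMeasure ((Φ N).flow (s * ((N : ℝ) + 1) ^ (-(1 / 3 : ℝ))) z)))
            ∂(localGibbsLaw σ (fun _ => 1) (fun _ => 0) (fun _ => θ) N (Φ N)))) atTop (𝓝 0) := by
  sorry

/-- STUB B2diag₀ (OPEN core, typed by lead c6): the wavenumber-zero instance of B2diag — the molecular-dynamics statement
`(N+1)⁻¹ E_{G_N}[S(s_N) S(0)] → c_F(s)` (`= TorusStressDiagonalLimitZero`, expanded). -/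
theorem stub_torusStressDiagonalLimitZero :
    ∃ σ₂ : ℝ, 0 < σ₂ ∧ ∀ σ : ℝ, 0 < σ → σ < σ₂ → ∀ θ : ℝ, 0 < θ → ∀ z : ℝ, 0 < z →
      ∀ F : HardSphereFluctuationData σ,
        (IsHardSphereGibbs σ z θ⁻¹ (0 : V3) F.μ ∧
          (∫ ω, cellCharge 0 ω ∂F.μ = 1) ∧
          (∃ Φ : InfiniteHardSphereFlow (Fin 3) σ, Φ.IsEquilibriumFlow ∧ ∀ t : ℝ, F.flow t =ᵐ[F.μ] Φ.flow t) ∧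
          cellObs (fun v : V3 => v 0 * v 1) ∈ F.localObs) →
        ∀ Φ : (N : ℕ) → HardSphereFlow (Torus.geometry (Fin 3)) (hsDiameter σ N) (N + 1),
        ∀ s : ℝ, 0 < s →
          Tendsto (fun N : ℕ => ((N : ℝ) + 1) * ∫ z, (∫ y, (UnitAddTorus.mFourier (0 : Fin 3 → ℤ) y.1).re * (y.2 0 * y.2 1)
              ∂(empiricalMeasure ((Φ N).flow (s * ((N : ℝ) + 1) ^ (-(1 / 3 : ℝ))) z))) *
            (∫ y, (UnitAddTorus.mFourier (0 : Fin 3 → ℤ) y.1).re * (y.2 0 * y.2 1) ∂(empiricalMeasure z))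
            ∂(localGibbsLaw σ (fun _ => 1) (fun _ => 0) (fun _ => θ) N (Φ N))) atTop
            (𝓝 (⟪F.koopman s (F.fluct (cellObs fun v : V3 => v 0 * v 1)),
                  F.fluct (cellObs fun v : V3 => v 0 * v 1)⟫_ℝ *
                ∫ x : T3, (UnitAddTorus.mFourier (0 : Fin 3 → ℤ) x).re * (UnitAddTorus.mFourier (0 : Fin 3 → ℤ) x).re)) := by
  sorry

/-- STUB B3lw (PROVABLE NOW, registered by lead c6 for wave 1 of cycle 6): the long-wavelength glue
`TorusStressPairForm → TorusStressPairLocality → TorusStressDiagonalLimitZero → TorusStressDiagonalLimit`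
(`= TorusStressLongWavelength`, expanded: the B3form, B3loc and B2diag₀ signatures imply the B2diag signature). -/
theorem stub_torusStressLongWavelength :
    (∀ σ : ℝ, 0 < σ → σ ≤ 1 / 2 → ∀ θ : ℝ, 0 < θ →
      ∀ Φ : (N : ℕ) → HardSphereFlow (Torus.geometry (Fin 3)) (hsDiameter σ N) (N + 1),
      ∀ (n : Fin 3 → ℤ) (s : ℝ) (N : ℕ),
        ((N : ℝ) + 1) * ∫ z, (∫ y, (UnitAddTorus.mFourier n y.1).re * (y.2 0 * y.2 1)
              ∂(empiricalMeasure ((Φ N).flow (s * ((N : ℝ) + 1) ^ (-(1 / 3 : ℝ))) z))) *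
            (∫ y, (UnitAddTorus.mFourier n y.1).re * (y.2 0 * y.2 1) ∂(empiricalMeasure z))
            ∂(localGibbsLaw σ (fun _ => 1) (fun _ => 0) (fun _ => θ) N (Φ N)) +
          ((N : ℝ) + 1) * ∫ z, (∫ y, (UnitAddTorus.mFourier n y.1).im * (y.2 0 * y.2 1)
              ∂(empiricalMeasure ((Φ N).flow (s * ((N : ℝ) + 1) ^ (-(1 / 3 : ℝ))) z))) *
            (∫ y, (UnitAddTorus.mFourier n y.1).im * (y.2 0 * y.2 1) ∂(empiricalMeasure z))
            ∂(localGibbsLaw σ (fun _ => 1) (fun _ => 0) (fun _ => θ) N (Φ N)) =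
        ((N : ℝ) + 1) * ∫ z, (∫ y, (∫ y', (UnitAddTorus.mFourier n (y.1 - y'.1)).re * (y.2 0 * y.2 1) * (y'.2 0 * y'.2 1)
              ∂(empiricalMeasure z)) ∂(empiricalMeasure ((Φ N).flow (s * ((N : ℝ) + 1) ^ (-(1 / 3 : ℝ))) z)))
            ∂(localGibbsLaw σ (fun _ => 1) (fun _ => 0) (fun _ => θ) N (Φ N))) →
    (∃ σ₂ : ℝ, 0 < σ₂ ∧ ∀ σ : ℝ, 0 < σ → σ < σ₂ → ∀ θ : ℝ, 0 < θ →
      ∀ Φ : (N : ℕ) → HardSphereFlow (Torus.geometry (Fin 3)) (hsDiameter σ N) (N + 1),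
      ∀ s : ℝ, 0 < s → ∀ f : T3 → ℝ, Continuous f →
        Tendsto (fun N : ℕ =>
          ((N : ℝ) + 1) * ∫ z, (∫ y, (∫ y', f (y.1 - y'.1) * (y.2 0 * y.2 1) * (y'.2 0 * y'.2 1)
              ∂(empiricalMeasure z)) ∂(empiricalMeasure ((Φ N).flow (s * ((N : ℝ) + 1) ^ (-(1 / 3 : ℝ))) z)))
            ∂(localGibbsLaw σ (fun _ => 1) (fun _ => 0) (fun _ => θ) N (Φ N)) -
          f 0 * (((N : ℝ) + 1) * ∫ z, (∫ y, (∫ y', 1 * (y.2 0 * y.2 1) * (y'.2 0 * y'.2 1)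
              ∂(empiricalMeasure z)) ∂(empiricalMeasure ((Φ N).flow (s * ((N : ℝ) + 1) ^ (-(1 / 3 : ℝ))) z)))
            ∂(localGibbsLaw σ (fun _ => 1) (fun _ => 0) (fun _ => θ) N (Φ N)))) atTop (𝓝 0)) →
    (∃ σ₂ : ℝ, 0 < σ₂ ∧ ∀ σ : ℝ, 0 < σ → σ < σ₂ → ∀ θ : ℝ, 0 < θ → ∀ z : ℝ, 0 < z →
      ∀ F : HardSphereFluctuationData σ,
        (IsHardSphereGibbs σ z θ⁻¹ (0 : V3) F.μ ∧
          (∫ ω, cellCharge 0 ω ∂F.μ = 1) ∧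
          (∃ Φ : InfiniteHardSphereFlow (Fin 3) σ, Φ.IsEquilibriumFlow ∧ ∀ t : ℝ, F.flow t =ᵐ[F.μ] Φ.flow t) ∧
          cellObs (fun v : V3 => v 0 * v 1) ∈ F.localObs) →
        ∀ Φ : (N : ℕ) → HardSphereFlow (Torus.geometry (Fin 3)) (hsDiameter σ N) (N + 1),
        ∀ s : ℝ, 0 < s →
          Tendsto (fun N : ℕ => ((N : ℝ) + 1) * ∫ z, (∫ y, (UnitAddTorus.mFourier (0 : Fin 3 → ℤ) y.1).re * (y.2 0 * y.2 1)
              ∂(empiricalMeasure ((Φ N).flow (s * ((N : ℝ) + 1) ^ (-(1 / 3 : ℝ))) z))) *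
            (∫ y, (UnitAddTorus.mFourier (0 : Fin 3 → ℤ) y.1).re * (y.2 0 * y.2 1) ∂(empiricalMeasure z))
            ∂(localGibbsLaw σ (fun _ => 1) (fun _ => 0) (fun _ => θ) N (Φ N))) atTop
            (𝓝 (⟪F.koopman s (F.fluct (cellObs fun v : V3 => v 0 * v 1)),
                  F.fluct (cellObs fun v : V3 => v 0 * v 1)⟫_ℝ *
                ∫ x : T3, (UnitAddTorus.mFourier (0 : Fin 3 → ℤ) x).re * (UnitAddTorus.mFourier (0 : Fin 3 → ℤ) x).re))) →
    ∃ σ₂ : ℝ, 0 < σ₂ ∧ ∀ σ : ℝ, 0 < σ → σ < σ₂ → ∀ θ : ℝ, 0 < θ → ∀ z : ℝ, 0 < z →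
      ∀ F : HardSphereFluctuationData σ,
        (IsHardSphereGibbs σ z θ⁻¹ (0 : V3) F.μ ∧
          (∫ ω, cellCharge 0 ω ∂F.μ = 1) ∧
          (∃ Φ : InfiniteHardSphereFlow (Fin 3) σ, Φ.IsEquilibriumFlow ∧ ∀ t : ℝ, F.flow t =ᵐ[F.μ] Φ.flow t) ∧
          cellObs (fun v : V3 => v 0 * v 1) ∈ F.localObs) →
        ∀ Φ : (N : ℕ) → HardSphereFlow (Torus.geometry (Fin 3)) (hsDiameter σ N) (N + 1),
        ∀ n : Fin 3 → ℤ, ∀ s : ℝ, 0 < s →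
          Tendsto (fun N : ℕ => ((N : ℝ) + 1) * ∫ z, (∫ y, (UnitAddTorus.mFourier n y.1).re * (y.2 0 * y.2 1)
              ∂(empiricalMeasure ((Φ N).flow (s * ((N : ℝ) + 1) ^ (-(1 / 3 : ℝ))) z))) *
            (∫ y, (UnitAddTorus.mFourier n y.1).re * (y.2 0 * y.2 1) ∂(empiricalMeasure z))
            ∂(localGibbsLaw σ (fun _ => 1) (fun _ => 0) (fun _ => θ) N (Φ N))) atTop
            (𝓝 (⟪F.koopman s (F.fluct (cellObs fun v : V3 => v 0 * v 1)),
                  F.fluct (cellObs fun v : V3 => v 0 * v 1)⟫_ℝ *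
                ∫ x : T3, (UnitAddTorus.mFourier n x).re * (UnitAddTorus.mFourier n x).re)) := by
  sorry

/-- B2diag (formerly STUB B2diag, typed by lead c4; RESHAPED by lead c6 (reshape 12, the long-wavelength reduction) into
B3form ∧ B3loc ∧ B2diag₀ ∧ B3lw and PROVED from them): the two-time kinetic shear-stress structure factor of the density-one torus gas
at fixed macroscopic wavenumber converges to the infinite-volume autocorrelation (`= TorusStressDiagonalLimit`, expanded). -/
theorem stub_torusStressDiagonalLimit :
    ∃ σ₂ : ℝ, 0 < σ₂ ∧ ∀ σ : ℝ, 0 < σ → σ < σ₂ → ∀ θ : ℝ, 0 < θ → ∀ z : ℝ, 0 < z →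
      ∀ F : HardSphereFluctuationData σ,
        (IsHardSphereGibbs σ z θ⁻¹ (0 : V3) F.μ ∧
          (∫ ω, cellCharge 0 ω ∂F.μ = 1) ∧
          (∃ Φ : InfiniteHardSphereFlow (Fin 3) σ, Φ.IsEquilibriumFlow ∧ ∀ t : ℝ, F.flow t =ᵐ[F.μ] Φ.flow t) ∧
          cellObs (fun v : V3 => v 0 * v 1) ∈ F.localObs) →
        ∀ Φ : (N : ℕ) → HardSphereFlow (Torus.geometry (Fin 3)) (hsDiameter σ N) (N + 1),
        ∀ n : Fin 3 → ℤ, ∀ s : ℝ, 0 < s →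
          Tendsto (fun N : ℕ => ((N : ℝ) + 1) * ∫ z, (∫ y, (UnitAddTorus.mFourier n y.1).re * (y.2 0 * y.2 1)
              ∂(empiricalMeasure ((Φ N).flow (s * ((N : ℝ) + 1) ^ (-(1 / 3 : ℝ))) z))) *
            (∫ y, (UnitAddTorus.mFourier n y.1).re * (y.2 0 * y.2 1) ∂(empiricalMeasure z))
            ∂(localGibbsLaw σ (fun _ => 1) (fun _ => 0) (fun _ => θ) N (Φ N))) atTop
            (𝓝 (⟪F.koopman s (F.fluct (cellObs fun v : V3 => v 0 * v 1)),
                  F.fluct (cellObs fun v : V3 => v 0 * v 1)⟫_ℝ *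
                ∫ x : T3, (UnitAddTorus.mFourier n x).re * (UnitAddTorus.mFourier n x).re)) :=
  stub_torusStressLongWavelength stub_torusStressPairForm stub_torusStressPairLocality stub_torusStressDiagonalLimitZero

/-- B2trig (formerly STUB B2trig, RESHAPED by lead c4 after wave 1: PROVED from B2diag by the landed reduction
`torusStressIdentificationTrig_of_diagonal`, p169373 — exact finite-`N` Schur relations p168678): the identification on all pairs of
real Fourier monomials (`= TorusStressIdentificationTrig`, expanded). -/
theorem stub_torusStressIdentificationTrig :
    ∃ σ₂ : ℝ, 0 < σ₂ ∧ ∀ σ : ℝ, 0 < σ → σ < σ₂ → ∀ θ : ℝ, 0 < θ → ∀ z : ℝ, 0 < z →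
      ∀ F : HardSphereFluctuationData σ,
        (IsHardSphereGibbs σ z θ⁻¹ (0 : V3) F.μ ∧
          (∫ ω, cellCharge 0 ω ∂F.μ = 1) ∧
          (∃ Φ : InfiniteHardSphereFlow (Fin 3) σ, Φ.IsEquilibriumFlow ∧ ∀ t : ℝ, F.flow t =ᵐ[F.μ] Φ.flow t) ∧
          cellObs (fun v : V3 => v 0 * v 1) ∈ F.localObs) →
        ∀ Φ : (N : ℕ) → HardSphereFlow (Torus.geometry (Fin 3)) (hsDiameter σ N) (N + 1),
        ∀ n m : Fin 3 → ℤ,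
        ∀ χ₁ ∈ ({fun x : T3 => (UnitAddTorus.mFourier n x).re, fun x : T3 => (UnitAddTorus.mFourier n x).im} : Set (T3 → ℝ)),
        ∀ χ₂ ∈ ({fun x : T3 => (UnitAddTorus.mFourier m x).re, fun x : T3 => (UnitAddTorus.mFourier m x).im} : Set (T3 → ℝ)),
        ∀ s : ℝ, 0 < s →
          Tendsto (fun N : ℕ => ((N : ℝ) + 1) * ∫ z, (∫ y, χ₁ y.1 * (y.2 0 * y.2 1)
              ∂(empiricalMeasure ((Φ N).flow (s * ((N : ℝ) + 1) ^ (-(1 / 3 : ℝ))) z))) *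
            (∫ y, χ₂ y.1 * (y.2 0 * y.2 1) ∂(empiricalMeasure z))
            ∂(localGibbsLaw σ (fun _ => 1) (fun _ => 0) (fun _ => θ) N (Φ N))) atTop
            (𝓝 (⟪F.koopman s (F.fluct (cellObs fun v : V3 => v 0 * v 1)),
                  F.fluct (cellObs fun v : V3 => v 0 * v 1)⟫_ℝ * ∫ x, χ₁ x * χ₂ x)) :=
  Summit.AtomisticToContinuum.HydrodynamicLimit.Theorems.MourreKoopmanChargesStressStrongMixing.torusStressIdentificationTrig_of_diagonal
    stub_torusStressDiagonalLimit

/-- B2glue (formerly STUB B2glue, CLOSED in cycle 4, wave 1: landed p167024, `Theorems/…TorusStressIdentificationPosOfTrig.lean`): the identification on real Fourier monomials extends to all continuous test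
functions — bilinearity, the landed uniform bound `abs_torusStressMoment_le`, density of real trigonometric polynomials in
`C(𝕋³, ℝ)` (`= TorusStressIdentificationPosOfTrig`, expanded: the B2trig signature implies the B2all signature). -/
theorem stub_torusStressIdentificationPosOfTrig :
    (∃ σ₂ : ℝ, 0 < σ₂ ∧ ∀ σ : ℝ, 0 < σ → σ < σ₂ → ∀ θ : ℝ, 0 < θ → ∀ z : ℝ, 0 < z →
      ∀ F : HardSphereFluctuationData σ,
        (IsHardSphereGibbs σ z θ⁻¹ (0 : V3) F.μ ∧
          (∫ ω, cellCharge 0 ω ∂F.μ = 1) ∧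
          (∃ Φ : InfiniteHardSphereFlow (Fin 3) σ, Φ.IsEquilibriumFlow ∧ ∀ t : ℝ, F.flow t =ᵐ[F.μ] Φ.flow t) ∧
          cellObs (fun v : V3 => v 0 * v 1) ∈ F.localObs) →
        ∀ Φ : (N : ℕ) → HardSphereFlow (Torus.geometry (Fin 3)) (hsDiameter σ N) (N + 1),
        ∀ n m : Fin 3 → ℤ,
        ∀ χ₁ ∈ ({fun x : T3 => (UnitAddTorus.mFourier n x).re, fun x : T3 => (UnitAddTorus.mFourier n x).im} : Set (T3 → ℝ)),
        ∀ χ₂ ∈ ({fun x : T3 => (UnitAddTorus.mFourier m x).re, fun x : T3 => (UnitAddTorus.mFourier m x).im} : Set (T3 → ℝ)),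
        ∀ s : ℝ, 0 < s →
          Tendsto (fun N : ℕ => ((N : ℝ) + 1) * ∫ z, (∫ y, χ₁ y.1 * (y.2 0 * y.2 1)
              ∂(empiricalMeasure ((Φ N).flow (s * ((N : ℝ) + 1) ^ (-(1 / 3 : ℝ))) z))) *
            (∫ y, χ₂ y.1 * (y.2 0 * y.2 1) ∂(empiricalMeasure z))
            ∂(localGibbsLaw σ (fun _ => 1) (fun _ => 0) (fun _ => θ) N (Φ N))) atTop
            (𝓝 (⟪F.koopman s (F.fluct (cellObs fun v : V3 => v 0 * v 1)),
                  F.fluct (cellObs fun v : V3 => v 0 * v 1)⟫_ℝ * ∫ x, χ₁ x * χ₂ x))) →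
    ∃ σ₂ : ℝ, 0 < σ₂ ∧ ∀ σ : ℝ, 0 < σ → σ < σ₂ → ∀ θ : ℝ, 0 < θ → ∀ z : ℝ, 0 < z →
      ∀ F : HardSphereFluctuationData σ,
        (IsHardSphereGibbs σ z θ⁻¹ (0 : V3) F.μ ∧
          (∫ ω, cellCharge 0 ω ∂F.μ = 1) ∧
          (∃ Φ : InfiniteHardSphereFlow (Fin 3) σ, Φ.IsEquilibriumFlow ∧ ∀ t : ℝ, F.flow t =ᵐ[F.μ] Φ.flow t) ∧
          cellObs (fun v : V3 => v 0 * v 1) ∈ F.localObs) →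
        ∀ Φ : (N : ℕ) → HardSphereFlow (Torus.geometry (Fin 3)) (hsDiameter σ N) (N + 1),
        ∀ χ₁ χ₂ : T3 → ℝ, Continuous χ₁ → Continuous χ₂ → ∀ s : ℝ, 0 < s →
          Tendsto (fun N : ℕ => ((N : ℝ) + 1) * ∫ z, (∫ y, χ₁ y.1 * (y.2 0 * y.2 1)
              ∂(empiricalMeasure ((Φ N).flow (s * ((N : ℝ) + 1) ^ (-(1 / 3 : ℝ))) z))) *
            (∫ y, χ₂ y.1 * (y.2 0 * y.2 1) ∂(empiricalMeasure z))
            ∂(localGibbsLaw σ (fun _ => 1) (fun _ => 0) (fun _ => θ) N (Φ N))) atTop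
            (𝓝 (⟪F.koopman s (F.fluct (cellObs fun v : V3 => v 0 * v 1)),
                  F.fluct (cellObs fun v : V3 => v 0 * v 1)⟫_ℝ * ∫ x, χ₁ x * χ₂ x)) :=
  Summit.AtomisticToContinuum.HydrodynamicLimit.Theorems.MourreKoopmanChargesStressStrongMixing.stub_torusStressIdentificationPosOfTrig

/-- B2all (derived from B2trig by B2glue): the `∀ F`, raw-moment, `s > 0` identification for all continuous test functions
(`= TorusStressIdentificationPosAll`, expanded). -/
theorem stub_torusStressIdentificationPosAll :
    ∃ σ₂ : ℝ, 0 < σ₂ ∧ ∀ σ : ℝ, 0 < σ → σ < σ₂ → ∀ θ : ℝ, 0 < θ → ∀ z : ℝ, 0 < z →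
      ∀ F : HardSphereFluctuationData σ,
        (IsHardSphereGibbs σ z θ⁻¹ (0 : V3) F.μ ∧
          (∫ ω, cellCharge 0 ω ∂F.μ = 1) ∧
          (∃ Φ : InfiniteHardSphereFlow (Fin 3) σ, Φ.IsEquilibriumFlow ∧ ∀ t : ℝ, F.flow t =ᵐ[F.μ] Φ.flow t) ∧
          cellObs (fun v : V3 => v 0 * v 1) ∈ F.localObs) →
        ∀ Φ : (N : ℕ) → HardSphereFlow (Torus.geometry (Fin 3)) (hsDiameter σ N) (N + 1),
        ∀ χ₁ χ₂ : T3 → ℝ, Continuous χ₁ → Continuous χ₂ → ∀ s : ℝ, 0 < s →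
          Tendsto (fun N : ℕ => ((N : ℝ) + 1) * ∫ z, (∫ y, χ₁ y.1 * (y.2 0 * y.2 1)
              ∂(empiricalMeasure ((Φ N).flow (s * ((N : ℝ) + 1) ^ (-(1 / 3 : ℝ))) z))) *
            (∫ y, χ₂ y.1 * (y.2 0 * y.2 1) ∂(empiricalMeasure z))
            ∂(localGibbsLaw σ (fun _ => 1) (fun _ => 0) (fun _ => θ) N (Φ N))) atTop
            (𝓝 (⟪F.koopman s (F.fluct (cellObs fun v : V3 => v 0 * v 1)),
                  F.fluct (cellObs fun v : V3 => v 0 * v 1)⟫_ℝ * ∫ x, χ₁ x * χ₂ x)) :=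
  stub_torusStressIdentificationPosOfTrig stub_torusStressIdentificationTrig

/-- **A and B2all imply B2pos** (`σ₂ := min (min σ₀(A) σ₂(B2all)) (1/2)`): take the framework `F` delivered by A, rewrite the
covariance form as the raw moment (B1, `σ ≤ 1/2`) and apply B2all to that `F`. -/
theorem torusStressIdentificationPos_of_framework_of_posAll (hA : StressFramework)
    (hall : TorusStressIdentificationPosAll) : TorusStressIdentificationPos := by
  obtain ⟨σ₁, hσ₁, H₁⟩ := hA
  obtain ⟨σ₂, hσ₂, H₂⟩ := hall
  refine ⟨min (min σ₁ σ₂) (1 / 2), lt_min (lt_min hσ₁ hσ₂) (by norm_num), ?_⟩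
  intro σ hσ hσlt θ hθ
  have h₁ : σ < σ₁ := lt_of_lt_of_le hσlt ((min_le_left _ _).trans (min_le_left _ _))
  have h₂ : σ < σ₂ := lt_of_lt_of_le hσlt ((min_le_left _ _).trans (min_le_right _ _))
  have hhalf : σ ≤ 1 / 2 := (lt_of_lt_of_le hσlt (min_le_right _ _)).le
  obtain ⟨z, hz, F, hF⟩ := H₁ σ hσ h₁ θ hθ
  refine ⟨z, hz, F, hF, fun Φ χ₁ χ₂ hχ₁ hχ₂ s hs => ?_⟩
  have hfun : (fun N : ℕ => torusStressCov σ θ Φ χ₁ χ₂ s N) = fun N : ℕ => torusStressMoment σ θ Φ χ₁ χ₂ s N :=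
    funext fun N => (stub_torusStressRawEqCov σ hσ hhalf θ hθ Φ χ₁ χ₂ hχ₁ hχ₂ s N).symm
  rw [hfun]
  exact H₂ σ hσ h₂ θ hθ z hz F hF Φ χ₁ χ₂ hχ₁ hχ₂ s hs

/-- B2pos (formerly STUB B2pos, RESHAPED by lead c4: now PROVED from A — hence from F1, Alexander, Fcov, F3a, Loc, F3glue — and
B2all ⇐ B2trig ∧ B2glue): the torus → `ℋ` identification of the two-time stress covariances for ONE density-one framework at
POSITIVE kinetic times (`= TorusStressIdentificationPos`, expanded). -/
theorem stub_torusStressIdentificationPos :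
    ∃ σ₂ : ℝ, 0 < σ₂ ∧ ∀ σ : ℝ, 0 < σ → σ < σ₂ → ∀ θ : ℝ, 0 < θ →
      ∃ z : ℝ, 0 < z ∧ ∃ F : HardSphereFluctuationData σ,
        (IsHardSphereGibbs σ z θ⁻¹ (0 : V3) F.μ ∧
          (∫ ω, cellCharge 0 ω ∂F.μ = 1) ∧
          (∃ Φ : InfiniteHardSphereFlow (Fin 3) σ, Φ.IsEquilibriumFlow ∧ ∀ t : ℝ, F.flow t =ᵐ[F.μ] Φ.flow t) ∧
          cellObs (fun v : V3 => v 0 * v 1) ∈ F.localObs) ∧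
        ∀ Φ : (N : ℕ) → HardSphereFlow (Torus.geometry (Fin 3)) (hsDiameter σ N) (N + 1),
        ∀ χ₁ χ₂ : T3 → ℝ, Continuous χ₁ → Continuous χ₂ → ∀ s : ℝ, 0 < s →
          Tendsto (fun N : ℕ => ((N : ℝ) + 1) *
              cov[fun z => ∫ y, χ₁ y.1 * (y.2 0 * y.2 1)
                    ∂(empiricalMeasure ((Φ N).flow (s * ((N : ℝ) + 1) ^ (-(1 / 3 : ℝ))) z)),
                  fun z => ∫ y, χ₂ y.1 * (y.2 0 * y.2 1) ∂(empiricalMeasure z);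
                localGibbsLaw σ (fun _ => 1) (fun _ => 0) (fun _ => θ) N (Φ N)]) atTop
            (𝓝 (⟪F.koopman s (F.fluct (cellObs fun v : V3 => v 0 * v 1)),
                  F.fluct (cellObs fun v : V3 => v 0 * v 1)⟫_ℝ * ∫ x, χ₁ x * χ₂ x)) :=
  torusStressIdentificationPos_of_framework_of_posAll stub_stressFramework stub_torusStressIdentificationPosAll

/-- **B2pos and B2zero imply B2core** (`σ₂ := min σ₂(B2pos) (1/2)`): for `s > 0` this is B2pos; at `s = 0` the
torus covariance form equals the raw moment (B1, `σ ≤ 1/2`), which is `θ²∫χ₁χ₂` for EVERY `N` (landed torus statics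
`torusStressMoment_zero`), and `θ² = c_F(0)` (B2zero), so the constant sequence converges. -/
theorem torusStressIdentificationCore_of_pos_of_zero (hpos : TorusStressIdentificationPos)
    (hzero : StressAutocorrelationZero) : TorusStressIdentificationCore := by
  obtain ⟨σ₂, hσ₂, H₂⟩ := hpos
  refine ⟨min σ₂ (1 / 2), lt_min hσ₂ (by norm_num), ?_⟩
  intro σ hσ hσlt θ hθ
  have h₂ : σ < σ₂ := lt_of_lt_of_le hσlt (min_le_left _ _)
  have hhalf : σ ≤ 1 / 2 := (lt_of_lt_of_le hσlt (min_le_right _ _)).le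
  obtain ⟨z, hz, F, hF, H⟩ := H₂ σ hσ h₂ θ hθ
  refine ⟨z, hz, F, hF, fun Φ χ₁ χ₂ hχ₁ hχ₂ s hs => ?_⟩
  rcases hs.lt_or_eq with hs' | hs'
  · exact H Φ χ₁ χ₂ hχ₁ hχ₂ s hs'
  · subst hs'
    have hc0 : stressAutocorrelation F 0 = θ ^ 2 := hzero σ θ z hσ hθ hz F hF
    have hconst : ∀ N : ℕ, torusStressCov σ θ Φ χ₁ χ₂ 0 N = θ ^ 2 * ∫ x, χ₁ x * χ₂ x := fun N => by
      rw [torusStressCov, ← stub_torusStressRawEqCov σ hσ hhalf θ hθ Φ χ₁ χ₂ hχ₁ hχ₂ 0 N]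
      exact Summit.AtomisticToContinuum.HydrodynamicLimit.Theorems.MourreKoopmanChargesStressStrongMixing.torusStressMoment_zero
        σ hhalf θ hθ Φ χ₁ χ₂ hχ₁ hχ₂ N
    rw [hc0, funext hconst]
    exact tendsto_const_nhds

/-- B2core (formerly STUB B2core, now PROVED from B2pos and B2zero by `torusStressIdentificationCore_of_pos_of_zero`):
the torus → `ℋ` identification of the two-time stress covariances for ONE density-one framework, all `s ≥ 0`
(`= TorusStressIdentificationCore`, expanded). -/
theorem stub_torusStressIdentificationCore :
    ∃ σ₂ : ℝ, 0 < σ₂ ∧ ∀ σ : ℝ, 0 < σ → σ < σ₂ → ∀ θ : ℝ, 0 < θ →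
      ∃ z : ℝ, 0 < z ∧ ∃ F : HardSphereFluctuationData σ,
        (IsHardSphereGibbs σ z θ⁻¹ (0 : V3) F.μ ∧
          (∫ ω, cellCharge 0 ω ∂F.μ = 1) ∧
          (∃ Φ : InfiniteHardSphereFlow (Fin 3) σ, Φ.IsEquilibriumFlow ∧ ∀ t : ℝ, F.flow t =ᵐ[F.μ] Φ.flow t) ∧
          cellObs (fun v : V3 => v 0 * v 1) ∈ F.localObs) ∧
        ∀ Φ : (N : ℕ) → HardSphereFlow (Torus.geometry (Fin 3)) (hsDiameter σ N) (N + 1),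
        ∀ χ₁ χ₂ : T3 → ℝ, Continuous χ₁ → Continuous χ₂ → ∀ s : ℝ, 0 ≤ s →
          Tendsto (fun N : ℕ => ((N : ℝ) + 1) *
              cov[fun z => ∫ y, χ₁ y.1 * (y.2 0 * y.2 1)
                    ∂(empiricalMeasure ((Φ N).flow (s * ((N : ℝ) + 1) ^ (-(1 / 3 : ℝ))) z)),
                  fun z => ∫ y, χ₂ y.1 * (y.2 0 * y.2 1) ∂(empiricalMeasure z);
                localGibbsLaw σ (fun _ => 1) (fun _ => 0) (fun _ => θ) N (Φ N)]) atTop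
            (𝓝 (⟪F.koopman s (F.fluct (cellObs fun v : V3 => v 0 * v 1)),
                  F.fluct (cellObs fun v : V3 => v 0 * v 1)⟫_ℝ * ∫ x, χ₁ x * χ₂ x)) :=
  torusStressIdentificationCore_of_pos_of_zero stub_torusStressIdentificationPos stub_stressAutocorrelationZero

/-- B2 (formerly STUB B2, now PROVED from Fu, M4, B2core by the landed reduction `torusStressCovIdentification_of`,
p150204): torus → `ℋ` identification of the two-time stress covariances for EVERY density-one framework
(`= TorusStressCovIdentification`, expanded). -/
theorem stub_torusStressCovIdentification :
    ∃ σ₀ : ℝ, 0 < σ₀ ∧ ∀ σ : ℝ, 0 < σ → σ < σ₀ → ∀ θ : ℝ, 0 < θ → ∀ z : ℝ, 0 < z →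
      ∀ F : HardSphereFluctuationData σ,
        (IsHardSphereGibbs σ z θ⁻¹ (0 : V3) F.μ ∧
          (∫ ω, cellCharge 0 ω ∂F.μ = 1) ∧
          (∃ Φ : InfiniteHardSphereFlow (Fin 3) σ, Φ.IsEquilibriumFlow ∧ ∀ t : ℝ, F.flow t =ᵐ[F.μ] Φ.flow t) ∧
          cellObs (fun v : V3 => v 0 * v 1) ∈ F.localObs) →
      ∀ Φ : (N : ℕ) → HardSphereFlow (Torus.geometry (Fin 3)) (hsDiameter σ N) (N + 1),
      ∀ χ₁ χ₂ : T3 → ℝ, Continuous χ₁ → Continuous χ₂ → ∀ s : ℝ, 0 ≤ s →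
        Tendsto (fun N : ℕ => ((N : ℝ) + 1) *
            cov[fun z => ∫ y, χ₁ y.1 * (y.2 0 * y.2 1)
                  ∂(empiricalMeasure ((Φ N).flow (s * ((N : ℝ) + 1) ^ (-(1 / 3 : ℝ))) z)),
                fun z => ∫ y, χ₂ y.1 * (y.2 0 * y.2 1) ∂(empiricalMeasure z);
              localGibbsLaw σ (fun _ => 1) (fun _ => 0) (fun _ => θ) N (Φ N)]) atTop
          (𝓝 (⟪F.koopman s (F.fluct (cellObs fun v : V3 => v 0 * v 1)),
                F.fluct (cellObs fun v : V3 => v 0 * v 1)⟫_ℝ * ∫ x, χ₁ x * χ₂ x)) :=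
  Summit.AtomisticToContinuum.HydrodynamicLimit.Theorems.MourreKoopmanChargesStressStrongMixing.torusStressCovIdentification_of
    stub_alexanderUnique stub_densityOneGibbsUnique stub_torusStressIdentificationCore

/-! C1 `StressSpectralDensity` (the a.c.-density form of the spectral content, registered as `stub_stressSpectralDensity` from reshape 2
to reshape 10) is NO LONGER A STUB since reshape 11 (lead c5): it is strictly stronger than what the composition consumes and has no engine
that the minimal form lacks.  It survives as the named `Prop` above together with the proved implication C1 ⇒ C
(`stressRajchman_of_spectralDensity`, Riemann–Lebesgue) and the record composition `StressStrongMixing_of_C1` at the end of the file. -/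

/-- **Riemann–Lebesgue for cosine transforms** (the glue C1 ⇒ C): for an integrable `ρ : ℝ → ℝ`,
`∫ cos(sλ) ρ(λ) dλ → 0` as `s → ∞` (real part of Mathlib's `Real.tendsto_integral_exp_smul_cocompact` at
`w = -s/(2π)`). [folklore] -/
theorem tendsto_integral_cos_mul_of_integrable {ρ : ℝ → ℝ} (hρ : Integrable ρ) :
    Tendsto (fun s : ℝ => ∫ l, Real.cos (s * l) * ρ l) atTop (𝓝 0) := by
  -- Riemann–Lebesgue for the complexified density along `w = s / (2π) → +∞ ≤ cocompact ℝ`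
  have hRL := Real.tendsto_integral_exp_smul_cocompact (fun l : ℝ => ((ρ l : ℝ) : ℂ))
  have hw : Tendsto (fun s : ℝ => s / (2 * Real.pi)) atTop (cocompact ℝ) :=
    (tendsto_id.atTop_div_const (by positivity)).mono_right atTop_le_cocompact
  have h := (Complex.continuous_re.tendsto 0).comp (hRL.comp hw)
  rw [Complex.zero_re] at h
  refine h.congr fun s => ?_
  simp only [Function.comp_apply]
  -- the complex integrand is integrable (unit-modulus character times an integrable real function)
  have hmeas : AEStronglyMeasurable
      (fun l : ℝ => Real.fourierChar (-(l * (s / (2 * Real.pi)))) • ((ρ l : ℝ) : ℂ)) volume :=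
    ((Real.continuous_fourierChar.comp ((continuous_id.mul continuous_const).neg)).aestronglyMeasurable).smul
      hρ.ofReal.aestronglyMeasurable
  have hint : Integrable (fun l : ℝ => Real.fourierChar (-(l * (s / (2 * Real.pi)))) • ((ρ l : ℝ) : ℂ)) :=
    hρ.ofReal.norm.mono' hmeas (ae_of_all _ fun l => (Circle.norm_smul _ _).le)
  -- real part of the integral = integral of the real part = the cosine transform
  rw [← Complex.reCLM_apply, ← ContinuousLinearMap.integral_comp_comm _ hint]
  refine integral_congr_ae (ae_of_all _ fun l => ?_)
  have hπ : (2 : ℝ) * Real.pi ≠ 0 := by positivity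
  show Complex.reCLM (Real.fourierChar (-(l * (s / (2 * Real.pi)))) • ((ρ l : ℝ) : ℂ)) = Real.cos (s * l) * ρ l
  rw [Complex.reCLM_apply, Circle.smul_def, Real.fourierChar_apply, smul_eq_mul, mul_comm,
    Complex.re_ofReal_mul, Complex.exp_ofReal_mul_I_re,
    show 2 * Real.pi * -(l * (s / (2 * Real.pi))) = -(s * l) by field_simp, Real.cos_neg, mul_comm]

/-- **C1 implies C** (`StressSpectralDensity → StressRajchman`): Riemann–Lebesgue. -/
theorem stressRajchman_of_spectralDensity (h : StressSpectralDensity) : StressRajchman := by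
  obtain ⟨σ₀, hσ₀, H⟩ := h
  refine ⟨σ₀, hσ₀, fun σ hσ hσlt θ hθ z hz F hF => ?_⟩
  obtain ⟨ρ, hρ, hrepr⟩ := H σ hσ hσlt θ hθ z hz F hF
  have hfun : stressAutocorrelation F = fun s => ∫ l, Real.cos (s * l) * ρ l := funext hrepr
  rw [hfun]
  exact tendsto_integral_cos_mul_of_integrable hρ

/-- STUB C (XL, HARDEST — the crux's open content; registered again since reshape 11, lead c5; it was the registrar's original
`stub_stressRajchman`, derived from the stronger C1 between reshapes 2 and 10): Rajchman decay of the `k = 0` kinetic shear-stress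
autocorrelation in Spohn's `ℋ`, `⟪U_s ξ_Π, ξ_Π⟫_ℋ → 0` as `s → ∞`, on every density-one framework at small reduced diameter
(`= StressRajchman`, expanded; verbatim the split child `StressRajchmanDecay` of `Lines/split3.lean`).  Status in print: OPEN at fixed packing
(Spohn 1991 Part I §7.2 p. 94; Dobrushin–Sinai–Sukhov, EMS 2 Ch. 10 §4.4); proved only in the Boltzmann–Grad limit (BGSS, CPAM 2023, Thm 1.1).
Fails for free flight (`c ≡ θ²`, `IdealGasNoDecay`): collisions must bite here. -/
theorem stub_stressRajchman :
    ∃ σ₀ : ℝ, 0 < σ₀ ∧ ∀ σ : ℝ, 0 < σ → σ < σ₀ → ∀ θ : ℝ, 0 < θ → ∀ z : ℝ, 0 < z →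
      ∀ F : HardSphereFluctuationData σ,
        (IsHardSphereGibbs σ z θ⁻¹ (0 : V3) F.μ ∧
          (∫ ω, cellCharge 0 ω ∂F.μ = 1) ∧
          (∃ Φ : InfiniteHardSphereFlow (Fin 3) σ, Φ.IsEquilibriumFlow ∧ ∀ t : ℝ, F.flow t =ᵐ[F.μ] Φ.flow t) ∧
          cellObs (fun v : V3 => v 0 * v 1) ∈ F.localObs) →
        Tendsto (fun s : ℝ => ⟪F.koopman s (F.fluct (cellObs fun v : V3 => v 0 * v 1)),
            F.fluct (cellObs fun v : V3 => v 0 * v 1)⟫_ℝ) atTop (𝓝 0) := by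
  sorry

/-- The expanded stub types ARE the named statements (definitional unfolding; re-checked by the kernel). -/
example : StressFramework = (∃ σ₀ : ℝ, 0 < σ₀ ∧ ∀ σ : ℝ, 0 < σ → σ < σ₀ → ∀ θ : ℝ, 0 < θ →
      ∃ z : ℝ, 0 < z ∧ ∃ F : HardSphereFluctuationData σ,
        IsHardSphereGibbs σ z θ⁻¹ (0 : V3) F.μ ∧
        (∫ ω, cellCharge 0 ω ∂F.μ = 1) ∧
        (∃ Φ : InfiniteHardSphereFlow (Fin 3) σ, Φ.IsEquilibriumFlow ∧ ∀ t : ℝ, F.flow t =ᵐ[F.μ] Φ.flow t) ∧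
        cellObs (fun v : V3 => v 0 * v 1) ∈ F.localObs) := rfl
example : TorusStressRawEqCov := fun σ hσ hσ' θ hθ Φ χ₁ χ₂ h₁ h₂ s N =>
  stub_torusStressRawEqCov σ hσ hσ' θ hθ Φ χ₁ χ₂ h₁ h₂ s N
example : TorusStressCovIdentification := stub_torusStressCovIdentification
example : StressRajchman := stub_stressRajchman
example : StressFramework := stub_stressFramework
example : DiluteGibbsDensityOne := stub_diluteGibbsDensityOne
example : RuelleDiluteGas := stub_ruelleDiluteGas
example : LowDensityGibbsUniqueness3 := stub_lowDensityGibbsUniqueness3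
example : AlexanderExistence := stub_alexanderExistence
example : AlexanderFlow := stub_alexanderFlow
example : EquilibriumFlowShiftCovariant := stub_equilibriumFlowShiftCovariant
example : StressSpectralDensity → StressRajchman := stressRajchman_of_spectralDensity
example : AlexanderUnique := stub_alexanderUnique
example : DensityOneGibbsUnique := stub_densityOneGibbsUnique
example : TorusStressIdentificationCore := stub_torusStressIdentificationCore
example : TorusStressIdentificationPos := stub_torusStressIdentificationPos
example : StressAutocorrelationZero := stub_stressAutocorrelationZero
example : GeneratorMoments := stub_generatorMoments
example : TwoTimeClustering := stub_twoTimeClustering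
example : StaticClustering := stub_staticClustering
example : DynamicClusteringUpgrade := stub_dynamicClusteringUpgrade
example : FlowLocality := stub_flowLocality
example : TwoTimeClusteringOfLocality := stub_twoTimeClusteringOfLocality
example : TorusStressIdentificationTrig := stub_torusStressIdentificationTrig
example : TorusStressIdentificationPosOfTrig := stub_torusStressIdentificationPosOfTrig
example : TorusStressIdentificationPosAll := stub_torusStressIdentificationPosAll
example : FlowLocalityInLaw := stub_flowLocalityInLaw
example : FlowLocalityOfInLaw := stub_flowLocalityOfInLaw
example : TorusStressDiagonalLimit := stub_torusStressDiagonalLimit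
example : TorusStressPairForm := stub_torusStressPairForm
example : TorusStressPairLocality := stub_torusStressPairLocality
example : TorusStressDiagonalLimitZero := stub_torusStressDiagonalLimitZero
example : TorusStressLongWavelength := stub_torusStressLongWavelength
example : FlowLocalityDominated := stub_flowLocalityDominated
example : WindowFourthMoments := stub_windowFourthMoments

/-! ### Glue of the reshaped stub B2 (PROVED, = the landed `torusStressCovIdentification_of`): Fu ∧ M4 ∧ B2core ⇒ B2 -/

/-- **Fu, M4 and B2core imply B2** (F-independence of `c_F` from the two uniqueness facts; landed as
`…Theorems.MourreKoopmanChargesStressStrongMixing.torusStressCovIdentification_of`, p150204). -/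
theorem torusStressCovIdentification_of_inputs (hFu : AlexanderUnique) (hM4 : DensityOneGibbsUnique)
    (hcore : TorusStressIdentificationCore) : TorusStressCovIdentification :=
  Summit.AtomisticToContinuum.HydrodynamicLimit.Theorems.MourreKoopmanChargesStressStrongMixing.torusStressCovIdentification_of
    hFu hM4 hcore

/-! ### Glue (PROVED): Fu ⇒ Fcov (landed `equilibriumFlowShiftCovariant_of_unique`, p152524) -/

/-- **Fu implies Fcov.** -/
theorem equilibriumFlowShiftCovariant_of_alexanderUnique (hFu : AlexanderUnique) : EquilibriumFlowShiftCovariant :=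
  Summit.AtomisticToContinuum.HydrodynamicLimit.Theorems.MourreKoopmanChargesStressStrongMixing.equilibriumFlowShiftCovariant_of_unique
    hFu

/-! ### Glue of the reshaped stub A (PROVED, = the landed `stressFramework_of`): F1 ∧ F2 ∧ Fcov ∧ F3 ⇒ A -/

/-- **F1, F2, Fcov and F3 imply A** (assembly of `F` via `IsFluctuationSetting.of_gibbs … |>.fluctuationData`;
landed as `…Theorems.MourreKoopmanChargesStressStrongMixing.stressFramework_of`, p147060). -/
theorem stressFramework_of_inputs (hF1 : DiluteGibbsDensityOne) (hF2 : AlexanderExistence)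
    (hFcov : EquilibriumFlowShiftCovariant) (hF3 : SpaceClusteringDensityOne) : StressFramework :=
  Summit.AtomisticToContinuum.HydrodynamicLimit.Theorems.MourreKoopmanChargesStressStrongMixing.stressFramework_of
    hF1 hF2 hFcov hF3

/-! ### Glue of the reshaped stub B (PROVED): B1 ∧ B2 ⇒ B -/

/-- **B1 and B2 imply B** (`σ₀ := min σ₀(B2) (1/2)`; for `σ < σ₀` rewrite each raw moment as `(N+1)`·covariance
by B1 and apply B2). -/
theorem torusStressIdentification_of (hB1 : TorusStressRawEqCov) (hB2 : TorusStressCovIdentification) :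
    TorusStressIdentification := by
  obtain ⟨σ₂, hσ₂, H₂⟩ := hB2
  refine ⟨min σ₂ (1 / 2), lt_min hσ₂ (by norm_num), ?_⟩
  intro σ hσ hσlt θ hθ z hz F hF Φ χ₁ χ₂ hχ₁ hχ₂ s hs
  have h₂ : σ < σ₂ := lt_of_lt_of_le hσlt (min_le_left _ _)
  have hhalf : σ ≤ 1 / 2 := (lt_of_lt_of_le hσlt (min_le_right _ _)).le
  have hfun : (fun N : ℕ => torusStressMoment σ θ Φ χ₁ χ₂ s N) =
      fun N : ℕ => torusStressCov σ θ Φ χ₁ χ₂ s N :=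
    funext fun N => hB1 σ hσ hhalf θ hθ Φ χ₁ χ₂ hχ₁ hχ₂ s N
  rw [hfun]
  exact H₂ σ hσ h₂ θ hθ z hz F hF Φ χ₁ χ₂ hχ₁ hχ₂ s hs

/-! ### Name-keyed aliases of the stub statements (the hypotheses of the composition; the skeleton audit admits a
hypothesis only if its head constant is a registered obligation or is named like a declared stub) -/
namespace Registered

/-- Alias of `AlexanderFlow` keyed by the registered stub name. -/
abbrev stub_alexanderFlow : Prop := AlexanderFlow
/-- Alias of `FlowLocalityDominated` keyed by the registered stub name. -/
abbrev stub_flowLocalityDominated : Prop := FlowLocalityDominated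
/-- Alias of `TorusStressPairForm` keyed by the registered stub name (reshape 12). -/
abbrev stub_torusStressPairForm : Prop := TorusStressPairForm
/-- Alias of `TorusStressPairLocality` keyed by the registered stub name (reshape 12). -/
abbrev stub_torusStressPairLocality : Prop := TorusStressPairLocality
/-- Alias of `TorusStressDiagonalLimitZero` keyed by the registered stub name (reshape 12). -/
abbrev stub_torusStressDiagonalLimitZero : Prop := TorusStressDiagonalLimitZero
/-- Alias of `TorusStressLongWavelength` keyed by the registered stub name (reshape 12). -/
abbrev stub_torusStressLongWavelength : Prop := TorusStressLongWavelength
/-- Alias of `StressRajchman` keyed by the registered stub name (reshape 11: the minimal spectral stub). -/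
abbrev stub_stressRajchman : Prop := StressRajchman

end Registered

/-! ### Composition (PROVED): the stubs imply the crux BY NAME

(The skeleton audit `#h21_check_skeleton` requires that EXACTLY ONE theorem of this file concludes the crux constant by name — it takes an
arbitrary one otherwise; therefore only `StressStrongMixing_of` below concludes `…Theses.MourreKoopmanCharges.StressStrongMixing` literally,
while the auxiliary compositions conclude the reducible alias `CruxStatement` and the historical shapes conclude the bundle
`StressFramework ∧ TorusStressIdentification ∧ StressRajchman`.) -/

/-- Reducible alias of the crux statement, used as the conclusion of the AUXILIARY compositions only (so that the skeleton audit sees a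
single theorem concluding the crux by name). -/
abbrev CruxStatement : Prop := Summit.AtomisticToContinuum.HydrodynamicLimit.Theses.MourreKoopmanCharges.StressStrongMixing


/-- **A ∧ B ∧ C imply the crux** (`σ₀ := min` of the three thresholds, `c := c_F` for the framework `F` delivered by A, decay by C,
convergence by B). -/
theorem StressStrongMixing_of_ABC (h : StressFramework ∧ TorusStressIdentification ∧ StressRajchman) :
    CruxStatement := by
  obtain ⟨hA, hB, hC⟩ := h
  obtain ⟨σ₁, hσ₁, H₁⟩ := hA
  obtain ⟨σ₂, hσ₂, H₂⟩ := hB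
  obtain ⟨σ₃, hσ₃, H₃⟩ := hC
  refine ⟨min σ₁ (min σ₂ σ₃), lt_min hσ₁ (lt_min hσ₂ hσ₃), ?_⟩
  intro σ hσ hσlt θ hθ
  have h₁ : σ < σ₁ := lt_of_lt_of_le hσlt (min_le_left _ _)
  have h₂ : σ < σ₂ := lt_of_lt_of_le hσlt ((min_le_right _ _).trans (min_le_left _ _))
  have h₃ : σ < σ₃ := lt_of_lt_of_le hσlt ((min_le_right _ _).trans (min_le_right _ _))
  obtain ⟨z, hz, F, hF⟩ := H₁ σ hσ h₁ θ hθ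
  refine ⟨stressAutocorrelation F, H₃ σ hσ h₃ θ hθ z hz F hF, ?_⟩
  intro Φ χ₁ χ₂ hχ₁ hχ₂ s hs
  exact H₂ σ hσ h₂ θ hθ z hz F hF Φ χ₁ χ₂ hχ₁ hχ₂ s hs

/-- **Shape 7 (lead c3): Alexander, F3dyn, B2pos and C (and the closed Ruelle, F3a, B1, LowDensU3, B2zero) give A ∧ B ∧ C**
(pure logic: F1 from the tree's `RuelleDiluteHardSphereGas_holds`; A from F1, F2, Fcov, F3a, F3b by `stressFramework_of_min`;
B2core from B2pos and B2zero (closed); B2 from Fu, M4 (⇐ LowDensU3, closed), B2core; B from B1 (closed) and B2; C is a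
hypothesis since reshape 11 — formerly derived from C1 by Riemann–Lebesgue). -/
theorem abc_of_shape7 (hAlex : AlexanderFlow) (hF3d : DynamicClusteringUpgrade)
    (hpos : TorusStressIdentificationPos) (hC : StressRajchman) :
    StressFramework ∧ TorusStressIdentification ∧ StressRajchman := by
  -- F3static is CLOSED (c3 wave 2): discharged here
  have hF3b : TwoTimeClustering := hF3d stub_staticClustering
  -- Ruelle is CLOSED in the tree (2026-08-17): discharged here
  have hRuelle : RuelleDiluteGas := Literature.MathematicalPhysics.StatisticalMechanics.RuelleDiluteHardSphereGas_holds
  -- F3a is CLOSED (c2 wave 3), LowDensU3 and B2zero are CLOSED (c3 wave 1): discharged here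
  have hF3a : GeneratorMoments := stub_generatorMoments
  have hLowDensU3 : LowDensityGibbsUniqueness3 := stub_lowDensityGibbsUniqueness3
  have hzero : StressAutocorrelationZero := stub_stressAutocorrelationZero
  have hF1 : DiluteGibbsDensityOne :=
    Summit.AtomisticToContinuum.HydrodynamicLimit.Theorems.MourreKoopmanChargesStressStrongMixing.diluteGibbsDensityOne_of_ruelle
      hRuelle
  have hM4 : DensityOneGibbsUnique := densityOneGibbsUnique_of_lowDensityUniqueness3 hLowDensU3
  have hF2 : AlexanderExistence := hAlex.1
  have hFu : AlexanderUnique := hAlex.2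
  have hFcov : EquilibriumFlowShiftCovariant := equilibriumFlowShiftCovariant_of_alexanderUnique hFu
  have hcore : TorusStressIdentificationCore := torusStressIdentificationCore_of_pos_of_zero hpos hzero
  have hB2 : TorusStressCovIdentification := torusStressCovIdentification_of_inputs hFu hM4 hcore
  -- B1 is CLOSED (landed p145407): discharged here, no longer a hypothesis
  have hB1 : TorusStressRawEqCov := fun σ hσ hσ' θ hθ Φ χ₁ χ₂ h₁ h₂ s N =>
    stub_torusStressRawEqCov σ hσ hσ' θ hθ Φ χ₁ χ₂ h₁ h₂ s N
  exact ⟨stressFramework_of_min hF1 hF2 hFcov hF3a hF3b, torusStressIdentification_of hB1 hB2, hC⟩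

/-- **A from Alexander and Loc** (`stressFramework_of_min` with F1 from the tree's Ruelle theorem, Fcov from Alexander
uniqueness, F3a closed, and F3b := F3glue Loc). -/
theorem stressFramework_of_loc (hAlex : AlexanderFlow) (hLoc : FlowLocality) (hLocGlue : TwoTimeClusteringOfLocality) :
    StressFramework :=
  stressFramework_of_min
    (Summit.AtomisticToContinuum.HydrodynamicLimit.Theorems.MourreKoopmanChargesStressStrongMixing.diluteGibbsDensityOne_of_ruelle
      Literature.MathematicalPhysics.StatisticalMechanics.RuelleDiluteHardSphereGas_holds)
    hAlex.1 (equilibriumFlowShiftCovariant_of_alexanderUnique hAlex.2) stub_generatorMoments (hLocGlue hLoc)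

/-- **Shape 8 (lead c4, before wave 1): Alexander, Loc, F3glue, B2trig, B2glue and C give A ∧ B ∧ C** (over shape 7: F3dyn := F3glue Loc
with the static hypothesis discarded; B2pos from A and B2all := B2glue B2trig). -/
theorem abc_of_shape8 (hAlex : AlexanderFlow) (hLoc : FlowLocality)
    (hLocGlue : TwoTimeClusteringOfLocality) (hTrig : TorusStressIdentificationTrig)
    (hTrigGlue : TorusStressIdentificationPosOfTrig) (hC : StressRajchman) :
    StressFramework ∧ TorusStressIdentification ∧ StressRajchman :=
  abc_of_shape7 hAlex (fun _ => hLocGlue hLoc)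
    (torusStressIdentificationPos_of_framework_of_posAll (stressFramework_of_loc hAlex hLoc hLocGlue) (hTrigGlue hTrig)) hC

/-- **B2diag implies B2trig** (named form of the landed `torusStressIdentificationTrig_of_diagonal`, p169373). -/
theorem torusStressIdentificationTrig_of_diagonalLimit (hDiag : TorusStressDiagonalLimit) : TorusStressIdentificationTrig :=
  Summit.AtomisticToContinuum.HydrodynamicLimit.Theorems.MourreKoopmanChargesStressStrongMixing.torusStressIdentificationTrig_of_diagonal
    hDiag

/-- **Shape 9: Alexander, Loc0, LocGlue0, B2diag and C give A ∧ B ∧ C** (over shape 8: Loc := LocGlue0 Loc0, F3glue and B2glue landed,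
B2trig := the landed diagonal reduction applied to B2diag). -/
theorem abc_of_shape9 (hAlex : AlexanderFlow) (hLoc0 : FlowLocalityInLaw)
    (hLocGlue0 : FlowLocalityOfInLaw) (hDiag : TorusStressDiagonalLimit) (hC : StressRajchman) :
    StressFramework ∧ TorusStressIdentification ∧ StressRajchman :=
  abc_of_shape8 hAlex (hLocGlue0 hLoc0)
    Summit.AtomisticToContinuum.HydrodynamicLimit.Theorems.MourreKoopmanChargesStressStrongMixing.stub_twoTimeClusteringOfLocality
    (torusStressIdentificationTrig_of_diagonalLimit hDiag)
    Summit.AtomisticToContinuum.HydrodynamicLimit.Theorems.MourreKoopmanChargesStressStrongMixing.stub_torusStressIdentificationPosOfTrig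
    hC

/-- **Shape 10: Alexander, LocDom, I4, LocGlue0, B2diag and C give A ∧ B ∧ C** (over shape 9: Loc0 := `flowLocalityInLaw_of_dominated`
LocDom I4). -/
theorem abc_of_shape10 (hAlex : AlexanderFlow) (hLocDom : FlowLocalityDominated)
    (hI4 : WindowFourthMoments) (hLocGlue0 : FlowLocalityOfInLaw)
    (hDiag : TorusStressDiagonalLimit) (hC : StressRajchman) :
    StressFramework ∧ TorusStressIdentification ∧ StressRajchman :=
  abc_of_shape9 hAlex (flowLocalityInLaw_of_dominated hLocDom hI4) hLocGlue0 hDiag hC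

/-- **Shape 11 (lead c5): Alexander, LocDom, B2diag and the minimal spectral stub C imply the crux** (record form, concluding the
alias `CruxStatement`; I4 (p170434) and LocGlue0 (p169819) discharged by their landed theorems). -/
theorem cruxStatement_of_shape11 (hAlex : AlexanderFlow) (hLocDom : FlowLocalityDominated)
    (hDiag : TorusStressDiagonalLimit) (hC : StressRajchman) : CruxStatement :=
  StressStrongMixing_of_ABC (abc_of_shape10 hAlex hLocDom
    Summit.AtomisticToContinuum.HydrodynamicLimit.Theorems.MourreKoopmanChargesStressStrongMixing.stub_windowFourthMoments
    Summit.AtomisticToContinuum.HydrodynamicLimit.Theorems.MourreKoopmanChargesStressStrongMixing.stub_flowLocalityOfInLaw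
    hDiag hC)

/-- **B3form, B3loc and B2diag₀ imply B2diag through the long-wavelength glue B3lw** (named form of reshape 12). -/
theorem torusStressDiagonalLimit_of_longWavelength (hForm : TorusStressPairForm) (hPairLoc : TorusStressPairLocality)
    (hDiag0 : TorusStressDiagonalLimitZero) (hLW : TorusStressLongWavelength) : TorusStressDiagonalLimit :=
  hLW hForm hPairLoc hDiag0

/-- **The seven registered stubs (shape 12 = shape 11 with B2diag cut along the long-wavelength reduction) imply the crux**
`StressStrongMixing` BY NAME: Alexander, LocDom, B3form (provable), B3loc, B2diag₀, B3lw (provable), C. -/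
theorem StressStrongMixing_of (hAlex : Registered.stub_alexanderFlow) (hLocDom : Registered.stub_flowLocalityDominated)
    (hForm : Registered.stub_torusStressPairForm) (hPairLoc : Registered.stub_torusStressPairLocality)
    (hDiag0 : Registered.stub_torusStressDiagonalLimitZero) (hLW : Registered.stub_torusStressLongWavelength)
    (hC : Registered.stub_stressRajchman) :
    Summit.AtomisticToContinuum.HydrodynamicLimit.Theses.MourreKoopmanCharges.StressStrongMixing :=
  cruxStatement_of_shape11 hAlex hLocDom (torusStressDiagonalLimit_of_longWavelength hForm hPairLoc hDiag0 hLW) hC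

/-- Wiring check: the registered stubs feed `StressStrongMixing_of` as stated. -/
example : Summit.AtomisticToContinuum.HydrodynamicLimit.Theses.MourreKoopmanCharges.StressStrongMixing :=
  StressStrongMixing_of stub_alexanderFlow stub_flowLocalityDominated stub_torusStressPairForm stub_torusStressPairLocality
    stub_torusStressDiagonalLimitZero stub_torusStressLongWavelength stub_stressRajchman

/-- **Record composition through C1** (shapes 2–10: the a.c.-density form of the spectral stub also closes the crux, via Riemann–Lebesgue). -/
theorem StressStrongMixing_of_C1 (hAlex : AlexanderFlow) (hLocDom : FlowLocalityDominated)
    (hDiag : TorusStressDiagonalLimit) (hC1 : StressSpectralDensity) : CruxStatement :=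
  cruxStatement_of_shape11 hAlex hLocDom hDiag (stressRajchman_of_spectralDensity hC1)

/-- **Direct shape-8 composition without the Core / uniqueness detour** (for the record: `c := c_F` for the framework `F` of A;
`s = 0` by the closed statics `torusStressMoment_zero` and B2zero; `s > 0` by B2all at that `F`; decay by C). -/
theorem StressStrongMixing_of_direct (h : StressFramework ∧ TorusStressIdentificationPosAll ∧ StressRajchman) :
    CruxStatement := by
  obtain ⟨hA, hall, hC⟩ := h
  obtain ⟨σ₁, hσ₁, H₁⟩ := hA
  obtain ⟨σ₂, hσ₂, H₂⟩ := hall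
  obtain ⟨σ₃, hσ₃, H₃⟩ := hC
  refine ⟨min (min σ₁ (min σ₂ σ₃)) (1 / 2), lt_min (lt_min hσ₁ (lt_min hσ₂ hσ₃)) (by norm_num), ?_⟩
  intro σ hσ hσlt θ hθ
  have h₁ : σ < σ₁ := lt_of_lt_of_le hσlt ((min_le_left _ _).trans (min_le_left _ _))
  have h₂ : σ < σ₂ := lt_of_lt_of_le hσlt ((min_le_left _ _).trans ((min_le_right _ _).trans (min_le_left _ _)))
  have h₃ : σ < σ₃ := lt_of_lt_of_le hσlt ((min_le_left _ _).trans ((min_le_right _ _).trans (min_le_right _ _)))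
  have hhalf : σ ≤ 1 / 2 := (lt_of_lt_of_le hσlt (min_le_right _ _)).le
  obtain ⟨z, hz, F, hF⟩ := H₁ σ hσ h₁ θ hθ
  refine ⟨stressAutocorrelation F, H₃ σ hσ h₃ θ hθ z hz F hF, ?_⟩
  intro Φ χ₁ χ₂ hχ₁ hχ₂ s hs
  rcases hs.lt_or_eq with hs' | hs'
  · exact H₂ σ hσ h₂ θ hθ z hz F hF Φ χ₁ χ₂ hχ₁ hχ₂ s hs'
  · subst hs'
    have hc0 : stressAutocorrelation F 0 = θ ^ 2 := stub_stressAutocorrelationZero σ θ z hσ hθ hz F hF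
    have hconst : ∀ N : ℕ, torusStressMoment σ θ Φ χ₁ χ₂ 0 N = θ ^ 2 * ∫ x, χ₁ x * χ₂ x := fun N =>
      Summit.AtomisticToContinuum.HydrodynamicLimit.Theorems.MourreKoopmanChargesStressStrongMixing.torusStressMoment_zero
        σ hhalf θ hθ Φ χ₁ χ₂ hχ₁ hχ₂ N
    show Tendsto (fun N : ℕ => torusStressMoment σ θ Φ χ₁ χ₂ 0 N) atTop (𝓝 (stressAutocorrelation F 0 * ∫ x, χ₁ x * χ₂ x))
    rw [hc0, funext hconst]
    exact tendsto_const_nhds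

/-- **The MINIMAL load-bearing cut** (lead c3, for the record): the crux already follows from the stubs
B2pos, B2zero (closed in cycle 3) and C alone — take the framework `F` FROM B2pos (it asserts one exists) instead of from A, so that
neither the A-side inputs (Alexander existence, Fcov, F3a, F3b, Ruelle) nor the uniqueness inputs (Alexander
uniqueness, LowDensU3/M4, used only to upgrade the identification from that `F` to every framework) are needed for
the implication itself.  They remain registered because they are exactly the published / known-kind inputs a proof
of B2pos's existence half consumes (landed assembly `stressFramework_of_min`) and because the `∀ F` upgrade
(`torusStressCovIdentification_of`) is what makes `c := c_F` canonical. -/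
theorem StressStrongMixing_of_min (h : TorusStressIdentificationPos ∧ StressRajchman) :
    CruxStatement := by
  obtain ⟨hpos, hC⟩ := h
  have hcore : TorusStressIdentificationCore :=
    torusStressIdentificationCore_of_pos_of_zero hpos stub_stressAutocorrelationZero
  obtain ⟨σ₂, hσ₂, H₂⟩ := hcore
  obtain ⟨σ₃, hσ₃, H₃⟩ := hC
  refine ⟨min (min σ₂ σ₃) (1 / 2), lt_min (lt_min hσ₂ hσ₃) (by norm_num), ?_⟩
  intro σ hσ hσlt θ hθ
  have h₂ : σ < σ₂ := lt_of_lt_of_le hσlt ((min_le_left _ _).trans (min_le_left _ _))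
  have h₃ : σ < σ₃ := lt_of_lt_of_le hσlt ((min_le_left _ _).trans (min_le_right _ _))
  have hhalf : σ ≤ 1 / 2 := (lt_of_lt_of_le hσlt (min_le_right _ _)).le
  obtain ⟨z, hz, F, hF, H⟩ := H₂ σ hσ h₂ θ hθ
  refine ⟨stressAutocorrelation F, H₃ σ hσ h₃ θ hθ z hz F hF, ?_⟩
  intro Φ χ₁ χ₂ hχ₁ hχ₂ s hs
  have hfun : (fun N : ℕ => torusStressMoment σ θ Φ χ₁ χ₂ s N) = fun N : ℕ => torusStressCov σ θ Φ χ₁ χ₂ s N :=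
    funext fun N => stub_torusStressRawEqCov σ hσ hhalf θ hθ Φ χ₁ χ₂ hχ₁ hχ₂ s N
  exact (show Tendsto (fun N : ℕ => torusStressMoment σ θ Φ χ₁ χ₂ s N) atTop
      (𝓝 (stressAutocorrelation F s * ∫ x, χ₁ x * χ₂ x)) from hfun ▸ H Φ χ₁ χ₂ hχ₁ hχ₂ s hs)

end Summit.AtomisticToContinuum.HydrodynamicLimit.Cruxes.StressStrongMixing.Birth

end
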